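import Mathlib
import Literature.NumberTheory.DiophantineGeometry.MultiplicativeGroupApproximationProofs
import Literature.NumberTheory.DiophantineGeometry.PadicLogFormsKummerFree
import Literature.NumberTheory.DiophantineGeometry.MultiplicativeGroupApproximationProp434Proofs
import Mathlib.Analysis.Complex.ExponentialBounds
import Literature.Barriers.ABC.BakerMethodBoundsStewartTijdemanGenericProofs
import HarnessLib

/-!
# The signed principal-unit lattice and the reduction WP-M of `p`-adic linear forms in logarithms of primes to Kummer-free principal generators; the glue to the one-prime bound; the odd-prime socket of the abc assembly (re-homed cell library `abc-stewartyu`)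

**Part III of IV.** RE-HOMED into `Literature/` by the Hodge foundations lane (`lit-hodgefound`, prover p20, generation 39): verbatim
DECLARATION-LEVEL port of the cell library `Summits/ABC/StewartYu/*.lean` (cell `abc-stewartyu`: the kernel `p`-adic Baker
bound for logarithms of rational primes and its abc consequences), namespace `Summit.ABC.StewartYu` re-rooted to
`Literature.NumberTheory.Transcendental.StewartYu`; the declarations the cell had placed inside the Literature namespaces
`Literature.NumberTheory.Transcendental.PadicCW77.Setup` / `….CW77.Setup` (dot-notation helpers on the tree's set-up records)
keep their namespace and get a trailing prime (`toQ'`, `Φ_half'`, `SizeHyp.abs_γ_le_p'`, …) because their un-primed names are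
taken by the Summits twins; imports from `Literature/` and Mathlib only; one `section PartK` per source module in dependency
order; no `sorry`, no new axiom, NO named fact (D-0026) — every declaration is a definition with a body or a proved theorem, and
every one keeps its source docstring with a `[cite: …]` locator (the Part's default where the source had `[folklore]` or none).
Sources followed by the cell: M. Waldschmidt, *A lower bound for linear forms in logarithms*, Acta Arith. 37 (1980) 257–283,
§3 [Waldschmidt1980]; P. L. Cijsouw, M. Waldschmidt, *Linear forms and simultaneous approximations* (1977) [CijsouwWaldschmidt1977];
K. Yu, *Linear forms in p-adic logarithms* I–II, Acta Arith. 53 (1989), Compositio Math. 74 (1990) [Yu1989] [Yu1990];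
C. L. Stewart, R. Tijdeman, *On the Oesterlé–Masser conjecture*, Monatsh. Math. 102 (1986) [StewartTijdeman1986];
T. N. Shorey, R. Tijdeman, *Exponential Diophantine Equations* (1986) Ch. 1 [ShoreyTijdeman1986]; C. L. Stewart, K. Yu, Math. Ann.
291 (1991) §3 [StewartYu1991]; J.-H. Evertse, K. Győry, *Unit Equations in Diophantine Number Theory* (2015) Thm 4.3.3
[EvertseGyory2015]; L. Babai, Combinatorica 6 (1986) [Babai1986].

THIS FILE (11 source modules `PrincipalUnitLattice{,Arith,Kummer}`, `WeightedLatticeBasis`, `WeightedLatticeCramer`,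
`PadicLogFormsPrincipalReduction`, `GluePrincipalToPrime`, `PrimePadicSocket{Tools,Log,Rad,Odd}`): the SIGNED PRINCIPAL-UNIT
LATTICE `Λ^± = {z : ∏ q̄ᵢ^{zᵢ} = ±1 in (ℤ/p)ˣ}` of distinct primes `qᵢ ≠ p` (index `≤ p − 1`), the sign-normalised generators
`α̃(z) ≡ 1 (mod p)` attached to a `ℤ`-basis (congruences, multiplicative independence, the Kummer condition for free), Minkowski
II + Mahler's basis theorem in the weighted norm ⇒ **WP-M** `PrincipalLattice.exists_principal_generators` (a basis with
`∏ h(α̃ⱼ) ≤ m^{2m} p ∏ log qᵢ`); the GLUE `primePadicBoundAt_odd_of_principal` (WP-M ∧ any Theorem-A-shaped bound ⇒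
`ord_p(∏ qᵢ^{eᵢ} − 1) ≤ 4704 (32c₁)ⁿ n^{(c₂+2)n} p² (∏ log qᵢ) L_B² L_Q²` at every odd `p`); and the ODD-PRIME SOCKET of the abc
assembly (`bakerShapeBound_of_oddPrime_logRadShape`, `bakerShapeBound_zero_mono`: the one-prime bound at the odd primes alone
gives `log c ≤ κ · rad(abc)^θ`).

WHAT THIS IS NOT: independent of Parts I–II (hypotheses are explicit binders); nothing asserted about abc here.
-/

noncomputable section

/-!
## Part 1 — port of `Summits/ABC/StewartYu/PrincipalUnitLattice.lean` (18 declarations kept)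

# The signed principal-unit lattice of a family of primes

Cell topic `Summits/ABC/StewartYu` (cell abc-stewartyu, HOME `run/shared/lean/pub/abc-stewartyu/`, seat p1); namespace
`Literature.NumberTheory.Transcendental.StewartYu.PrincipalLattice`.

For a prime `p` and natural numbers `q₁, …, q_m` prime to `p` (in the application: distinct primes
`≠ p`), the **signed principal-unit lattice** is
`Λ^± = {z ∈ ℤ^m : ∏ q̄ᵢ^{zᵢ} = ±1 in (ℤ/p)ˣ}`,
the preimage of `{±1}` under the exponent homomorphism `ψ : ℤ^m → (ℤ/p)ˣ`, `ψ(z) = ∏ q̄ᵢ^{zᵢ}`.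
It has index `[ℤ^m : Λ^±] ≤ #(ℤ/p)ˣ = p − 1` (`index_latPM_le`). To `z ∈ Λ^±` one attaches the
**sign-normalised generator** `α̃(z) = χ(z) · ∏ qᵢ^{zᵢ} ∈ ℚ` with the sign `χ(z) ∈ {±1}` chosen so
that `χ(z) ≡ ∏ q̄ᵢ^{zᵢ} (mod p)` (`unitSign`, `signedProd`, `cast_unitSign_eq`); then
`α̃(z) ≡ 1 (mod p)` is a principal unit of `ℚ_p` whose height is `∑ |zᵢ| log qᵢ` — the price of
principalisation is the index `≤ p − 1` of the lattice, paid ONCE, instead of the factor `(p−1)^m`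
of the naive `qᵢ ↦ qᵢ^{p−1}`.

This file only sets up the objects (definitions + their immediate API). The arithmetic of the
generators attached to a `ℤ`-basis of `Λ^±` — congruences, multiplicative independence, the Kummer
condition "no sub-product is a square" (automatic for a BASIS of `Λ^±`), heights — is in
`Summits/ABC/StewartYu/PrincipalUnitLatticeKummer.lean`, and the geometry-of-numbers reduction (a basis with small
heights product, by Minkowski's second theorem and Mahler's basis theorem) in
`Summits/ABC/StewartYu/PadicLogFormsPrincipalReduction.lean`. Together they form work package WP-M ("reduction to signed
principal-unit generators, Kummer condition for free") of the kernel `p`-adic Baker bound for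
logarithms of rational primes (the `p`-adic input of the Stewart–Yu / Stewart–Tijdeman abc bounds,
`Literature/Barriers/ABC/BakerMethodBounds*.lean`); compare the unsigned level-`m₀` lattice of
`Literature.Barriers.ABC.StewartTijdemanPrincipal.exists_principal_lattice`, which yields positive
but not Kummer-free generators.

Design notes. `ψ` is written additively (`ℤ^m →+ Additive (ℤ/p)ˣ`) so that `Λ^±` is an
`AddSubgroup` (`latPM`) and a `ℤ`-submodule (`latPMSub`) of `ℤ^m = Fin m → ℤ`; the residues `q̄ᵢ`
are units via `Units.mk0` under `[Fact p.Prime]` and the hypothesis `(qᵢ : ℤ/p) ≠ 0`. Everything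
here is elementary and [folklore]; no named facts are introduced.
-/

section Part1

open _root_.Finset

namespace Literature.NumberTheory.Transcendental.StewartYu.PrincipalLattice

variable {m : ℕ} {p : ℕ} [hp : Fact p.Prime]

/-! ### The exponent homomorphism and the lattice `Λ^±` -/

/-- The residue `q̄ᵢ ∈ (ℤ/p)ˣ` of a natural number prime to `p`, as a unit (`Units.mk0` in the
field `ℤ/p`). [cite: StewartTijdeman1986, proof of Theorem 1 (the signed principal-unit lattice of a family of primes; definitions)] -/
def resUnit (q : Fin m → ℕ) (hq0 : ∀ i, ((q i : ℕ) : ZMod p) ≠ 0) (i : Fin m) : (ZMod p)ˣ :=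
  Units.mk0 ((q i : ℕ) : ZMod p) (hq0 i)

/-- The exponent homomorphism `ψ : ℤ^m → (ℤ/p)ˣ` (written additively), `ψ(z) = ∏ q̄ᵢ^{zᵢ}`.
[cite: StewartTijdeman1986, proof of Theorem 1 (the signed principal-unit lattice of a family of primes; definitions)] -/
def expHom (q : Fin m → ℕ) (hq0 : ∀ i, ((q i : ℕ) : ZMod p) ≠ 0) :
    (Fin m → ℤ) →+ Additive (ZMod p)ˣ :=
  ∑ i : Fin m, (zmultiplesHom (Additive (ZMod p)ˣ) (Additive.ofMul (resUnit q hq0 i))).comp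
    (Pi.evalAddMonoidHom (fun _ : Fin m => ℤ) i)

/-- `ψ(z) = ∑ zᵢ • q̄ᵢ` (additive notation). [cite: StewartTijdeman1986, proof of Theorem 1 (the signed principal-unit lattice of a family of primes; definitions)] -/
theorem expHom_apply (q : Fin m → ℕ) (hq0 : ∀ i, ((q i : ℕ) : ZMod p) ≠ 0) (z : Fin m → ℤ) :
    expHom q hq0 z = ∑ i, z i • Additive.ofMul (resUnit q hq0 i) := by
  simp [expHom]

/-- `ψ(z) = ∏ q̄ᵢ^{zᵢ}` (multiplicative notation). [cite: StewartTijdeman1986, proof of Theorem 1 (the signed principal-unit lattice of a family of primes; definitions)] -/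
theorem toMul_expHom (q : Fin m → ℕ) (hq0 : ∀ i, ((q i : ℕ) : ZMod p) ≠ 0) (z : Fin m → ℤ) :
    Additive.toMul (expHom q hq0 z) = ∏ i, resUnit q hq0 i ^ z i := by
  rw [expHom_apply]
  simp [toMul_sum, toMul_zsmul]

/-- The sign subgroup `{±1} = ℤ ∙ (−1)` of `(ℤ/p)ˣ` (additive notation). [cite: StewartTijdeman1986, proof of Theorem 1 (the signed principal-unit lattice of a family of primes; definitions)] -/
def signSub (p : ℕ) [Fact p.Prime] : AddSubgroup (Additive (ZMod p)ˣ) :=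
  AddSubgroup.zmultiples (Additive.ofMul (-1))

/-- Membership in the sign subgroup: `x ∈ {±1} ↔ x = 1 ∨ x = −1`. [cite: StewartTijdeman1986, proof of Theorem 1 (the signed principal-unit lattice of a family of primes; definitions)] -/
theorem mem_signSub_iff {x : Additive (ZMod p)ˣ} :
    x ∈ signSub p ↔ Additive.toMul x = 1 ∨ Additive.toMul x = -1 := by
  rw [signSub, AddSubgroup.mem_zmultiples_iff]
  constructor
  · rintro ⟨k, hk⟩
    rw [← hk, toMul_zsmul, toMul_ofMul]
    rcases Int.even_or_odd k with ⟨j, rfl⟩ | ⟨j, rfl⟩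
    · left
      rw [← two_mul, zpow_mul, zpow_two, neg_one_mul, neg_neg, one_zpow]
    · right
      rw [zpow_add, zpow_mul, zpow_two, neg_one_mul, neg_neg, one_zpow, zpow_one, one_mul]
  · rintro (h | h)
    · refine ⟨0, ?_⟩
      apply Additive.toMul.injective
      rw [toMul_zsmul, toMul_ofMul, zpow_zero, h]
    · refine ⟨1, ?_⟩
      apply Additive.toMul.injective
      rw [toMul_zsmul, toMul_ofMul, zpow_one, h]

/-- **The signed principal-unit lattice** `Λ^± = {z ∈ ℤ^m : ∏ q̄ᵢ^{zᵢ} = ±1 in ℤ/p}`. [cite: StewartTijdeman1986, proof of Theorem 1 (the signed principal-unit lattice of a family of primes; definitions)] -/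
def latPM (q : Fin m → ℕ) (hq0 : ∀ i, ((q i : ℕ) : ZMod p) ≠ 0) : AddSubgroup (Fin m → ℤ) :=
  (signSub p).comap (expHom q hq0)

/-- Membership in `Λ^±`: `z ∈ Λ^± ↔ ∏ q̄ᵢ^{zᵢ} = 1 ∨ ∏ q̄ᵢ^{zᵢ} = −1`. [cite: StewartTijdeman1986, proof of Theorem 1 (the signed principal-unit lattice of a family of primes; definitions)] -/
theorem mem_latPM_iff (q : Fin m → ℕ) (hq0 : ∀ i, ((q i : ℕ) : ZMod p) ≠ 0) (z : Fin m → ℤ) :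
    z ∈ latPM q hq0 ↔ (∏ i, resUnit q hq0 i ^ z i = 1 ∨ ∏ i, resUnit q hq0 i ^ z i = -1) := by
  rw [latPM, AddSubgroup.mem_comap, mem_signSub_iff, toMul_expHom]

/-- `ker ψ ≤ Λ^±`. [cite: StewartTijdeman1986, proof of Theorem 1 (the signed principal-unit lattice of a family of primes; definitions)] -/
theorem ker_le_latPM (q : Fin m → ℕ) (hq0 : ∀ i, ((q i : ℕ) : ZMod p) ≠ 0) :
    (expHom q hq0).ker ≤ latPM q hq0 := by
  intro z hz
  rw [AddMonoidHom.mem_ker] at hz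
  rw [latPM, AddSubgroup.mem_comap, hz]
  exact zero_mem _

/-- **The index of `Λ^±` is at most `p − 1`** (`[ℤ^m : Λ^±] ≤ [ℤ^m : ker ψ] = #ψ(ℤ^m) ≤ #(ℤ/p)ˣ`).
[cite: StewartTijdeman1986, proof of Theorem 1 (the signed principal-unit lattice of a family of primes; definitions)] -/
theorem index_latPM_le (q : Fin m → ℕ) (hq0 : ∀ i, ((q i : ℕ) : ZMod p) ≠ 0) :
    (latPM q hq0).index ≤ p - 1 ∧ 0 < (latPM q hq0).index := by
  have hker : (expHom q hq0).ker.index = Nat.card (expHom q hq0).range :=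
    AddSubgroup.index_ker (expHom q hq0)
  have hfin : Finite (Additive (ZMod p)ˣ) := by
    change Finite (ZMod p)ˣ; infer_instance
  have hcardR : Nat.card (expHom q hq0).range ≤ p - 1 := by
    calc Nat.card (expHom q hq0).range ≤ Nat.card (Additive (ZMod p)ˣ) :=
          Nat.card_le_card_of_injective _ Subtype.val_injective
      _ = p - 1 := by
          change Nat.card (ZMod p)ˣ = p - 1
          rw [Nat.card_eq_fintype_card, ZMod.card_units_eq_totient, Nat.totient_prime hp.out]
  have hkerpos : 0 < (expHom q hq0).ker.index := by
    rw [hker]; exact Nat.card_pos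
  have hdvd : (latPM q hq0).index ∣ (expHom q hq0).ker.index :=
    AddSubgroup.index_dvd_of_le (ker_le_latPM q hq0)
  refine ⟨(Nat.le_of_dvd hkerpos hdvd).trans (hker ▸ hcardR), ?_⟩
  exact Nat.pos_of_ne_zero fun h0 => by
    rw [h0] at hdvd; exact absurd (Nat.eq_zero_of_zero_dvd hdvd) hkerpos.ne'

/-! ### `Λ^±` as a `ℤ`-submodule of `ℤ^m` -/

/-- `Λ^±` as a `ℤ`-submodule of `ℤ^m`. [cite: StewartTijdeman1986, proof of Theorem 1 (the signed principal-unit lattice of a family of primes; definitions)] -/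
def latPMSub (q : Fin m → ℕ) (hq0 : ∀ i, ((q i : ℕ) : ZMod p) ≠ 0) : Submodule ℤ (Fin m → ℤ) :=
  (latPM q hq0).toIntSubmodule

/-- The `ℤ`-submodule `Λ^±` has the same elements as the subgroup `Λ^±`. [cite: StewartTijdeman1986, proof of Theorem 1 (the signed principal-unit lattice of a family of primes; definitions)] -/
theorem mem_latPMSub_iff (q : Fin m → ℕ) (hq0 : ∀ i, ((q i : ℕ) : ZMod p) ≠ 0) (z : Fin m → ℤ) :
    z ∈ latPMSub q hq0 ↔ z ∈ latPM q hq0 := Iff.rfl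

/-! ### Sign normalisation: `α̃(z) = χ(z) · ∏ qᵢ^{zᵢ} ≡ 1 (mod p)` -/

/-- The sign `χ(z) ∈ {1, −1}` normalising `∏ qᵢ^{zᵢ}` to a principal unit: `χ(z) = 1` if
`∏ q̄ᵢ^{zᵢ} = 1` in `(ℤ/p)ˣ` and `χ(z) = −1` otherwise (so that `χ(z) ≡ ∏ q̄ᵢ^{zᵢ}` for
`z ∈ Λ^±`). [cite: StewartTijdeman1986, proof of Theorem 1 (the signed principal-unit lattice of a family of primes; definitions)] -/
def unitSign (q : Fin m → ℕ) (hq0 : ∀ i, ((q i : ℕ) : ZMod p) ≠ 0) (z : Fin m → ℤ) : ℤ :=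
  if Additive.toMul (expHom q hq0 z) = 1 then 1 else -1

/-- **The sign-normalised generator** `α̃(z) = χ(z) · ∏ qᵢ^{zᵢ} ∈ ℚ` attached to an exponent
vector `z` (for `z ∈ Λ^±` it is `≡ 1 (mod p)`, `one_le_padicValRat_signedProd_sub_one`).
[cite: StewartTijdeman1986, proof of Theorem 1 (the signed principal-unit lattice of a family of primes; definitions)] -/
def signedProd (q : Fin m → ℕ) (hq0 : ∀ i, ((q i : ℕ) : ZMod p) ≠ 0) (z : Fin m → ℤ) : ℚ :=
  (unitSign q hq0 z : ℚ) * ∏ i, (q i : ℚ) ^ z i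

/-- `χ(z) = ±1`. [cite: StewartTijdeman1986, proof of Theorem 1 (the signed principal-unit lattice of a family of primes; definitions)] -/
theorem unitSign_eq_or (q : Fin m → ℕ) (hq0 : ∀ i, ((q i : ℕ) : ZMod p) ≠ 0) (z : Fin m → ℤ) :
    unitSign q hq0 z = 1 ∨ unitSign q hq0 z = -1 := by
  unfold unitSign; split_ifs <;> simp

/-- For `z ∈ Λ^±`, `χ(z) = ∏ q̄ᵢ^{zᵢ}` in `ℤ/p`. [cite: StewartTijdeman1986, proof of Theorem 1 (the signed principal-unit lattice of a family of primes; definitions)] -/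
theorem cast_unitSign_eq (q : Fin m → ℕ) (hq0 : ∀ i, ((q i : ℕ) : ZMod p) ≠ 0)
    {z : Fin m → ℤ} (hz : z ∈ latPM q hq0) :
    ((unitSign q hq0 z : ℤ) : ZMod p) =
      ((Additive.toMul (expHom q hq0 z) : (ZMod p)ˣ) : ZMod p) := by
  rw [mem_latPM_iff] at hz
  unfold unitSign
  rw [toMul_expHom]
  by_cases h1 : ∏ i, resUnit q hq0 i ^ z i = 1
  · rw [if_pos h1, h1]; push_cast; rfl
  · rw [if_neg h1]
    rcases hz with h | h
    · exact absurd h h1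
    · rw [h, Units.val_neg, Units.val_one]; push_cast; rfl

/-- For `z ∈ Λ^±`, `(∏ q̄ᵢ^{zᵢ})² = 1` in `ℤ/p`. [cite: StewartTijdeman1986, proof of Theorem 1 (the signed principal-unit lattice of a family of primes; definitions)] -/
theorem val_toMul_expHom_sq (q : Fin m → ℕ) (hq0 : ∀ i, ((q i : ℕ) : ZMod p) ≠ 0)
    {z : Fin m → ℤ} (hz : z ∈ latPM q hq0) :
    ((Additive.toMul (expHom q hq0 z) : (ZMod p)ˣ) : ZMod p) ^ 2 = 1 := by
  rw [mem_latPM_iff] at hz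
  rw [toMul_expHom]
  rcases hz with h | h <;> rw [h] <;> simp

/-- Reduction of numerator and denominator: in `ℤ/p`,
`(∏ q̄ᵢ^{zᵢ}) · ∏ qᵢ^{zᵢ⁻} = ∏ qᵢ^{zᵢ⁺}`. [cite: StewartTijdeman1986, proof of Theorem 1 (the signed principal-unit lattice of a family of primes; definitions)] -/
theorem val_toMul_expHom_mul_den (q : Fin m → ℕ) (hq0 : ∀ i, ((q i : ℕ) : ZMod p) ≠ 0)
    (z : Fin m → ℤ) :
    ((Additive.toMul (expHom q hq0 z) : (ZMod p)ˣ) : ZMod p) *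
        ((∏ i, q i ^ (-z i).toNat : ℕ) : ZMod p) = ((∏ i, q i ^ (z i).toNat : ℕ) : ZMod p) := by
  rw [toMul_expHom]
  have h1 : (∏ i, resUnit q hq0 i ^ z i) * (∏ i, resUnit q hq0 i ^ (-z i).toNat) =
      ∏ i, resUnit q hq0 i ^ (z i).toNat := by
    rw [← Finset.prod_mul_distrib]
    refine Finset.prod_congr rfl fun i _ => ?_
    rw [← zpow_natCast, ← zpow_natCast, ← zpow_add]
    congr 1
    have := Int.toNat_sub_toNat_neg (z i)
    omega
  have h2 := congrArg (fun u : (ZMod p)ˣ => (u : ZMod p)) h1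
  simp only [Units.val_mul, Units.coe_prod, Units.val_pow_eq_pow_val,
    Units.val_zpow_eq_zpow_val] at h2
  have h3 : ∀ (i : Fin m) (n : ℕ), ((resUnit q hq0 i : (ZMod p)ˣ) : ZMod p) ^ n
      = ((q i : ℕ) : ZMod p) ^ n := fun i n => by rw [resUnit, Units.val_mk0]
  simp only [h3] at h2
  push_cast
  exact h2

end Literature.NumberTheory.Transcendental.StewartYu.PrincipalLattice

end Part1

/-!
## Part 2 — port of `Summits/ABC/StewartYu/PrincipalUnitLatticeArith.lean` (11 declarations kept)

# The signed principal-unit lattice: valuations and the bridge to `ord_p`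

Cell topic `Summits/ABC/StewartYu` (cell abc-stewartyu, HOME `run/shared/lean/pub/abc-stewartyu/`, seat p1); namespace
`Literature.NumberTheory.Transcendental.StewartYu.PrincipalLattice` (continuation of
`Summits/ABC/StewartYu/PrincipalUnitLattice.lean`; theorems only).

Let `p` be a prime, `q₁, …, q_m` DISTINCT primes `≠ p`, `Λ^± ≤ ℤ^m` the signed principal-unit lattice
and `α̃(z) = χ(z) ∏ qᵢ^{zᵢ}` the sign-normalised generator of `z ∈ Λ^±`. This file proves:

* valuations: `ord_{qᵢ}(∏ q_k^{z_k}) = zᵢ` (`padicValRat_prod_zpow`), so `∏ qᵢ^{zᵢ} = 1 ⇒ z = 0`;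
* the bridge to `p`-adic valuations: `ord_p(α̃(z) − 1) ≥ 1` for `z ∈ Λ^± ∖ {0}`
  (`one_le_padicValRat_signedProd_sub_one`), and conversely `ord_p(∏ qᵢ^{eᵢ} − 1) ≥ 1 ⇒ e ∈ ker ψ ≤ Λ^±`
  (`expHom_eq_zero_of_one_le_padicValRat`, `mem_latPM_of_one_le_padicValRat`);

(The basis lemmas — independence, Kummer condition, the main identity — and the heights are in
`Summits/ABC/StewartYu/PrincipalUnitLatticeKummer.lean`.)

These are the algebraic steps (M1)–(M3), (M6) of work package WP-M of the kernel `p`-adic Baker bound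
(cell abc-stewartyu); the Kummer condition is exactly the hypothesis `hind` consumed by the
Cijsouw–Waldschmidt 2-descent (`Literature/NumberTheory/Transcendental/CijsouwWaldschmidt1977Steps.lean`).
All statements are elementary and [folklore].
-/

section Part2

open _root_.Finset
open Literature.NumberTheory.DiophantineGeometry

namespace Literature.NumberTheory.Transcendental.StewartYu.PrincipalLattice

variable {m : ℕ} {p : ℕ} [hp : Fact p.Prime]

/-! ### The rational numbers `∏ qᵢ^{zᵢ}`: valuations, positivity -/

/-- `ord_ℓ` of a finite product of non-zero rationals is the sum of the `ord_ℓ`. [cite: StewartTijdeman1986, proof of Theorem 1 (arithmetic of the sign-normalised generators)] -/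
theorem padicValRat_finset_prod {ℓ : ℕ} [Fact ℓ.Prime] {ι : Type*} (s : Finset ι) (f : ι → ℚ)
    (hf : ∀ i ∈ s, f i ≠ 0) : padicValRat ℓ (∏ i ∈ s, f i) = ∑ i ∈ s, padicValRat ℓ (f i) := by
  classical
  induction s using Finset.induction_on with
  | empty => simp
  | insert a s ha ih =>
    rw [Finset.prod_insert ha, Finset.sum_insert ha,
      padicValRat.mul (hf a (Finset.mem_insert_self a s))
        (Finset.prod_ne_zero_iff.mpr fun i hi => hf i (Finset.mem_insert_of_mem hi)),
      ih fun i hi => hf i (Finset.mem_insert_of_mem hi)]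

/-- `ord_{qᵢ}(∏ q_k^{z_k}) = zᵢ` for distinct primes `q_k`. [cite: StewartTijdeman1986, proof of Theorem 1 (arithmetic of the sign-normalised generators)] -/
theorem padicValRat_prod_zpow (q : Fin m → ℕ) (hq : ∀ i, (q i).Prime)
    (hinj : Function.Injective q) (z : Fin m → ℤ) (i : Fin m) :
    padicValRat (q i) (∏ k, (q k : ℚ) ^ z k) = z i := by
  haveI : Fact (q i).Prime := ⟨hq i⟩
  have hq0 : ∀ k, (q k : ℚ) ≠ 0 := fun k => by exact_mod_cast (hq k).ne_zero
  rw [padicValRat_finset_prod _ _ fun k _ => zpow_ne_zero _ (hq0 k), Finset.sum_eq_single i]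
  · rw [padicValRat.zpow, padicValRat.self (hq i).one_lt, mul_one]
  · intro k _ hki
    haveI : Fact (q k).Prime := ⟨hq k⟩
    rw [padicValRat.zpow, padicValRat.of_nat,
      padicValNat_primes (fun h => hki (hinj h).symm)]
    simp
  · intro h; exact absurd (Finset.mem_univ i) h

/-- `∏ qᵢ^{zᵢ} > 0`. [cite: StewartTijdeman1986, proof of Theorem 1 (arithmetic of the sign-normalised generators)] -/
theorem prod_zpow_pos (q : Fin m → ℕ) (hq : ∀ i, (q i).Prime) (z : Fin m → ℤ) :
    0 < ∏ k, (q k : ℚ) ^ z k :=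
  Finset.prod_pos fun k _ => zpow_pos (by exact_mod_cast (hq k).pos) _

/-- `∏ qᵢ^{zᵢ} = 1` only for `z = 0` (unique factorisation). [cite: StewartTijdeman1986, proof of Theorem 1 (arithmetic of the sign-normalised generators)] -/
theorem eq_zero_of_prod_zpow_eq_one (q : Fin m → ℕ) (hq : ∀ i, (q i).Prime)
    (hinj : Function.Injective q) {z : Fin m → ℤ} (h : ∏ k, (q k : ℚ) ^ z k = 1) : z = 0 := by
  funext i
  have := padicValRat_prod_zpow q hq hinj z i
  rw [h, padicValRat.one] at this
  exact_mod_cast this.symm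

/-- In a division ring, `s^c = s^{|c|}` for a sign `s = ±1`. [cite: StewartTijdeman1986, proof of Theorem 1 (arithmetic of the sign-normalised generators)] -/
theorem sign_zpow_eq_pow_natAbs {K : Type*} [DivisionRing K] {s : K} (hs : s = 1 ∨ s = -1)
    (c : ℤ) : s ^ c = s ^ c.natAbs := by
  rcases hs with rfl | rfl
  · simp
  · rcases Int.natAbs_eq c with h | h
    · conv_lhs => rw [h]
      exact zpow_natCast _ _
    · conv_lhs => rw [h]
      rw [zpow_neg, zpow_natCast, inv_eq_iff_eq_inv]
      rcases neg_one_pow_eq_or K c.natAbs with h1 | h1 <;> rw [h1] <;> norm_num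

/-- `p` divides no product of powers of primes `qᵢ ≠ p`. [cite: StewartTijdeman1986, proof of Theorem 1 (arithmetic of the sign-normalised generators)] -/
theorem not_dvd_prod_pow (q : Fin m → ℕ) (hq : ∀ i, (q i).Prime) (hqp : ∀ i, q i ≠ p)
    (f : Fin m → ℕ) : ¬ p ∣ ∏ i, q i ^ f i := by
  intro h
  have hp' : _root_.Prime p := Nat.prime_iff.mp hp.out
  obtain ⟨i, -, hi⟩ := (hp'.dvd_finsetProd_iff _).mp h
  have h1 : p ∣ q i := hp.out.dvd_of_dvd_pow hi
  exact hqp i ((Nat.prime_dvd_prime_iff_eq hp.out (hq i)).mp h1).symm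

/-- `∏ qᵢ^{zᵢ} = U/V` with `U = ∏ qᵢ^{zᵢ⁺}`, `V = ∏ qᵢ^{zᵢ⁻}`. [cite: StewartTijdeman1986, proof of Theorem 1 (arithmetic of the sign-normalised generators)] -/
theorem prod_zpow_eq_div' (q : Fin m → ℕ) (hq : ∀ i, (q i).Prime) (z : Fin m → ℤ) :
    ∏ i, ((q i : ℚ)) ^ z i =
      ((∏ i, q i ^ (z i).toNat : ℕ) : ℚ) / ((∏ i, q i ^ (-z i).toNat : ℕ) : ℚ) := by
  push_cast
  rw [← Finset.prod_div_distrib]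
  refine Finset.prod_congr rfl fun i _ => ?_
  have hqi : (q i : ℚ) ≠ 0 := by exact_mod_cast (hq i).ne_zero
  rw [← zpow_natCast, ← zpow_natCast, ← zpow_sub₀ hqi]
  congr 1
  exact (Int.toNat_sub_toNat_neg (z i)).symm

/-- `ord_p(s·U/V − 1) = ord_p(sU − V)` for an integer `s`, naturals `U, V` with `p ∤ V`,
`sU ≠ V`. [cite: StewartTijdeman1986, proof of Theorem 1 (arithmetic of the sign-normalised generators)] -/
theorem padicValRat_sign_mul_div_sub_one {U V : ℕ} (hV0 : V ≠ 0) (hpV : ¬ p ∣ V) (s : ℤ)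
    (hne : s * U - V ≠ 0) :
    padicValRat p ((s : ℚ) * ((U : ℚ) / V) - 1) = padicValInt p (s * U - V) := by
  have hVQ : (V : ℚ) ≠ 0 := by exact_mod_cast hV0
  have h1 : (s : ℚ) * ((U : ℚ) / V) - 1 = (((s * U - V : ℤ)) : ℚ) / (V : ℚ) := by
    push_cast; field_simp
  rw [h1, padicValRat.div (by exact_mod_cast hne) hVQ, padicValRat.of_int, padicValRat.of_nat,
    padicValNat.eq_zero_of_not_dvd hpV]
  simp

/-- **Principal units from `Λ^±`.** For `z ∈ Λ^±`, `z ≠ 0`, and primes `qᵢ ≠ p` (distinct):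
`ord_p(α̃(z) − 1) ≥ 1`, i.e. `α̃(z) ≡ 1 (mod p)` (write `α̃(z) = χ U/V`; in `ℤ/p`,
`χ Ū = (∏ q̄ᵢ^{zᵢ})² V̄ = V̄`, and `χU ≠ V` as `z ≠ 0`). [cite: StewartTijdeman1986, proof of Theorem 1 (arithmetic of the sign-normalised generators)] -/
theorem one_le_padicValRat_signedProd_sub_one (q : Fin m → ℕ) (hq : ∀ i, (q i).Prime)
    (hinj : Function.Injective q) (hqp : ∀ i, q i ≠ p) (hq0 : ∀ i, ((q i : ℕ) : ZMod p) ≠ 0)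
    {z : Fin m → ℤ} (hz : z ∈ latPM q hq0) (hz0 : z ≠ 0) :
    1 ≤ padicValRat p (signedProd q hq0 z - 1) := by
  set U : ℕ := ∏ i, q i ^ (z i).toNat with hU
  set V : ℕ := ∏ i, q i ^ (-z i).toNat with hV
  have hU0 : U ≠ 0 := Finset.prod_ne_zero_iff.mpr fun i _ => pow_ne_zero _ (hq i).ne_zero
  have hV0 : V ≠ 0 := Finset.prod_ne_zero_iff.mpr fun i _ => pow_ne_zero _ (hq i).ne_zero
  have hpV : ¬ p ∣ V := not_dvd_prod_pow q hq hqp _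
  have hprod : ∏ i, (q i : ℚ) ^ z i = (U : ℚ) / V := prod_zpow_eq_div' q hq z
  set s : ℤ := unitSign q hq0 z with hs
  -- `s U ≠ V`
  have hne : s * U - V ≠ 0 := by
    intro h
    rcases unitSign_eq_or q hq0 z with h1 | h1
    · rw [← hs] at h1
      rw [h1, one_mul, sub_eq_zero] at h
      have hUV : (U : ℚ) = V := by exact_mod_cast h
      apply hz0
      apply eq_zero_of_prod_zpow_eq_one q hq hinj
      rw [hprod, hUV, div_self (by exact_mod_cast hV0)]
    · rw [← hs] at h1
      rw [h1] at h
      have : (0 : ℤ) < U + V := by positivity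
      omega
  -- the congruence `s U ≡ V (mod p)`
  have hcong : ((s * U - V : ℤ) : ZMod p) = 0 := by
    have hsq := val_toMul_expHom_sq q hq0 hz
    have hden := val_toMul_expHom_mul_den q hq0 z
    have hsgn := cast_unitSign_eq q hq0 hz
    rw [← hs] at hsgn
    push_cast
    rw [hsgn, ← hden, ← mul_assoc, ← sq, hsq, one_mul, sub_self]
  have hdvd : (p : ℤ) ∣ s * U - V := (ZMod.intCast_zmod_eq_zero_iff_dvd _ p).mp hcong
  -- the valuation
  have hval : padicValRat p (signedProd q hq0 z - 1) = padicValInt p (s * U - V) := by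
    unfold signedProd
    rw [hprod, ← hs]
    exact padicValRat_sign_mul_div_sub_one hV0 hpV s hne
  rw [hval]
  rcases (padicValInt_dvd_iff 1 (s * U - V)).mp (by rwa [pow_one]) with h | h
  · exact absurd h hne
  · exact_mod_cast h

/-- If `ord_p(∏ qᵢ^{eᵢ} − 1) ≥ 1` then `∏ q̄ᵢ^{eᵢ} = 1` in `(ℤ/p)ˣ`: `e` lies in the kernel of
the exponent map, in particular in `Λ^±`. [cite: StewartTijdeman1986, proof of Theorem 1 (arithmetic of the sign-normalised generators)] -/
theorem expHom_eq_zero_of_one_le_padicValRat (q : Fin m → ℕ) (hq : ∀ i, (q i).Prime)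
    (hqp : ∀ i, q i ≠ p) (hq0 : ∀ i, ((q i : ℕ) : ZMod p) ≠ 0) {e : Fin m → ℤ}
    (he : 1 ≤ padicValRat p (∏ i, (q i : ℚ) ^ e i - 1)) : expHom q hq0 e = 0 := by
  set U : ℕ := ∏ i, q i ^ (e i).toNat with hU
  set V : ℕ := ∏ i, q i ^ (-e i).toNat with hV
  have hV0 : V ≠ 0 := Finset.prod_ne_zero_iff.mpr fun i _ => pow_ne_zero _ (hq i).ne_zero
  have hpV : ¬ p ∣ V := not_dvd_prod_pow q hq hqp _
  have hprod : ∏ i, (q i : ℚ) ^ e i = (U : ℚ) / V := prod_zpow_eq_div' q hq e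
  have hne : (1 : ℤ) * U - V ≠ 0 := by
    intro h
    rw [one_mul, sub_eq_zero] at h
    have hUV : (U : ℚ) = V := by exact_mod_cast h
    rw [hprod, hUV, div_self (by exact_mod_cast hV0), sub_self, padicValRat.zero] at he
    exact absurd he (by norm_num)
  have hval : padicValRat p (∏ i, (q i : ℚ) ^ e i - 1) = padicValInt p (1 * U - V) := by
    rw [hprod, ← padicValRat_sign_mul_div_sub_one hV0 hpV 1 hne]
    push_cast; rw [one_mul]
  rw [hval] at he
  have hdvd : (p : ℤ) ^ 1 ∣ 1 * U - V :=
    (padicValInt_dvd_iff 1 _).mpr (Or.inr (by exact_mod_cast he))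
  rw [pow_one, one_mul] at hdvd
  have hUV : (U : ZMod p) = (V : ZMod p) := by
    have := (ZMod.intCast_eq_intCast_iff_dvd_sub (V : ℤ) (U : ℤ) p).mpr hdvd
    push_cast at this
    exact this.symm
  have hden := val_toMul_expHom_mul_den q hq0 e
  rw [← hU, ← hV, hUV] at hden
  have hVne : (V : ZMod p) ≠ 0 := fun h => hpV ((ZMod.natCast_eq_zero_iff V p).mp h)
  have h1 : ((Additive.toMul (expHom q hq0 e) : (ZMod p)ˣ) : ZMod p) = 1 :=
    mul_right_cancel₀ hVne (by rw [hden, one_mul])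
  have h2 : Additive.toMul (expHom q hq0 e) = 1 := Units.val_eq_one.mp h1
  exact toMul_eq_one.mp h2

/-- The hypothesis `ord_p(∏ qᵢ^{eᵢ} − 1) ≥ 1` puts `e` in `Λ^±`. [cite: StewartTijdeman1986, proof of Theorem 1 (arithmetic of the sign-normalised generators)] -/
theorem mem_latPM_of_one_le_padicValRat (q : Fin m → ℕ) (hq : ∀ i, (q i).Prime)
    (hqp : ∀ i, q i ≠ p) (hq0 : ∀ i, ((q i : ℕ) : ZMod p) ≠ 0) {e : Fin m → ℤ}
    (he : 1 ≤ padicValRat p (∏ i, (q i : ℚ) ^ e i - 1)) : e ∈ latPM q hq0 :=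
  ker_le_latPM q hq0 ((AddMonoidHom.mem_ker).mpr
    (expHom_eq_zero_of_one_le_padicValRat q hq hqp hq0 he))

end Literature.NumberTheory.Transcendental.StewartYu.PrincipalLattice

end Part2

/-!
## Part 3 — port of `Summits/ABC/StewartYu/PrincipalUnitLatticeKummer.lean` (13 declarations kept)

# The signed principal-unit lattice: independence, Kummer condition, heights

Cell topic `Summits/ABC/StewartYu` (cell abc-stewartyu, HOME `run/shared/lean/pub/abc-stewartyu/`, seat p1); namespace
`Literature.NumberTheory.Transcendental.StewartYu.PrincipalLattice` (continuation of
`Summits/ABC/StewartYu/PrincipalUnitLattice.lean`; theorems only).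

Let `p` be a prime, `q₁, …, q_m` DISTINCT primes `≠ p`, `Λ^± ≤ ℤ^m` the signed principal-unit lattice
and `α̃(z) = χ(z) ∏ qᵢ^{zᵢ}` the sign-normalised generator of `z ∈ Λ^±`. This file proves:

(valuations and the bridge `ord_p(α̃(z) − 1) ≥ 1` are in `PrincipalUnitLatticeArith.lean`)

* for a `ℤ`-BASIS `b` of `Λ^±` and the generators `αⱼ = α̃(bⱼ)`: the product formula
  `∏ αⱼ^{cⱼ} = (∏ χ(bⱼ)^{|cⱼ|}) · ∏ qᵢ^{(∑ cⱼbⱼ)ᵢ}` (`prod_signedProd_zpow`), multiplicative independence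
  (`signedProd_basis_independent`), the **Kummer condition for free** — no non-empty sub-product of
  the `αⱼ` is a square in `ℚ` (`not_isSquare_prod_signedProd_basis`, DERIVED from p2's `PadicKummer.not_isSquare_prod_gen_basis_zmod` via `latPMSub_eq_pmLattice`/`signedProd_eq_gen`: a square sub-product
  `∏_{j∈T} αⱼ = r²` has exponent vector `∑_{j∈T} bⱼ = 2u` with `(∏ q̄ᵢ^{uᵢ})² = 1`, so `u ∈ Λ^±` and the
  indicator of `T` would be `≡ 0 (mod 2)` in basis coordinates) —, and the main identity
  `∏ qᵢ^{eᵢ} = ∏ αⱼ^{e'ⱼ}` for `e ∈ ker ψ` with basis coordinates `e'`, the sign being `+1` because it is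
  `≡ ψ(e) = 1 (mod p)` and `p ≠ 2` (`prod_signedProd_zpow_repr`);
* heights: `h(α̃(z)) ≤ ∑ |zᵢ| log qᵢ` (`logHeight₁_signedProd_le`) and the floor `log p ≤ 2 h(α)` for any
  `α ∈ ℚ` with `ord_p(α − 1) ≥ 1`, `p` odd (`log_le_two_mul_logHeight₁`, via the tree's
  `Dioph.padicValRat_mul_log_le_logHeight₁`, `Dioph.logHeight₁_one_sub_le`, `Dioph.log_two_le_logHeight₁`).

These are the algebraic steps (M1)–(M3), (M6) of work package WP-M of the kernel `p`-adic Baker bound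
(cell abc-stewartyu); the Kummer condition is exactly the hypothesis `hind` consumed by the
Cijsouw–Waldschmidt 2-descent (`Literature/NumberTheory/Transcendental/CijsouwWaldschmidt1977Steps.lean`).
All statements are elementary and [folklore].
-/

section Part3

open _root_.Finset
open Literature.NumberTheory.DiophantineGeometry

namespace Literature.NumberTheory.Transcendental.StewartYu.PrincipalLattice

variable {m : ℕ} {p : ℕ} [hp : Fact p.Prime]

/-! ### Generators attached to a `ℤ`-basis of `Λ^±`: products, independence, Kummer condition -/

/-- `a^{∑ f} = ∏ a^{f}` for a non-zero element of a division ring. [cite: StewartTijdeman1986, proof of Theorem 1 (generators attached to a basis of the lattice: congruences, independence, the Kummer condition)] -/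
theorem zpow_finset_sum {K : Type*} [Field K] {ι : Type*} (s : Finset ι) {a : K} (ha : a ≠ 0)
    (f : ι → ℤ) : a ^ (∑ i ∈ s, f i) = ∏ i ∈ s, a ^ f i := by
  classical
  induction s using Finset.induction_on with
  | empty => simp
  | insert i s hi ih => rw [Finset.sum_insert hi, Finset.prod_insert hi, zpow_add₀ ha, ih]

/-- A product of signs `±1` is a sign. [cite: StewartTijdeman1986, proof of Theorem 1 (generators attached to a basis of the lattice: congruences, independence, the Kummer condition)] -/
theorem prod_sign_eq_or {ι : Type*} (s : Finset ι) (f : ι → ℤ)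
    (hf : ∀ j ∈ s, f j = 1 ∨ f j = -1) : ∏ j ∈ s, f j = 1 ∨ ∏ j ∈ s, f j = -1 := by
  classical
  induction s using Finset.induction_on with
  | empty => simp
  | insert a s ha ih =>
    rw [Finset.prod_insert ha]
    rcases hf a (Finset.mem_insert_self a s) with h | h <;>
      rcases ih (fun j hj => hf j (Finset.mem_insert_of_mem hj)) with h' | h' <;>
      rw [h, h'] <;> norm_num

section BasisLemmas

variable (q : Fin m → ℕ) (hq0 : ∀ i, ((q i : ℕ) : ZMod p) ≠ 0)
  (b : Module.Basis (Fin m) ℤ (latPMSub q hq0))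

/-- **Products of the generators.** For a `ℤ`-basis `b` of `Λ^±` and `c ∈ ℤ^m`:
`∏ⱼ α̃(bⱼ)^{cⱼ} = S · ∏ᵢ qᵢ^{(∑ⱼ cⱼ bⱼ)ᵢ}` with the sign `S = ∏ⱼ χ(bⱼ)^{|cⱼ|}`. [cite: StewartTijdeman1986, proof of Theorem 1 (generators attached to a basis of the lattice: congruences, independence, the Kummer condition)] -/
theorem prod_signedProd_zpow (hq : ∀ i, (q i).Prime) (c : Fin m → ℤ) :
    ∏ j, signedProd q hq0 (b j : Fin m → ℤ) ^ c j =
      ((∏ j, unitSign q hq0 (b j : Fin m → ℤ) ^ (c j).natAbs : ℤ) : ℚ) *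
        ∏ i, (q i : ℚ) ^ (∑ j, c j • (b j : Fin m → ℤ)) i := by
  have hq0Q : ∀ i, (q i : ℚ) ≠ 0 := fun i => by exact_mod_cast (hq i).ne_zero
  unfold signedProd
  simp_rw [mul_zpow, Finset.prod_mul_distrib]
  congr 1
  · push_cast
    refine Finset.prod_congr rfl fun j _ => ?_
    have hs : ((unitSign q hq0 (b j : Fin m → ℤ) : ℤ) : ℚ) = 1 ∨
        ((unitSign q hq0 (b j : Fin m → ℤ) : ℤ) : ℚ) = -1 := by
      rcases unitSign_eq_or q hq0 (b j : Fin m → ℤ) with h | h <;> rw [h] <;> norm_num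
    exact sign_zpow_eq_pow_natAbs hs (c j)
  · have h1 : ∀ j, (∏ i, (q i : ℚ) ^ (b j : Fin m → ℤ) i) ^ c j =
        ∏ i, (q i : ℚ) ^ (c j * (b j : Fin m → ℤ) i) := by
      intro j
      rw [← Finset.prod_zpow]
      refine Finset.prod_congr rfl fun i _ => ?_
      rw [← zpow_mul, mul_comm]
    simp_rw [h1]
    rw [Finset.prod_comm]
    refine Finset.prod_congr rfl fun i _ => ?_
    rw [show (∑ j, c j • (b j : Fin m → ℤ)) i = ∑ j, c j * (b j : Fin m → ℤ) i by
      simp [Finset.sum_apply], zpow_finset_sum _ (hq0Q i)]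

/-- **The sign of a product reduces to the exponent map**: for a `ℤ`-basis `b` of `Λ^±`,
`∏ⱼ χ(bⱼ)^{|cⱼ|} ≡ ∏ᵢ q̄ᵢ^{(∑ⱼ cⱼ bⱼ)ᵢ} (mod p)`. [cite: StewartTijdeman1986, proof of Theorem 1 (generators attached to a basis of the lattice: congruences, independence, the Kummer condition)] -/
theorem cast_prod_unitSign_pow (c : Fin m → ℤ) :
    ((∏ j, unitSign q hq0 (b j : Fin m → ℤ) ^ (c j).natAbs : ℤ) : ZMod p) =
      ((Additive.toMul (expHom q hq0 (∑ j, c j • (b j : Fin m → ℤ))) : (ZMod p)ˣ) : ZMod p) := by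
  rw [map_sum]
  simp_rw [map_zsmul]
  rw [toMul_sum]
  simp_rw [toMul_zsmul]
  push_cast
  refine Finset.prod_congr rfl fun j _ => ?_
  rw [cast_unitSign_eq q hq0 (b j).2]
  have hs : ((Additive.toMul (expHom q hq0 (b j : Fin m → ℤ)) : (ZMod p)ˣ) : ZMod p) = 1 ∨
      ((Additive.toMul (expHom q hq0 (b j : Fin m → ℤ)) : (ZMod p)ˣ) : ZMod p) = -1 := by
    have h := (mem_latPM_iff q hq0 _).mp (b j).2
    rw [toMul_expHom]
    rcases h with h | h <;> rw [h] <;> simp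
  exact (sign_zpow_eq_pow_natAbs hs (c j)).symm

/-- The sign `∏ⱼ χ(bⱼ)^{nⱼ}` is `±1`. [cite: StewartTijdeman1986, proof of Theorem 1 (generators attached to a basis of the lattice: congruences, independence, the Kummer condition)] -/
theorem prod_unitSign_pow_eq_or (n : Fin m → ℕ) :
    (∏ j, unitSign q hq0 (b j : Fin m → ℤ) ^ n j) = 1 ∨
      (∏ j, unitSign q hq0 (b j : Fin m → ℤ) ^ n j) = -1 :=
  prod_sign_eq_or _ _ fun j _ => by
    rcases unitSign_eq_or q hq0 (b j : Fin m → ℤ) with h | h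
    · rw [h]; simp
    · rw [h]; exact neg_one_pow_eq_or ℤ (n j)

/-- Coordinates: `↑(∑ⱼ cⱼ • bⱼ) = ∑ⱼ cⱼ • ↑bⱼ` in `ℤ^m`. [cite: StewartTijdeman1986, proof of Theorem 1 (generators attached to a basis of the lattice: congruences, independence, the Kummer condition)] -/
theorem coe_sum_smul (c : Fin m → ℤ) :
    ((∑ j, c j • b j : latPMSub q hq0) : Fin m → ℤ) = ∑ j, c j • (b j : Fin m → ℤ) := by
  rw [Submodule.coe_sum]
  rfl

/-- **Multiplicative independence of the generators** `α̃(bⱼ)` (`b` a `ℤ`-basis of `Λ^±`,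
`qᵢ` distinct primes): `∏ α̃(bⱼ)^{μⱼ} = 1 ⇒ μ = 0`. [cite: StewartTijdeman1986, proof of Theorem 1 (generators attached to a basis of the lattice: congruences, independence, the Kummer condition)] -/
theorem signedProd_basis_independent (hq : ∀ i, (q i).Prime) (hinj : Function.Injective q)
    (μ : Fin m → ℤ) (h : ∏ j, signedProd q hq0 (b j : Fin m → ℤ) ^ μ j = 1) : μ = 0 := by
  rw [prod_signedProd_zpow q hq0 b hq] at h
  set z : Fin m → ℤ := ∑ j, μ j • (b j : Fin m → ℤ) with hz
  -- valuations: `z = 0`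
  have hz0 : z = 0 := by
    funext i
    haveI : Fact (q i).Prime := ⟨hq i⟩
    have hv := congrArg (padicValRat (q i)) h
    have hS : ((∏ j, unitSign q hq0 (b j : Fin m → ℤ) ^ (μ j).natAbs : ℤ) : ℚ) ≠ 0 := by
      rcases prod_unitSign_pow_eq_or q hq0 b (fun j => (μ j).natAbs) with h1 | h1 <;>
        rw [h1] <;> norm_num
    rw [padicValRat.mul hS (prod_zpow_pos q hq z).ne', padicValRat_prod_zpow q hq hinj,
      padicValRat.one] at hv
    have hvS : padicValRat (q i)
        ((∏ j, unitSign q hq0 (b j : Fin m → ℤ) ^ (μ j).natAbs : ℤ) : ℚ) = 0 := by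
      rcases prod_unitSign_pow_eq_or q hq0 b (fun j => (μ j).natAbs) with h1 | h1 <;>
        rw [h1] <;> simp
    rw [hvS, zero_add] at hv
    exact_mod_cast hv
  -- linear independence of `b`
  have hsum : (∑ j, μ j • b j : latPMSub q hq0) = 0 := by
    apply Subtype.ext
    rw [coe_sum_smul, ← hz, hz0]
    rfl
  exact funext fun j => Fintype.linearIndependent_iff.mp b.linearIndependent μ hsum j

/-- **Same lattice as p2's `PadicKummer.pmLattice`** (`Literature/NumberTheory/DiophantineGeometry/
PadicLogFormsKummerFree.lean`, which encodes `Λ^±` as `{z : (∏ q̄ᵢ^{zᵢ})² = 1}` for an abstract group):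
for `G = (ℤ/p)ˣ` the two submodules coincide (`x² = 1 ↔ x = ±1` in a field). [cite: StewartTijdeman1986, proof of Theorem 1 (generators attached to a basis of the lattice: congruences, independence, the Kummer condition)] -/
theorem latPMSub_eq_pmLattice :
    latPMSub q hq0 = Literature.NumberTheory.DiophantineGeometry.PadicKummer.pmLattice (resUnit q hq0) := by
  ext z
  rw [mem_latPMSub_iff, mem_latPM_iff,
    Literature.NumberTheory.DiophantineGeometry.PadicKummer.mem_pmLattice]
  change _ ↔ (∏ j, resUnit q hq0 j ^ z j) ^ 2 = 1
  constructor
  · rintro (h | h) <;> rw [h] <;> simp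
  · intro h
    have h' : ((∏ j, resUnit q hq0 j ^ z j : (ZMod p)ˣ) : ZMod p) *
        ((∏ j, resUnit q hq0 j ^ z j : (ZMod p)ˣ) : ZMod p) = 1 := by
      have := congrArg (fun x : (ZMod p)ˣ => (x : ZMod p)) h
      simpa [pow_two] using this
    rcases mul_self_eq_one_iff.mp h' with h1 | h1
    · left; exact Units.ext h1
    · right; exact Units.ext (by simpa using h1)

/-- **Same generators as p2's `PadicKummer.gen`**: `α̃(z) = gen q (q̄) z`. [cite: StewartTijdeman1986, proof of Theorem 1 (generators attached to a basis of the lattice: congruences, independence, the Kummer condition)] -/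
theorem signedProd_eq_gen (z : Fin m → ℤ) :
    signedProd q hq0 z =
      Literature.NumberTheory.DiophantineGeometry.PadicKummer.gen q (resUnit q hq0) z := by
  classical
  unfold signedProd unitSign Literature.NumberTheory.DiophantineGeometry.PadicKummer.gen
    Literature.NumberTheory.DiophantineGeometry.PadicKummer.sgn
    Literature.NumberTheory.DiophantineGeometry.PadicKummer.charProd
  rw [toMul_expHom]
  congr 2
  by_cases h : ∏ j, resUnit q hq0 j ^ z j = 1 <;> simp [h]

/-- **Kummer condition for free.** For a `ℤ`-basis `b` of `Λ^±` (distinct primes `qᵢ ≠ p`),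
no non-empty sub-product of the `α̃(bⱼ)` is a square in `ℚ`: if `∏_{j∈T} α̃(bⱼ) = r²` then
`∑_{j∈T} bⱼ = 2u` with `∏ qᵢ^{uᵢ} ≡ ±1 (mod p)` (its square is `≡ 1`), so `u ∈ Λ^±` and the
indicator vector of `T` would be divisible by `2` in `ℤ^m`. DERIVED from p2's kernel proof
`PadicKummer.not_isSquare_prod_gen_basis_zmod` (cell abc-stewartyu, M3 of PADIC-CORE §2; referee flag
F-ref-4: one lemma, one proof) by transporting the basis along `latPMSub_eq_pmLattice`. [cite: StewartTijdeman1986, proof of Theorem 1 (generators attached to a basis of the lattice: congruences, independence, the Kummer condition)] -/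
theorem not_isSquare_prod_signedProd_basis (hq : ∀ i, (q i).Prime)
    (hinj : Function.Injective q) (T : Finset (Fin m)) (hT : T.Nonempty) :
    ¬ IsSquare (∏ j ∈ T, signedProd q hq0 (b j : Fin m → ℤ)) := by
  classical
  have heq := latPMSub_eq_pmLattice q hq0
  let e : latPMSub q hq0 ≃ₗ[ℤ]
      Literature.NumberTheory.DiophantineGeometry.PadicKummer.pmLattice (resUnit q hq0) :=
    LinearEquiv.ofEq _ _ heq
  let v := b.map e
  have hv : ∀ j, ((v j : Literature.NumberTheory.DiophantineGeometry.PadicKummer.pmLattice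
      (resUnit q hq0)) : Fin m → ℤ) = (b j : Fin m → ℤ) := fun j => by
    simp [v, e, Module.Basis.map_apply]
  have h := Literature.NumberTheory.DiophantineGeometry.PadicKummer.not_isSquare_prod_gen_basis_zmod
    hq hinj (resUnit q hq0) v T hT
  rw [show (∏ j ∈ T, signedProd q hq0 (b j : Fin m → ℤ)) =
      ∏ j ∈ T, Literature.NumberTheory.DiophantineGeometry.PadicKummer.gen q (resUnit q hq0)
        (v j : Fin m → ℤ) from Finset.prod_congr rfl fun j _ => by rw [signedProd_eq_gen, hv]]
  exact h

/-- **The main identity.** If `∏ q̄ᵢ^{eᵢ} = 1` (e.g. `ord_p(∏ qᵢ^{eᵢ} − 1) ≥ 1`), `p ≠ 2`, and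
`e' ∈ ℤ^m` are the coordinates of `e ∈ Λ^±` in the basis `b`, then `∏ qᵢ^{eᵢ} = ∏ⱼ α̃(bⱼ)^{e'ⱼ}`
(the sign `∏ χ(bⱼ)^{e'ⱼ} ≡ ∏ q̄ᵢ^{eᵢ} = 1 (mod p)` is `+1` as `p ≠ 2`). [cite: StewartTijdeman1986, proof of Theorem 1 (generators attached to a basis of the lattice: congruences, independence, the Kummer condition)] -/
theorem prod_signedProd_zpow_repr (hq : ∀ i, (q i).Prime) (hp2 : p ≠ 2) {e : Fin m → ℤ}
    (he : expHom q hq0 e = 0) (heΛ : e ∈ latPM q hq0) :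
    ∏ i, (q i : ℚ) ^ e i =
      ∏ j, signedProd q hq0 (b j : Fin m → ℤ) ^ (b.equivFun ⟨e, heΛ⟩ j) := by
  set e' : Fin m → ℤ := b.equivFun ⟨e, heΛ⟩ with he'
  have hsum : ∑ j, e' j • (b j : Fin m → ℤ) = e := by
    rw [← coe_sum_smul, ← b.equivFun_symm_apply, he', LinearEquiv.symm_apply_apply]
  rw [prod_signedProd_zpow q hq0 b hq, hsum]
  set S : ℤ := ∏ j, unitSign q hq0 (b j : Fin m → ℤ) ^ (e' j).natAbs with hS
  have hSp : ((S : ℤ) : ZMod p) = 1 := by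
    rw [hS, cast_prod_unitSign_pow q hq0 b e', hsum, he, toMul_zero, Units.val_one]
  have hS1 : S = 1 := by
    rcases prod_unitSign_pow_eq_or q hq0 b (fun j => (e' j).natAbs) with h1 | h1
    · exact h1
    · exfalso
      rw [← hS] at h1
      rw [h1] at hSp
      push_cast at hSp
      -- `-1 = 1` in `ℤ/p` forces `p ∣ 2`
      have h2 : ((2 : ℕ) : ZMod p) = 0 := by
        have : (1 : ZMod p) + 1 = 0 := by
          calc (1 : ZMod p) + 1 = -1 + 1 := by rw [hSp]
            _ = 0 := by ring
        exact_mod_cast this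
      rw [ZMod.natCast_eq_zero_iff] at h2
      exact hp2 ((Nat.prime_dvd_prime_iff_eq hp.out Nat.prime_two).mp h2)
  rw [hS1]; push_cast; rw [one_mul]

end BasisLemmas

/-! ### Heights and the floor `log p ≤ 2 h(α)` -/

/-- **Heights of the generators**: `h(α̃(z)) ≤ ∑ᵢ |zᵢ| log qᵢ` (`h(±x) = h(x)`,
`h(∏ xᵢ) ≤ ∑ h(xᵢ)`, `h(q^k) = |k| log q`). [cite: StewartTijdeman1986, proof of Theorem 1 (generators attached to a basis of the lattice: congruences, independence, the Kummer condition)] -/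
theorem logHeight₁_signedProd_le (q : Fin m → ℕ) (hq : ∀ i, (q i).Prime)
    (hq0 : ∀ i, ((q i : ℕ) : ZMod p) ≠ 0) (z : Fin m → ℤ) :
    Height.logHeight₁ (signedProd q hq0 z) ≤ ∑ i, Real.log (q i) * |(z i : ℝ)| := by
  have h1 : Height.logHeight₁ (signedProd q hq0 z) =
      Height.logHeight₁ (∏ i, (q i : ℚ) ^ z i) := by
    unfold signedProd
    rcases unitSign_eq_or q hq0 z with h | h
    · rw [h]; push_cast; rw [one_mul]
    · rw [h]; push_cast; rw [neg_one_mul, Height.logHeight₁_neg]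
  rw [h1]
  calc Height.logHeight₁ (∏ i, (q i : ℚ) ^ z i)
      ≤ ∑ i, Height.logHeight₁ ((q i : ℚ) ^ z i) := Height.logHeight₁_prod_le _ _
    _ = ∑ i, Real.log (q i) * |(z i : ℝ)| := by
        refine Finset.sum_congr rfl fun i _ => ?_
        haveI : NeZero (q i) := ⟨(hq i).ne_zero⟩
        rw [Height.logHeight₁_zpow, Rat.logHeight₁_natCast, Nat.cast_natAbs, Int.cast_abs,
          mul_comm]

/-- **The height floor of a principal unit.** For an odd prime `p` and `α ∈ ℚ` with
`ord_p(α − 1) ≥ 1`: `log p ≤ 2 h(α)` (indeed `log p ≤ ord_p(α−1) log p ≤ h(α − 1) ≤ log 2 + h(α)`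
and `h(α) ≥ log 2` as `α ≠ 0, ±1`). [cite: StewartTijdeman1986, proof of Theorem 1 (generators attached to a basis of the lattice: congruences, independence, the Kummer condition)] -/
theorem log_le_two_mul_logHeight₁ (hp2 : p ≠ 2) {α : ℚ} (h : 1 ≤ padicValRat p (α - 1)) :
    Real.log p ≤ 2 * Height.logHeight₁ α := by
  have hp' := hp.out
  have hα1 : α - 1 ≠ 0 := by
    intro h0; rw [h0, padicValRat.zero] at h; exact absurd h (by norm_num)
  have hα0 : α ≠ 0 := by
    rintro rfl
    rw [zero_sub, padicValRat.neg, padicValRat.one] at h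
    exact absurd h (by norm_num)
  have hαm1 : α ≠ -1 := by
    rintro h0
    rw [h0, show (-1 : ℚ) - 1 = -(2 : ℕ) by norm_num, padicValRat.neg, padicValRat.of_nat] at h
    haveI : Fact (Nat.Prime 2) := ⟨Nat.prime_two⟩
    rw [padicValNat_primes hp2] at h
    exact absurd h (by norm_num)
  have hα1' : α ≠ 1 := fun h0 => hα1 (by rw [h0, sub_self])
  have h1 : (padicValRat p (α - 1) : ℝ) * Real.log p ≤ Height.logHeight₁ (α - 1) :=
    Dioph.padicValRat_mul_log_le_logHeight₁ p hp' hα1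
  have h2 : Height.logHeight₁ (α - 1) ≤ Real.log 2 + Height.logHeight₁ α := by
    rw [show α - 1 = -(1 - α) by ring, Height.logHeight₁_neg]
    exact Dioph.logHeight₁_one_sub_le α
  have h3 : Real.log 2 ≤ Height.logHeight₁ α := Dioph.log_two_le_logHeight₁ hα0 hα1' hαm1
  have hlogp : 0 ≤ Real.log p := Real.log_natCast_nonneg p
  have h4 : (1 : ℝ) ≤ padicValRat p (α - 1) := by exact_mod_cast h
  nlinarith

end Literature.NumberTheory.Transcendental.StewartYu.PrincipalLattice

end Part3

/-!
## Part 4 — port of `Summits/ABC/StewartYu/WeightedLatticeBasis.lean` (4 declarations kept)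

# Geometry of numbers in a finite-index sublattice of `ℤ^m`, weighted `ℓ¹` form (I): a short basis

Cell topic `Summits/ABC/StewartYu` (cell abc-stewartyu, seat p1); namespace
`Literature.NumberTheory.Transcendental.StewartYu.PrincipalLattice` (theorems only). Part of work package WP-M (reduction of
`p`-adic linear forms in logarithms of primes to Kummer-free principal generators); the main theorem
is in `PadicLogFormsPrincipalReduction.lean`.

* `exists_seminorm_weighted` — the weighted `ℓ¹`-norm `F(x) = ∑ wᵢ|xᵢ|` (`wᵢ > 0`) as a definite
  `Seminorm`;
* `volume_weighted_lt_one` / `_le_one` — the weighted cross-polytope `{∑ wᵢ|xᵢ| < 1}` has volume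
  `2^m/(m! ∏ wᵢ)` (Mathlib's `volume_sum_rpow_lt_one`, `p = 1`, and a diagonal change of variables);
* `exists_basis_prod_weighted_le` — a finite-index `L ≤ ℤ^m` (index `d`) has a `ℤ`-basis with
  `∏ⱼ F(bⱼ) ≤ (m!)² d ∏ wᵢ`: Minkowski's second theorem and Mahler's basis theorem, both PROVED in
  the tree for `ℤ^m` (`Dioph.exists_directional_system_prod_mul_volume_le`
  [cite: EvertseGyory2015, Thm 4.3.1 (p. 70)], `Dioph.exists_int_basis_le_of_directional`
  [cite: EvertseGyory2015, Thm 4.3.3 (p. 70)]), transported to `L` by a basis matrix.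

## References

* [EvertseGyory2015] J.-H. Evertse, K. Győry, *Unit Equations in Diophantine Number Theory*,
  Cambridge Stud. Adv. Math. 146, CUP 2015 — Thm 4.3.1, Thm 4.3.3 (p. 70), Lemma 4.3.6 (p. 72).
-/

section Part4

namespace Literature.NumberTheory.Transcendental.StewartYu.PrincipalLattice

open _root_.MeasureTheory _root_.Module _root_.Finset
open Literature.NumberTheory.DiophantineGeometry.Dioph

/-! ### The weighted `ℓ¹`-norm `F(x) = ∑ wᵢ |xᵢ|` on `ℝ^m`: seminorm, volume of its ball -/

/-- The weighted `ℓ¹`-norm `x ↦ ∑ wᵢ |xᵢ|` (`wᵢ > 0`) is a norm on `ℝ^m`; packaged as the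
existence of a definite `Seminorm` with this value. [cite: EvertseGyory2015, Thm 4.3.3 (p. 70) (Mahler’s basis theorem in the weighted norm)] -/
theorem exists_seminorm_weighted {m : ℕ} (w : Fin m → ℝ) (hw : ∀ i, 0 < w i) :
    ∃ F : Seminorm ℝ (Fin m → ℝ), (∀ x, F x = ∑ i, w i * |x i|) ∧ ∀ x, F x = 0 → x = 0 := by
  refine ⟨Seminorm.of (fun x => ∑ i, w i * |x i|) (fun x y => ?_) (fun a x => ?_),
    fun x => rfl, fun x hx => ?_⟩
  · rw [← Finset.sum_add_distrib]
    refine Finset.sum_le_sum fun i _ => ?_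
    rw [← mul_add]
    exact mul_le_mul_of_nonneg_left (abs_add_le _ _) (hw i).le
  · rw [Finset.mul_sum]
    refine Finset.sum_congr rfl fun i _ => ?_
    rw [Pi.smul_apply, smul_eq_mul, abs_mul, Real.norm_eq_abs]; ring
  · change ∑ i, w i * |x i| = 0 at hx
    rw [Finset.sum_eq_zero_iff_of_nonneg fun i _ => mul_nonneg (hw i).le (abs_nonneg _)] at hx
    funext i
    have := hx i (Finset.mem_univ i)
    rcases mul_eq_zero.mp this with h | h
    · exact absurd h (hw i).ne'
    · exact abs_eq_zero.mp h

/-- **Volume of the weighted cross-polytope**: `vol {x ∈ ℝ^m : ∑ wᵢ|xᵢ| < 1} = 2^m/(m! ∏ wᵢ)`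
(`wᵢ > 0`; the image of the cross-polytope `{∑ |cᵢ| < 1}`, of volume `2^m/m!` — Mathlib's
`volume_sum_rpow_lt_one` with `p = 1` —, under the diagonal map `cᵢ ↦ cᵢ/wᵢ`). [cite: EvertseGyory2015, Thm 4.3.3 (p. 70) (Mahler’s basis theorem in the weighted norm)] -/
theorem volume_weighted_lt_one {m : ℕ} (w : Fin m → ℝ) (hw : ∀ i, 0 < w i) :
    volume {x : Fin m → ℝ | ∑ i, w i * |x i| < 1} =
      ENNReal.ofReal (2 ^ m / (m.factorial * ∏ i, w i)) := by
  set D : (Fin m → ℝ) →ₗ[ℝ] (Fin m → ℝ) := Matrix.toLin' (Matrix.diagonal w) with hD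
  have hDapply : ∀ x i, D x i = w i * x i := by
    intro x i; rw [hD, Matrix.toLin'_apply, Matrix.mulVec_diagonal]
  have hdetD : LinearMap.det D = ∏ i, w i := by
    rw [hD, LinearMap.det_toLin', Matrix.det_diagonal]
  have hprod : 0 < ∏ i, w i := Finset.prod_pos fun i _ => hw i
  have hdet0 : LinearMap.det D ≠ 0 := by rw [hdetD]; exact hprod.ne'
  have hset : {x : Fin m → ℝ | ∑ i, w i * |x i| < 1} = D ⁻¹' {c | ∑ i, |c i| < 1} := by
    ext x
    simp only [Set.mem_setOf_eq, Set.mem_preimage, hDapply, abs_mul, abs_of_pos (hw _)]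
  rw [hset, MeasureTheory.Measure.addHaar_preimage_linearMap volume hdet0]
  have hcross : volume {c : Fin m → ℝ | ∑ i, |c i| < 1} =
      ENNReal.ofReal (2 ^ m / m.factorial) := by
    have h := MeasureTheory.volume_sum_rpow_lt_one (Fin m) (p := 1) le_rfl
    have hset' : {x : Fin m → ℝ | ∑ i, |x i| ^ (1 : ℝ) < 1} = {c | ∑ i, |c i| < 1} := by
      ext x; simp only [Set.mem_setOf_eq, Real.rpow_one]
    rw [hset'] at h
    rw [h]
    have h2 : Real.Gamma 2 = 1 := by
      rw [show (2 : ℝ) = (1 : ℕ) + 1 by norm_num, Real.Gamma_nat_eq_factorial, Nat.factorial_one,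
        Nat.cast_one]
    simp only [Fintype.card_fin, div_one, one_add_one_eq_two, h2, mul_one,
      Real.Gamma_nat_eq_factorial]
  rw [hcross, hdetD, ← ENNReal.ofReal_mul (abs_nonneg _), abs_inv, abs_of_pos hprod]
  congr 1
  field_simp

/-- The closed ball version: `vol {x : ∑ wᵢ|xᵢ| ≤ 1} = 2^m/(m! ∏ wᵢ)` (`m ≥ 1`). [cite: EvertseGyory2015, Thm 4.3.3 (p. 70) (Mahler’s basis theorem in the weighted norm)] -/
theorem volume_weighted_le_one {m : ℕ} (hm : 0 < m) (w : Fin m → ℝ) (hw : ∀ i, 0 < w i) :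
    volume {x : Fin m → ℝ | ∑ i, w i * |x i| ≤ 1} =
      ENNReal.ofReal (2 ^ m / (m.factorial * ∏ i, w i)) := by
  obtain ⟨F, hF, hF0⟩ := exists_seminorm_weighted w hw
  haveI : Nontrivial (Fin m → ℝ) := by
    haveI : Nonempty (Fin m) := ⟨⟨0, hm⟩⟩
    infer_instance
  have h := MeasureTheory.measure_le_eq_lt volume (map_zero F) (fun z => map_neg_eq_map F z)
    (fun z w => map_add_le_add F z w) (fun {z} hz => hF0 z hz)
    (fun r z => (map_smul_eq_mul F r z).le.trans_eq (by rw [Real.norm_eq_abs])) 1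
  simp only [hF] at h
  rw [h, volume_weighted_lt_one w hw]

/-! ### Geometry of numbers in a finite-index sublattice of `ℤ^m`, weighted `ℓ¹` form -/

/-- **A `ℤ`-basis of a finite-index sublattice with small weighted norms** (Minkowski's second
theorem and Mahler's basis theorem, both PROVED in the tree for `ℤ^m`:
`Dioph.exists_directional_system_prod_mul_volume_le` [Evertse–Győry Thm 4.3.1] and
`Dioph.exists_int_basis_le_of_directional` [Thm 4.3.3]). For `L ≤ ℤ^m` (`m ≥ 1`) of finite
index `d` and weights `wᵢ > 0`, `L` has a `ℤ`-basis `b` with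
`∏ⱼ F(bⱼ) ≤ (m!)² · d · ∏ᵢ wᵢ`, `F(x) = ∑ᵢ wᵢ |xᵢ|` — transport `F` to `ℤ^m ≅ L` through a basis
matrix `B` (`|det B| = d`); the unit ball of `F ∘ B` has volume `2^m / (m! · d · ∏ wᵢ)`,
Minkowski gives a directional system `v` with `∏ F(Bv_k) ≤ m! d ∏ wᵢ`, Mahler a basis `y` of
`ℤ^m` with `F(By_j) ≤ (j+1) F(Bv_j)`, and `b_j = B y_j`. [cite: EvertseGyory2015, Thm 4.3.3 (p. 70) (Mahler’s basis theorem in the weighted norm)] -/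
theorem exists_basis_prod_weighted_le {m : ℕ} (hm : 0 < m) (L : Submodule ℤ (Fin m → ℤ))
    [Finite ((Fin m → ℤ) ⧸ L)] (w : Fin m → ℝ) (hw : ∀ i, 0 < w i) :
    ∃ b : Module.Basis (Fin m) ℤ L,
      ∏ j, (∑ i, w i * |(((b j : L) : Fin m → ℤ) i : ℝ)|) ≤
        (m.factorial : ℝ) ^ 2 * Nat.card ((Fin m → ℤ) ⧸ L) * ∏ i, w i := by
  classical
  -- full rank and a basis
  have hrank : Module.finrank ℤ L = m := by
    have h := (Submodule.finiteQuotient_iff L).mp ‹_›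
    rw [h, Module.finrank_fin_fun]
  let bN : Module.Basis (Fin m) ℤ L := Module.finBasisOfFinrankEq ℤ L hrank
  -- the matrix of the basis (columns) and its determinant
  set B : Matrix (Fin m) (Fin m) ℤ := Matrix.of fun i k => ((bN k : L) : Fin m → ℤ) i with hB
  have hdet : B.det.natAbs = Nat.card ((Fin m → ℤ) ⧸ L) := by
    have h := Submodule.natAbs_det_basis_change (Pi.basisFun ℤ (Fin m)) L bN
    rw [Module.Basis.det_apply] at h
    rw [← h]
    congr 2
  have hcard_pos : 0 < Nat.card ((Fin m → ℤ) ⧸ L) := Nat.card_pos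
  have hdet0 : B.det ≠ 0 := by
    intro h0; rw [h0, Int.natAbs_zero] at hdet; omega
  set Bℝ : Matrix (Fin m) (Fin m) ℝ := B.map (Int.cast : ℤ → ℝ) with hBℝ
  have hdetℝ : Bℝ.det = (B.det : ℝ) := by rw [hBℝ]; norm_cast
  have hdetℝ0 : Bℝ.det ≠ 0 := by rw [hdetℝ]; exact_mod_cast hdet0
  set T : (Fin m → ℝ) →ₗ[ℝ] (Fin m → ℝ) := Matrix.toLin' Bℝ with hT
  have hTdet : LinearMap.det T = Bℝ.det := by rw [hT, LinearMap.det_toLin']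
  have hTinj : Function.Injective T := by
    rw [hT]
    exact Matrix.mulVec_injective_iff_isUnit.mpr
      ((Matrix.isUnit_iff_isUnit_det _).mpr (isUnit_iff_ne_zero.mpr hdetℝ0))
  -- the weighted norm and its transport
  obtain ⟨F, hF, hF0⟩ := exists_seminorm_weighted w hw
  let N : Seminorm ℝ (Fin m → ℝ) := F.comp T
  have N_apply : ∀ x, N x = F (T x) := fun x => rfl
  have hN : ∀ x, N x = 0 → x = 0 := fun x hx => by
    rw [N_apply] at hx
    exact hTinj (by rw [hF0 _ hx, map_zero])
  obtain ⟨v, hli, hmono, -, hvol⟩ := exists_directional_system_prod_mul_volume_le hm N hN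
  obtain ⟨y, hygen, hyne, hyle⟩ := exists_int_basis_le_of_directional N v hli hmono
  -- the volume of the unit ball of `N`
  have hΩ : 0 < ∏ i, w i := Finset.prod_pos fun i _ => hw i
  have hball : {x : Fin m → ℝ | N x < 1} = T ⁻¹' {x | ∑ i, w i * |x i| < 1} := by
    ext x; simp [N_apply, hF]
  have hvolN : volume {x : Fin m → ℝ | N x < 1} =
      ENNReal.ofReal |(Bℝ.det)⁻¹| * ENNReal.ofReal (2 ^ m / (m.factorial * ∏ i, w i)) := by
    rw [hball, MeasureTheory.Measure.addHaar_preimage_linearMap volume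
      (by rw [hTdet]; exact hdetℝ0), hTdet, volume_weighted_lt_one w hw]
  -- `∏ N(v_k) ≤ m! |det B| ∏ w`
  set P : ℝ := ∏ k, N (fun i => (v k i : ℝ)) with hP
  have hP0 : 0 ≤ P := Finset.prod_nonneg fun k _ => apply_nonneg _ _
  have hD0 : 0 < |Bℝ.det| := abs_pos.mpr hdetℝ0
  have hPle : P ≤ (m.factorial : ℝ) * |Bℝ.det| * ∏ i, w i := by
    rw [hvolN] at hvol
    have h2m : (2 : ENNReal) ^ m = ENNReal.ofReal ((2 : ℝ) ^ m) := by
      rw [ENNReal.ofReal_pow (by norm_num), ENNReal.ofReal_ofNat]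
    rw [h2m, ← ENNReal.ofReal_mul (abs_nonneg _), ← ENNReal.ofReal_mul hP0,
      ENNReal.ofReal_le_ofReal_iff (by positivity)] at hvol
    rw [abs_inv] at hvol
    -- `hvol : P * (|det|⁻¹ * (2^m / (m! ∏ w))) ≤ 2^m`
    have hfac : (0 : ℝ) < m.factorial := by exact_mod_cast Nat.factorial_pos m
    have h3 : P * (2 : ℝ) ^ m ≤ (m.factorial : ℝ) * |Bℝ.det| * (∏ i, w i) * 2 ^ m := by
      have := mul_le_mul_of_nonneg_left hvol
        (show (0 : ℝ) ≤ (m.factorial : ℝ) * |Bℝ.det| * ∏ i, w i by positivity)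
      calc P * (2 : ℝ) ^ m
          = (m.factorial : ℝ) * |Bℝ.det| * (∏ i, w i) *
              (P * (|Bℝ.det|⁻¹ * (2 ^ m / (m.factorial * ∏ i, w i)))) := by
            field_simp
        _ ≤ (m.factorial : ℝ) * |Bℝ.det| * (∏ i, w i) * 2 ^ m := this
    exact le_of_mul_le_mul_right h3 (by positivity)
  -- `∏ N(y_j) ≤ m! ∏ N(v_k)`
  have hyprod : ∏ j, N (fun i => (y j i : ℝ)) ≤ (m.factorial : ℝ) * P := by
    calc ∏ j, N (fun i => (y j i : ℝ))
        ≤ ∏ j : Fin m, (((j : ℕ) : ℝ) + 1) * N (fun i => (v j i : ℝ)) :=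
          Finset.prod_le_prod (fun j _ => apply_nonneg _ _) fun j _ => hyle j
      _ = (∏ j : Fin m, (((j : ℕ) : ℝ) + 1)) * ∏ j, N (fun i => (v j i : ℝ)) :=
          Finset.prod_mul_distrib
      _ = (m.factorial : ℝ) * P := by
          rw [hP]
          congr 1
          rw [Fin.prod_univ_eq_prod_range (fun j => ((j : ℝ) + 1)) m]
          exact_mod_cast Finset.prod_range_add_one_eq_factorial m
  -- the basis `y` of `ℤ^m` and the basis `b = B y` of `L`
  let yB : Module.Basis (Fin m) ℤ (Fin m → ℤ) :=
    basisOfTopLeSpanOfCardEqFinrank y hygen.ge (by simp)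
  have hyB : ∀ j, yB j = y j := fun j => by
    simp [yB, coe_basisOfTopLeSpanOfCardEqFinrank]
  let b : Module.Basis (Fin m) ℤ L := yB.map bN.equivFun.symm
  have hb : ∀ j, ((b j : L) : Fin m → ℤ) = B.mulVec (y j) := by
    intro j
    have h1 : (b j : L) = bN.equivFun.symm (y j) := by
      rw [Module.Basis.map_apply, hyB]
    rw [h1, Module.Basis.equivFun_symm_apply, Submodule.coe_sum]
    ext i
    simp [Matrix.mulVec, dotProduct, hB, Finset.sum_apply, mul_comm]
  have hnorm : ∀ j, ∑ i, w i * |(((b j : L) : Fin m → ℤ) i : ℝ)| = N (fun i => (y j i : ℝ)) := by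
    intro j
    rw [N_apply, hF, hT, Matrix.toLin'_apply]
    refine Finset.sum_congr rfl fun i _ => ?_
    congr 2
    rw [hb j]
    have := RingHom.map_mulVec (Int.castRingHom ℝ) B (y j) i
    simpa [hBℝ, Function.comp_def] using this
  refine ⟨b, ?_⟩
  calc ∏ j, (∑ i, w i * |(((b j : L) : Fin m → ℤ) i : ℝ)|)
      = ∏ j, N (fun i => (y j i : ℝ)) := Finset.prod_congr rfl fun j _ => hnorm j
    _ ≤ (m.factorial : ℝ) * P := hyprod
    _ ≤ (m.factorial : ℝ) * ((m.factorial : ℝ) * |Bℝ.det| * ∏ i, w i) :=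
        mul_le_mul_of_nonneg_left hPle (by positivity)
    _ = (m.factorial : ℝ) ^ 2 * Nat.card ((Fin m → ℤ) ⧸ L) * ∏ i, w i := by
        rw [hdetℝ, ← Int.cast_abs, ← hdet, Nat.cast_natAbs]; ring

end Literature.NumberTheory.Transcendental.StewartYu.PrincipalLattice

end Part4

/-!
## Part 5 — port of `Summits/ABC/StewartYu/WeightedLatticeCramer.lean` (4 declarations kept)

# Geometry of numbers in a finite-index sublattice of `ℤ^m`, weighted `ℓ¹` form (II): coordinates

Cell topic `Summits/ABC/StewartYu` (cell abc-stewartyu, seat p1); namespace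
`Literature.NumberTheory.Transcendental.StewartYu.PrincipalLattice` (theorems only); sequel to `WeightedLatticeBasis.lean`.

* `card_mul_abs_repr_mul_prod_le` — Cramer's rule and Evertse–Győry's Lemma 4.3.6
  (`Dioph.abs_det_le_of_seminorm`, proved in the tree) bound basis coordinates in a lattice basis:
  `d |cⱼ| ∏ wᵢ ≤ F(x) ∏_{k≠j} F(b_k)`;
* `factorial_sq_mul_le` — the numerical inequality `(m!)² m ≤ 3 (log 2)^m m^{2m}` (induction with
  Bernoulli `2(n+1)^{2n+1} ≤ (n+2)^{2n+1}` and `2 log 2 ≥ 1`), which converts the Cramer bound into the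
  interface constant `m^{2m} p (∏ log qᵢ) max|eᵢ|` of `AbcStewartYuPlan.WPM`.

## References

* [EvertseGyory2015] J.-H. Evertse, K. Győry, *Unit Equations in Diophantine Number Theory*,
  CUP 2015 — Lemma 4.3.6 (p. 72).
-/

section Part5

namespace Literature.NumberTheory.Transcendental.StewartYu.PrincipalLattice

open _root_.MeasureTheory _root_.Module _root_.Finset
open Literature.NumberTheory.DiophantineGeometry.Dioph

/-- **Cramer's bound for basis coordinates, weighted form.** Let `b` be a `ℤ`-basis of
`L ≤ ℤ^m` (`m ≥ 1`, index `d`), `wᵢ > 0`, `F(x) = ∑ wᵢ|xᵢ|`, and `x ∈ L` with coordinates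
`c = b.repr x`. Then for every `j`: `d · |cⱼ| · ∏ᵢ wᵢ ≤ F(x) · ∏_{k ≠ j} F(b_k)` — Cramer's rule
`det(b) · cⱼ = det(b with bⱼ ← x)`, `|det(b)| = d`, and Evertse–Győry's Lemma 4.3.6
(`Dioph.abs_det_le_of_seminorm`: `|det| ≤ (m!/2^m) · vol{F ≤ 1} · ∏ F(rows)`, PROVED in the
tree) with `vol{F ≤ 1} = 2^m/(m! ∏ wᵢ)`. [cite: EvertseGyory2015, Thm 4.3.3 (p. 70) (Cramer bookkeeping for the weighted basis)] -/
theorem card_mul_abs_repr_mul_prod_le {m : ℕ} (hm : 0 < m) (L : Submodule ℤ (Fin m → ℤ))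
    [Finite ((Fin m → ℤ) ⧸ L)] (b : Module.Basis (Fin m) ℤ L) (w : Fin m → ℝ)
    (hw : ∀ i, 0 < w i) (x : L) (j : Fin m) :
    (Nat.card ((Fin m → ℤ) ⧸ L) : ℝ) * |(b.repr x j : ℝ)| * ∏ i, w i ≤
      (∑ i, w i * |((x : Fin m → ℤ) i : ℝ)|) *
        ∏ k ∈ Finset.univ.erase j, (∑ i, w i * |(((b k : L) : Fin m → ℤ) i : ℝ)|) := by
  classical
  -- the matrix of the basis (rows) and its determinant
  set R : Matrix (Fin m) (Fin m) ℤ := Matrix.of fun k i => ((b k : L) : Fin m → ℤ) i with hR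
  have hdet : R.det.natAbs = Nat.card ((Fin m → ℤ) ⧸ L) := by
    have h := Submodule.natAbs_det_basis_change (Pi.basisFun ℤ (Fin m)) L b
    rw [Module.Basis.det_apply] at h
    rw [← h, ← Matrix.det_transpose]
    congr 2
  -- coordinates: `x = Rᵀ c`
  set c : Fin m → ℤ := fun k => b.repr x k with hc
  have hx : (x : Fin m → ℤ) = R.transpose.mulVec c := by
    have h1 : (x : L) = ∑ k, c k • b k := by
      rw [hc]; exact (b.sum_repr x).symm
    have h2 : ((x : L) : Fin m → ℤ) = ∑ k, c k • ((b k : L) : Fin m → ℤ) := by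
      rw [h1, Submodule.coe_sum]; rfl
    rw [h2]
    ext i
    simp [Matrix.mulVec, dotProduct, hR, Finset.sum_apply, mul_comm]
  -- Cramer: `det R · c_j = det (R with row j ← x)`
  have hcramer : R.det * c j = (R.updateRow j (x : Fin m → ℤ)).det := by
    have h1 : Matrix.cramer R.transpose (x : Fin m → ℤ) = R.transpose.det • c := by
      rw [hx, Matrix.cramer_eq_adjugate_mulVec, Matrix.mulVec_mulVec, Matrix.adjugate_mul,
        Matrix.smul_mulVec, Matrix.one_mulVec]
    have h2 := congrFun h1 j
    rw [Matrix.cramer_transpose_apply, Pi.smul_apply, smul_eq_mul, Matrix.det_transpose] at h2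
    exact h2.symm
  -- the real matrix of rows `b_k (k ≠ j), x`
  let f : Fin m → Fin m → ℝ := fun k i => ((R.updateRow j (x : Fin m → ℤ)) k i : ℝ)
  have hdetf : (((R.updateRow j (x : Fin m → ℤ)).det : ℤ) : ℝ) = (Matrix.of f).det := by
    rw [show (((R.updateRow j (x : Fin m → ℤ)).det : ℤ) : ℝ) =
        (Int.castRingHom ℝ) (R.updateRow j (x : Fin m → ℤ)).det from rfl, RingHom.map_det]
    congr 1
  -- Lemma 4.3.6 for the weighted norm
  obtain ⟨F, hF, hF0⟩ := exists_seminorm_weighted w hw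
  have h436 := abs_det_le_of_seminorm hm F hF0 f
  have hΩ : 0 < ∏ i, w i := Finset.prod_pos fun i _ => hw i
  have hvol : (volume {z : Fin m → ℝ | F z ≤ 1}).toReal = 2 ^ m / (m.factorial * ∏ i, w i) := by
    simp only [hF]
    rw [volume_weighted_le_one hm w hw,
      ENNReal.toReal_ofReal (div_nonneg (by positivity) (mul_nonneg (by positivity) hΩ.le))]
  rw [hvol] at h436
  have hfac : (0 : ℝ) < m.factorial := by exact_mod_cast Nat.factorial_pos m
  have hconst : (m.factorial : ℝ) / 2 ^ m * (2 ^ m / (m.factorial * ∏ i, w i)) = (∏ i, w i)⁻¹ := by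
    field_simp
  rw [hconst] at h436
  -- the rows
  have hrows : ∏ k, F (f k) = (∑ i, w i * |((x : Fin m → ℤ) i : ℝ)|) *
      ∏ k ∈ Finset.univ.erase j, (∑ i, w i * |(((b k : L) : Fin m → ℤ) i : ℝ)|) := by
    rw [← Finset.mul_prod_erase Finset.univ _ (Finset.mem_univ j)]
    congr 1
    · rw [hF]
      refine Finset.sum_congr rfl fun i _ => ?_
      simp [f, Matrix.updateRow_self]
    · refine Finset.prod_congr rfl fun k hk => ?_
      rw [hF]
      refine Finset.sum_congr rfl fun i _ => ?_
      simp [f, Matrix.updateRow_ne (Finset.ne_of_mem_erase hk), hR]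
  rw [hrows] at h436
  -- assemble
  have hlhs : (Nat.card ((Fin m → ℤ) ⧸ L) : ℝ) * |(b.repr x j : ℝ)| = |(Matrix.of f).det| := by
    rw [← hdetf, ← hcramer, ← hdet, Nat.cast_natAbs, Int.cast_abs]
    push_cast
    rw [abs_mul]
  rw [hlhs]
  calc |(Matrix.of f).det| * ∏ i, w i
      ≤ (∏ i, w i)⁻¹ * ((∑ i, w i * |((x : Fin m → ℤ) i : ℝ)|) *
          ∏ k ∈ Finset.univ.erase j, (∑ i, w i * |(((b k : L) : Fin m → ℤ) i : ℝ)|)) *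
          ∏ i, w i := mul_le_mul_of_nonneg_right h436 hΩ.le
    _ = _ := by field_simp

/-! ### A numerical inequality: `(m!)² · m ≤ 3 (log 2)^m · m^{2m}` -/

/-- Bernoulli: `2 (n+1)^{2n+1} ≤ (n+2)^{2n+1}`. [cite: EvertseGyory2015, Thm 4.3.3 (p. 70) (Cramer bookkeeping for the weighted basis)] -/
theorem two_mul_pow_le_pow (n : ℕ) :
    (2 : ℝ) * ((n : ℝ) + 1) ^ (2 * n + 1) ≤ ((n : ℝ) + 2) ^ (2 * n + 1) := by
  have hn1 : (0 : ℝ) < (n : ℝ) + 1 := by positivity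
  have hx : (0 : ℝ) ≤ 1 / ((n : ℝ) + 1) := by positivity
  have hB := one_add_mul_le_pow (show (-2 : ℝ) ≤ 1 / ((n : ℝ) + 1) by linarith) (2 * n + 1)
  have h2 : (2 : ℝ) ≤ 1 + ((2 * n + 1 : ℕ) : ℝ) * (1 / ((n : ℝ) + 1)) := by
    rw [mul_one_div]
    have : (1 : ℝ) ≤ ((2 * n + 1 : ℕ) : ℝ) / ((n : ℝ) + 1) := by
      rw [le_div_iff₀ hn1]; push_cast; linarith
    linarith
  have h3 : ((n : ℝ) + 2) ^ (2 * n + 1) =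
      ((n : ℝ) + 1) ^ (2 * n + 1) * (1 + 1 / ((n : ℝ) + 1)) ^ (2 * n + 1) := by
    rw [← mul_pow]; congr 1; field_simp; ring
  rw [h3]
  calc (2 : ℝ) * ((n : ℝ) + 1) ^ (2 * n + 1) = ((n : ℝ) + 1) ^ (2 * n + 1) * 2 := mul_comm _ _
    _ ≤ ((n : ℝ) + 1) ^ (2 * n + 1) * (1 + ((2 * n + 1 : ℕ) : ℝ) * (1 / ((n : ℝ) + 1))) :=
        mul_le_mul_of_nonneg_left h2 (by positivity)
    _ ≤ ((n : ℝ) + 1) ^ (2 * n + 1) * (1 + 1 / ((n : ℝ) + 1)) ^ (2 * n + 1) :=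
        mul_le_mul_of_nonneg_left hB (by positivity)

/-- `((n+1)!)² (n+1) ≤ 3 (log 2)^{n+1} (n+1)^{2(n+1)}` (induction; the step is
`2 (n+1)^{2n+1} ≤ (n+2)^{2n+1}` and `2 log 2 ≥ 1`). [cite: EvertseGyory2015, Thm 4.3.3 (p. 70) (Cramer bookkeeping for the weighted basis)] -/
theorem factorial_sq_mul_le_aux (n : ℕ) :
    ((n + 1).factorial : ℝ) ^ 2 * ((n : ℝ) + 1) ≤
      3 * Real.log 2 ^ (n + 1) * ((n : ℝ) + 1) ^ (2 * (n + 1)) := by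
  have hL : (0.6931471803 : ℝ) < Real.log 2 := Real.log_two_gt_d9
  have hL0 : 0 < Real.log 2 := by linarith
  induction n with
  | zero => simp only [zero_add, Nat.factorial_one, Nat.cast_one, one_pow, pow_one,
      CharP.cast_eq_zero, mul_one]; linarith
  | succ n ih =>
    set A : ℝ := (n : ℝ) + 1 with hA
    set B : ℝ := (n : ℝ) + 2 with hB
    set f : ℝ := ((n + 1).factorial : ℝ) with hf
    set P : ℝ := A ^ (2 * n + 1) with hP
    set Q : ℝ := B ^ (2 * n + 1) with hQ
    have hA0 : 0 < A := by positivity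
    have hB0 : 0 < B := by positivity
    have key : 2 * P ≤ Q := two_mul_pow_le_pow n
    -- the induction hypothesis: `f² ≤ 3 L^{n+1} P`
    have hih : f ^ 2 ≤ 3 * Real.log 2 ^ (n + 1) * P := by
      have h1 : ((n : ℝ) + 1) ^ (2 * (n + 1)) = P * A := by
        rw [hP, hA, show 2 * (n + 1) = (2 * n + 1) + 1 by ring, pow_succ]
      rw [h1] at ih
      have h2 : f ^ 2 * A ≤ (3 * Real.log 2 ^ (n + 1) * P) * A := by rw [hf, hA]; linarith
      exact le_of_mul_le_mul_right h2 hA0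
    -- rewrite the goal
    have hfac : ((n + 1 + 1).factorial : ℝ) = B * f := by
      rw [Nat.factorial_succ, hB, hf]; push_cast; ring
    have hcast : ((n + 1 : ℕ) : ℝ) + 1 = B := by rw [hB]; push_cast; ring
    have hpow : B ^ (2 * (n + 1 + 1)) = Q * B ^ 3 := by
      rw [hQ, show 2 * (n + 1 + 1) = (2 * n + 1) + 3 by ring, pow_add]
    rw [hfac, hcast, hpow]
    have hL2 : P ≤ Real.log 2 * Q := by
      have hQ0 : 0 ≤ Q := by positivity
      have : 0 ≤ (Real.log 2 - 1 / 2) * Q := mul_nonneg (by linarith) hQ0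
      linarith
    calc (B * f) ^ 2 * B = B ^ 3 * f ^ 2 := by ring
      _ ≤ B ^ 3 * (3 * Real.log 2 ^ (n + 1) * P) :=
          mul_le_mul_of_nonneg_left hih (by positivity)
      _ ≤ B ^ 3 * (3 * Real.log 2 ^ (n + 1) * (Real.log 2 * Q)) := by gcongr
      _ = 3 * Real.log 2 ^ (n + 1 + 1) * (Q * B ^ 3) := by ring

/-- **`(m!)² · m ≤ 3 · (log 2)^m · m^{2m}`** for every `m ∈ ℕ`. [cite: EvertseGyory2015, Thm 4.3.3 (p. 70) (Cramer bookkeeping for the weighted basis)] -/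
theorem factorial_sq_mul_le (m : ℕ) :
    (m.factorial : ℝ) ^ 2 * m ≤ 3 * Real.log 2 ^ m * (m : ℝ) ^ (2 * m) := by
  rcases m with _ | n
  · simp
  · have := factorial_sq_mul_le_aux n
    push_cast
    exact this

end Literature.NumberTheory.Transcendental.StewartYu.PrincipalLattice

end Part5

/-!
## Part 6 — port of `Summits/ABC/StewartYu/PadicLogFormsPrincipalReduction.lean` (1 declarations kept)

# Reduction of `p`-adic linear forms in logarithms of primes to Kummer-free principal generators

Cell topic `Summits/ABC/StewartYu` (cell abc-stewartyu, HOME `run/shared/lean/pub/abc-stewartyu/`, seat p1); namespace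
`Literature.NumberTheory.Transcendental.StewartYu.PrincipalLattice` (theorems only; the main theorem of WP-M — the geometry-of-numbers lemmas it uses are in
`WeightedLatticeBasis.lean` / `WeightedLatticeCramer.lean`).

Main result `exists_principal_generators` (work package **WP-M** of the kernel `p`-adic Baker bound
for logarithms of rational primes; its statement is the cell's skeleton interface `WPM`, verbatim).
For an odd prime `p`, distinct primes `q₁, …, q_m ≠ p` and `e ∈ ℤ^m ∖ {0}` with
`ord_p(∏ qᵢ^{eᵢ} − 1) ≥ 1`, there are `α₁, …, α_m ∈ ℚ` and `e' ∈ ℤ^m ∖ {0}` such that: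
`ord_p(αⱼ − 1) ≥ 1`; the `αⱼ` are multiplicatively independent; no non-empty sub-product of the
`αⱼ` is a square in `ℚ`; `∏ qᵢ^{eᵢ} = ∏ αⱼ^{e'ⱼ}`; `∏ h(αⱼ) ≤ m^{2m} p ∏ log qᵢ`;
`|e'ⱼ| ≤ m^{2m} p (∏ log qᵢ) max|eᵢ|`; `log p ≤ 2 h(αⱼ)`. So a `p`-adic lower bound for linear forms
in the `p`-adic logarithms of Kummer-free PRINCIPAL units of `ℚ` (to which the tree's
Cijsouw–Waldschmidt / Waldschmidt 1980 descent applies verbatim over `ℚ_p`) yields one for distinct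
primes, the prime `p` being paid once (linearly) through the index of the lattice.

Proof. `αⱼ = α̃(bⱼ)` for a `ℤ`-basis `b` of the signed principal-unit lattice `Λ^±`
(`Summits/ABC/StewartYu/PrincipalUnitLattice*.lean`) chosen by the geometry of numbers:

* `volume_weighted_lt_one` / `_le_one`: the weighted cross-polytope `{∑ wᵢ|xᵢ| < 1}` has volume
  `2^m/(m! ∏ wᵢ)` (Mathlib's `volume_sum_rpow_lt_one`, `p = 1`, and a diagonal change of variables);
* `exists_basis_prod_weighted_le`: a finite-index `L ≤ ℤ^m` (index `d`) has a `ℤ`-basis with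
  `∏ⱼ F(bⱼ) ≤ (m!)² d ∏ wᵢ`, `F(x) = ∑ wᵢ|xᵢ|` — Minkowski's second theorem and Mahler's basis theorem,
  both PROVED in the tree for `ℤ^m` (`Dioph.exists_directional_system_prod_mul_volume_le`
  [cite: EvertseGyory2015, Thm 4.3.1 (p. 70)], `Dioph.exists_int_basis_le_of_directional`
  [cite: EvertseGyory2015, Thm 4.3.3 (p. 70)]), transported to `L` by a basis matrix;
* `card_mul_abs_repr_mul_prod_le`: Cramer's rule and Evertse–Győry's Lemma 4.3.6
  (`Dioph.abs_det_le_of_seminorm`, proved in the tree) bound basis coordinates: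
  `d |cⱼ| ∏ wᵢ ≤ F(x) ∏_{k≠j} F(b_k)`;
* `factorial_sq_mul_le`: `(m!)² m ≤ 3 (log 2)^m m^{2m}` (so that `(m!)² F(e)/F(bⱼ)` fits the
  interface's `m^{2m} p (∏ log qᵢ) max|eᵢ|`, using `F(bⱼ) ≥ log 2`, `∑ log qᵢ ≤ m ∏ log qᵢ/(log 2)^{m−1}`,
  `p ≥ 3`).

With `wᵢ = log qᵢ`: `h(αⱼ) ≤ F(bⱼ)`, `d ≤ p − 1`, `(m!)² ≤ m^{2m}` give the heights product; the
Kummer condition, independence, congruences and the identity (sign `+1` as `p ≠ 2`) are the basis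
lemmas of `Summits/ABC/StewartYu/PrincipalUnitLatticeKummer.lean`. Everything is [folklore] geometry of numbers; the only
printed inputs (Minkowski, Mahler, Lemma 4.3.6) were already proved in the tree.

## References

* [EvertseGyory2015] J.-H. Evertse, K. Győry, *Unit Equations in Diophantine Number Theory*,
  Cambridge Stud. Adv. Math. 146, CUP 2015 — Thm 4.3.1, Thm 4.3.3 (p. 70), Lemma 4.3.6 (p. 72).
-/

section Part6

namespace Literature.NumberTheory.Transcendental.StewartYu.PrincipalLattice

open _root_.Module _root_.Finset Height

/-! ### The reduction theorem (WP-M): principal, Kummer-free generators -/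

/-- **Reduction to signed principal-unit generators** (work package WP-M of the kernel `p`-adic
Baker bound; the statement is `AbcStewartYuPlan.WPM` of the cell's skeleton, verbatim). Let `p`
be an odd prime, `q₁, …, q_m` distinct primes `≠ p` and `e ∈ ℤ^m ∖ {0}` with
`ord_p(∏ qᵢ^{eᵢ} − 1) ≥ 1`. Then there are rationals `α₁, …, α_m` and `e' ∈ ℤ^m ∖ {0}` with:
`αⱼ ≡ 1 (mod p)` (`ord_p(αⱼ − 1) ≥ 1`); the `αⱼ` multiplicatively independent; no non-empty
sub-product of the `αⱼ` a square in `ℚ` (the Kummer condition of the Cijsouw–Waldschmidt descent);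
`∏ qᵢ^{eᵢ} = ∏ αⱼ^{e'ⱼ}`; `∏ h(αⱼ) ≤ m^{2m} · p · ∏ log qᵢ`;
`|e'ⱼ| ≤ m^{2m} · p · (∏ log qᵢ) · max|eᵢ|`; and `log p ≤ 2 h(αⱼ)`.
Construction: `αⱼ = α̃(bⱼ) = χ(bⱼ) ∏ qᵢ^{bⱼᵢ}` for a `ℤ`-basis `b` of the signed principal-unit
lattice `Λ^± = {z : ∏ qᵢ^{zᵢ} ≡ ±1 (mod p)}` (index `d ≤ p − 1`) with
`∏ⱼ F(bⱼ) ≤ (m!)² d ∏ log qᵢ`, `F(z) = ∑ |zᵢ| log qᵢ ≥ h(α̃(z))` (Minkowski's second theorem +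
Mahler's basis theorem, `exists_basis_prod_weighted_le`); `e ∈ Λ^±` and `e'` = its coordinates
(Cramer: `|e'ⱼ| F(bⱼ) ≤ (m!)² F(e)`, `card_mul_abs_repr_mul_prod_le`); the sign of `∏ αⱼ^{e'ⱼ}`
is `+1` as `p ≠ 2` (`prod_signedProd_zpow_repr`); Kummer-freeness is
`not_isSquare_prod_signedProd_basis`; the numerical step is `(m!)² m ≤ 3 (log 2)^m m^{2m}` and
`∑ log qᵢ ≤ m (∏ log qᵢ)/(log 2)^{m−1}`. [cite: EvertseGyory2015, Thm 4.3.3 (p. 70) with StewartTijdeman1986, proof of Theorem 1 (WP-M: reduction of p-adic linear forms in logarithms of primes to Kummer-free principal generators)] -/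
theorem exists_principal_generators :
    ∀ (p : ℕ), p.Prime → p ≠ 2 → ∀ (m : ℕ) (q : Fin m → ℕ),
    (∀ i, (q i).Prime) → Function.Injective q → (∀ i, q i ≠ p) →
    ∀ (e : Fin m → ℤ), e ≠ 0 → 1 ≤ padicValRat p (∏ i, (q i : ℚ) ^ e i - 1) →
    ∃ (α : Fin m → ℚ) (e' : Fin m → ℤ),
      (∀ j, α j ≠ 0 ∧ 1 ≤ padicValRat p (α j - 1)) ∧
      (∀ μ : Fin m → ℤ, ∏ j, α j ^ μ j = 1 → μ = 0) ∧
      (∀ T : Finset (Fin m), T.Nonempty → ¬ IsSquare (∏ j ∈ T, α j)) ∧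
      e' ≠ 0 ∧ ∏ i, (q i : ℚ) ^ e i = ∏ j, α j ^ e' j ∧
      (∏ j, logHeight₁ (α j)) ≤ (m : ℝ) ^ (2 * m) * p * ∏ i, Real.log (q i) ∧
      (∀ j, (|e' j| : ℝ) ≤
        (m : ℝ) ^ (2 * m) * p * (∏ i, Real.log (q i)) * (Finset.univ.sup fun i => (e i).natAbs)) ∧
      (∀ j, Real.log p ≤ 2 * logHeight₁ (α j)) := by
  intro p hp hp2 m q hq hinj hqp e he hval
  classical
  haveI := Fact.mk hp
  -- `m = 0` is impossible
  rcases Nat.eq_zero_or_pos m with hm | hm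
  · subst hm; exact absurd (funext fun i => Fin.elim0 i) he
  have hq0 : ∀ i, ((q i : ℕ) : ZMod p) ≠ 0 := fun i h =>
    hqp i (((Nat.prime_dvd_prime_iff_eq hp (hq i)).mp ((ZMod.natCast_eq_zero_iff _ _).mp h)).symm)
  -- weights `wᵢ = log qᵢ`
  set w : Fin m → ℝ := fun i => Real.log (q i) with hw
  have hwpos : ∀ i, 0 < w i := fun i => Real.log_pos (by exact_mod_cast (hq i).one_lt)
  have hwge : ∀ i, Real.log 2 ≤ w i := fun i =>
    Real.log_le_log two_pos (by exact_mod_cast (hq i).two_le)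
  have hΩ : 0 < ∏ i, w i := Finset.prod_pos fun i _ => hwpos i
  have hL : (0.6931471803 : ℝ) < Real.log 2 := Real.log_two_gt_d9
  have hL0 : 0 < Real.log 2 := by linarith
  -- the lattice `Λ^±` and its index `d ≤ p − 1`
  set L := latPMSub q hq0 with hLdef
  have hidx := index_latPM_le q hq0
  have hcardL : Nat.card ((Fin m → ℤ) ⧸ L) = (latPM q hq0).index := rfl
  haveI : Finite ((Fin m → ℤ) ⧸ L) :=
    Nat.finite_of_card_ne_zero (by rw [hcardL]; exact hidx.2.ne')
  set d : ℕ := Nat.card ((Fin m → ℤ) ⧸ L) with hd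
  have hd0 : 0 < d := by rw [hcardL]; exact hidx.2
  have hdp : (d : ℝ) ≤ p := by
    have h1 : d ≤ p - 1 := by rw [hcardL]; exact hidx.1
    have h2 : p - 1 ≤ p := Nat.sub_le p 1
    exact_mod_cast h1.trans h2
  -- the good basis and the generators
  obtain ⟨b, hb⟩ := exists_basis_prod_weighted_le hm L w hwpos
  have heker := expHom_eq_zero_of_one_le_padicValRat q hq hqp hq0 hval
  have heΛ : e ∈ latPM q hq0 := mem_latPM_of_one_le_padicValRat q hq hqp hq0 hval
  set eL : L := ⟨e, heΛ⟩ with heL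
  set α : Fin m → ℚ := fun j => signedProd q hq0 (b j : Fin m → ℤ) with hα
  set e' : Fin m → ℤ := fun j => b.equivFun eL j with he'
  have hbne : ∀ j, ((b j : L) : Fin m → ℤ) ≠ 0 := fun j h =>
    b.ne_zero j (Subtype.ext h)
  have hα1 : ∀ j, 1 ≤ padicValRat p (α j - 1) := fun j =>
    one_le_padicValRat_signedProd_sub_one q hq hinj hqp hq0 (b j).2 (hbne j)
  -- the weighted norms `F(b_j) ≥ log 2` and `F(e) ≤ B ∑ wᵢ`
  set Fb : Fin m → ℝ := fun j => ∑ i, w i * |(((b j : L) : Fin m → ℤ) i : ℝ)| with hFb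
  have hFb_ge : ∀ j, Real.log 2 ≤ Fb j := by
    intro j
    obtain ⟨i, hi⟩ : ∃ i, ((b j : L) : Fin m → ℤ) i ≠ 0 := by
      by_contra h; push Not at h; exact hbne j (funext h)
    have h1 : (1 : ℝ) ≤ |(((b j : L) : Fin m → ℤ) i : ℝ)| := by
      rw [← Int.cast_abs]; exact_mod_cast Int.one_le_abs hi
    calc Real.log 2 ≤ w i * |(((b j : L) : Fin m → ℤ) i : ℝ)| := by
          nlinarith [hwge i, hwpos i]
      _ ≤ Fb j := Finset.single_le_sum (f := fun i => w i * |(((b j : L) : Fin m → ℤ) i : ℝ)|)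
          (fun k _ => mul_nonneg (hwpos k).le (abs_nonneg _)) (Finset.mem_univ i)
  have hFb_pos : ∀ j, 0 < Fb j := fun j => hL0.trans_le (hFb_ge j)
  set Bmax : ℝ := ((Finset.univ.sup fun i => (e i).natAbs : ℕ) : ℝ) with hBmax
  have hBmax0 : 0 ≤ Bmax := Nat.cast_nonneg _
  have heB : ∀ i, |(e i : ℝ)| ≤ Bmax := by
    intro i
    rw [← Int.cast_abs, show ((|e i| : ℤ) : ℝ) = ((e i).natAbs : ℝ) by
      rw [Nat.cast_natAbs], hBmax]
    exact_mod_cast Finset.le_sup (f := fun i => (e i).natAbs) (Finset.mem_univ i)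
  have hFe : ∑ i, w i * |(e i : ℝ)| ≤ Bmax * ∑ i, w i := by
    rw [Finset.mul_sum]
    exact Finset.sum_le_sum fun i _ => by
      rw [mul_comm Bmax]; exact mul_le_mul_of_nonneg_left (heB i) (hwpos i).le
  -- `(log 2)^{m-1} ∑ wᵢ ≤ m ∏ wᵢ`
  have hsumw : Real.log 2 ^ (m - 1) * ∑ i, w i ≤ m * ∏ i, w i := by
    rw [Finset.mul_sum]
    have h1 : ∀ i, Real.log 2 ^ (m - 1) * w i ≤ ∏ k, w k := by
      intro i
      rw [← Finset.mul_prod_erase Finset.univ w (Finset.mem_univ i), mul_comm]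
      refine mul_le_mul_of_nonneg_left ?_ (hwpos i).le
      have hcard : (Finset.univ.erase i).card = m - 1 := by
        rw [Finset.card_erase_of_mem (Finset.mem_univ i), Finset.card_univ, Fintype.card_fin]
      calc Real.log 2 ^ (m - 1) = ∏ _k ∈ Finset.univ.erase i, Real.log 2 := by
            rw [Finset.prod_const, hcard]
        _ ≤ ∏ k ∈ Finset.univ.erase i, w k :=
            Finset.prod_le_prod (fun k _ => hL0.le) fun k _ => hwge k
    calc ∑ i, Real.log 2 ^ (m - 1) * w i ≤ ∑ _i : Fin m, ∏ k, w k :=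
          Finset.sum_le_sum fun i _ => h1 i
      _ = m * ∏ i, w i := by rw [Finset.sum_const, Finset.card_univ, Fintype.card_fin]; ring
  -- numerical constants
  have hfact := factorial_sq_mul_le m
  have hp3 : (3 : ℝ) ≤ p := by
    have := hp.two_le
    have h3 : 3 ≤ p := by omega
    exact_mod_cast h3
  have hmfac : ((m.factorial : ℝ)) ^ 2 ≤ (m : ℝ) ^ (2 * m) := by
    rw [pow_mul', ← Nat.cast_pow]
    have := Nat.factorial_le_pow m
    exact_mod_cast pow_le_pow_left₀ (Nat.cast_nonneg _) (show (m.factorial : ℝ) ≤ (m ^ m : ℕ) by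
      exact_mod_cast this) 2
  refine ⟨α, e', fun j => ⟨?_, hα1 j⟩, ?_, ?_, ?_, ?_, ?_, ?_, fun j => ?_⟩
  · -- `αⱼ ≠ 0`
    rw [hα]
    simp only
    unfold signedProd
    refine mul_ne_zero ?_ (prod_zpow_pos q hq _).ne'
    rcases unitSign_eq_or q hq0 ((b j : L) : Fin m → ℤ) with h | h <;> rw [h] <;> norm_num
  · -- multiplicative independence
    exact fun μ hμ => signedProd_basis_independent q hq0 b hq hinj μ hμ
  · -- Kummer condition
    exact fun T hT => not_isSquare_prod_signedProd_basis q hq0 b hq hinj T hT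
  · -- `e' ≠ 0`
    intro h0
    apply he
    have h1 : b.equivFun eL = 0 := funext fun j => congrFun h0 j
    have h2 : eL = 0 := (LinearEquiv.map_eq_zero_iff _).mp h1
    exact congrArg Subtype.val h2
  · -- the identity
    exact prod_signedProd_zpow_repr q hq0 b hq hp2 heker heΛ
  · -- heights product
    calc ∏ j, logHeight₁ (α j) ≤ ∏ j, Fb j :=
          Finset.prod_le_prod (fun j _ => Height.zero_le_logHeight₁ _)
            fun j _ => logHeight₁_signedProd_le q hq hq0 _
      _ ≤ (m.factorial : ℝ) ^ 2 * d * ∏ i, w i := hb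
      _ ≤ (m : ℝ) ^ (2 * m) * p * ∏ i, w i := by gcongr
  · -- the exponents `e'`
    intro j
    have hcr := card_mul_abs_repr_mul_prod_le hm L b w hwpos eL j
    rw [← hd] at hcr
    have he'j : (b.repr eL j : ℝ) = (e' j : ℝ) := by
      rw [he']; simp only [Module.Basis.equivFun_apply]
    rw [he'j] at hcr
    -- `d |e'ⱼ| Ω Fb j ≤ F(e) ∏ Fb ≤ F(e) (m!)² d Ω`
    have h1 : (d : ℝ) * |(e' j : ℝ)| * (∏ i, w i) * Fb j ≤
        (∑ i, w i * |(e i : ℝ)|) * ((m.factorial : ℝ) ^ 2 * d * ∏ i, w i) := by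
      have h2 := mul_le_mul_of_nonneg_right hcr (hFb_pos j).le
      have h3 : (∏ k ∈ Finset.univ.erase j, Fb k) * Fb j = ∏ k, Fb k := by
        rw [mul_comm, Finset.mul_prod_erase _ _ (Finset.mem_univ j)]
      calc (d : ℝ) * |(e' j : ℝ)| * (∏ i, w i) * Fb j
          ≤ (∑ i, w i * |(e i : ℝ)|) * (∏ k ∈ Finset.univ.erase j, Fb k) * Fb j := h2
        _ = (∑ i, w i * |(e i : ℝ)|) * ∏ k, Fb k := by rw [mul_assoc, h3]
        _ ≤ (∑ i, w i * |(e i : ℝ)|) * ((m.factorial : ℝ) ^ 2 * d * ∏ i, w i) :=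
            mul_le_mul_of_nonneg_left hb
              (Finset.sum_nonneg fun i _ => mul_nonneg (hwpos i).le (abs_nonneg _))
    -- cancel `d Ω > 0`: `|e'ⱼ| Fb j ≤ (m!)² F(e)`
    have h4 : |(e' j : ℝ)| * Fb j ≤ (m.factorial : ℝ) ^ 2 * ∑ i, w i * |(e i : ℝ)| := by
      have hdΩ : (0 : ℝ) < d * ∏ i, w i := mul_pos (by exact_mod_cast hd0) hΩ
      have : (d * ∏ i, w i) * (|(e' j : ℝ)| * Fb j) ≤
          (d * ∏ i, w i) * ((m.factorial : ℝ) ^ 2 * ∑ i, w i * |(e i : ℝ)|) := by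
        calc (d * ∏ i, w i) * (|(e' j : ℝ)| * Fb j)
            = (d : ℝ) * |(e' j : ℝ)| * (∏ i, w i) * Fb j := by ring
          _ ≤ (∑ i, w i * |(e i : ℝ)|) * ((m.factorial : ℝ) ^ 2 * d * ∏ i, w i) := h1
          _ = (d * ∏ i, w i) * ((m.factorial : ℝ) ^ 2 * ∑ i, w i * |(e i : ℝ)|) := by ring
      exact le_of_mul_le_mul_left this hdΩ
    -- `|e'ⱼ| (log 2)^m ≤ (m!)² Bmax (log 2)^{m-1} ∑ w ≤ (m!)² m Bmax Ω ≤ 3 (log 2)^m m^{2m} Bmax Ω`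
    have h5 : |(e' j : ℝ)| * Real.log 2 ^ m ≤
        3 * Real.log 2 ^ m * (m : ℝ) ^ (2 * m) * Bmax * ∏ i, w i := by
      have hm1 : Real.log 2 ^ m = Real.log 2 ^ (m - 1) * Real.log 2 :=
        (pow_sub_one_mul hm.ne' _).symm
      calc |(e' j : ℝ)| * Real.log 2 ^ m
          = (|(e' j : ℝ)| * Real.log 2) * Real.log 2 ^ (m - 1) := by rw [hm1]; ring
        _ ≤ (|(e' j : ℝ)| * Fb j) * Real.log 2 ^ (m - 1) :=
            mul_le_mul_of_nonneg_right (mul_le_mul_of_nonneg_left (hFb_ge j) (abs_nonneg _))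
              (by positivity)
        _ ≤ ((m.factorial : ℝ) ^ 2 * (Bmax * ∑ i, w i)) * Real.log 2 ^ (m - 1) :=
            mul_le_mul_of_nonneg_right
              (h4.trans (mul_le_mul_of_nonneg_left hFe (by positivity))) (by positivity)
        _ = (m.factorial : ℝ) ^ 2 * Bmax * (Real.log 2 ^ (m - 1) * ∑ i, w i) := by ring
        _ ≤ (m.factorial : ℝ) ^ 2 * Bmax * (m * ∏ i, w i) :=
            mul_le_mul_of_nonneg_left hsumw (by positivity)
        _ = ((m.factorial : ℝ) ^ 2 * m) * Bmax * ∏ i, w i := by ring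
        _ ≤ (3 * Real.log 2 ^ m * (m : ℝ) ^ (2 * m)) * Bmax * ∏ i, w i := by gcongr
        _ = 3 * Real.log 2 ^ m * (m : ℝ) ^ (2 * m) * Bmax * ∏ i, w i := by ring
    have h6 : |(e' j : ℝ)| ≤ 3 * (m : ℝ) ^ (2 * m) * Bmax * ∏ i, w i := by
      have hLm : (0 : ℝ) < Real.log 2 ^ m := by positivity
      have : Real.log 2 ^ m * |(e' j : ℝ)| ≤
          Real.log 2 ^ m * (3 * (m : ℝ) ^ (2 * m) * Bmax * ∏ i, w i) := by
        calc Real.log 2 ^ m * |(e' j : ℝ)| = |(e' j : ℝ)| * Real.log 2 ^ m := mul_comm _ _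
          _ ≤ _ := h5
          _ = Real.log 2 ^ m * (3 * (m : ℝ) ^ (2 * m) * Bmax * ∏ i, w i) := by ring
      exact le_of_mul_le_mul_left this hLm
    calc |(e' j : ℝ)| ≤ 3 * (m : ℝ) ^ (2 * m) * Bmax * ∏ i, w i := h6
      _ ≤ (p : ℝ) * (m : ℝ) ^ (2 * m) * Bmax * ∏ i, w i := by gcongr
      _ = (m : ℝ) ^ (2 * m) * p * (∏ i, w i) * Bmax := by ring
  · -- the floor
    exact log_le_two_mul_logHeight₁ hp2 (hα1 j)

end Literature.NumberTheory.Transcendental.StewartYu.PrincipalLattice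

end Part6

/-!
## Part 7 — port of `Summits/ABC/StewartYu/GluePrincipalToPrime.lean` (8 declarations kept)

# Cell abc-stewartyu, WP-S glue: principal-unit reduction (WP-M) ∧ `p`-adic Cijsouw–Waldschmidt for
# principal units (Theorem A) ⇒ the prime-argument bound (Theorem P) at every odd prime

`Summits/ABC/StewartYu/GluePrincipalToPrime.lean` — cell `abc-stewartyu` (HOME
`run/shared/lean/pub/abc-stewartyu/`, seat p3; theorems only, no definition, no named fact). This is the
stub `stub_glue : GlueSpec` of the planner's G0 skeleton `HOME/plan/Skeleton.lean` (architecture of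
record `HOME/p2/PADIC-CORE.md` v0, DAG `HOME/plan/DAG.md` §3), PROVED: the two work-package statements
are taken as explicit hypotheses (binders `hM` = the body of `AbcStewartYuPlan.WPM`, `hA` = the body of
`AbcStewartYuPlan.PadicCW77Bound C r`, verbatim), and the conclusion is the body of
`AbcStewartYuPlan.PrimePadicBoundAt p K L κ 2 2 2` at every odd prime `p` with the explicit constants
`K = 4704`, `L = 32 c₁`, `κ = c₂ + 2` (the skeleton asks for `κ ≤ c₂ + 5`).

Book-keeping (all elementary): for `v = ord_p(∏ qᵢ^{eᵢ} − 1) ≥ 1` take the generators `αⱼ ≡ 1 (p)`,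
exponents `e'` of `hM`; feed `hA` with `Vⱼ = max(h(αⱼ), log p) ≤ 2 h(αⱼ)` (floor clause
`log p ≤ 2 h(αⱼ)`), `Vmax = ∏ Vⱼ ≤ 2ⁿ n^{2n} p Ω` (`Ω = ∏ log qᵢ`; every `Vⱼ ≥ log p ≥ 1`),
`W = log max(3, n^{2n} p Ω B)`; then `log p ≥ 1` removes `/ (log p)^r` and the factor `log p` on the
left, and `W ≤ 2n² + log p + L_Q + L_B`, `log(2 Vmax) ≤ 2n² + n + 2 + log p + L_Q`
(`L_Q = log max(3, ∏ qᵢ) ≥ log Ω`, `L_B = log max(3, max|eᵢ|)`), `a + x ≤ a(1 + x)` (`a ≥ 1`),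
`1 + log p ≤ 2√p`, `n⁴ ≤ 16ⁿ` give
`v ≤ 4704 · (32 c₁)ⁿ · n^{(c₂+2) n} · p² · Ω · L_B² · L_Q²`. Everything is [folklore].
-/

section Part7

open _root_.Finset _root_.Real Height
open Literature.NumberTheory.DiophantineGeometry

namespace Literature.NumberTheory.Transcendental.StewartYu

namespace Glue

/-! ### Elementary inequalities -/

/-- `a + x ≤ a (1 + x)` for `a ≥ 1`, `x ≥ 0`. [cite: StewartTijdeman1986, proof of Theorem 1 (principal-unit reduction ∧ the principal-unit lower bound ⇒ the one-prime bound at every odd prime)] -/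
theorem add_le_mul_one_add {a x : ℝ} (ha : 1 ≤ a) (hx : 0 ≤ x) : a + x ≤ a * (1 + x) := by
  nlinarith

/-- `1 + log p ≤ 2 √p` for `p ≥ 1` (`log √p ≤ √p − 1`). [folklore] -/
private theorem one_add_log_le_two_sqrt {p : ℝ} (hp : 1 ≤ p) : 1 + Real.log p ≤ 2 * Real.sqrt p := by
  have hs : 0 < Real.sqrt p := Real.sqrt_pos.mpr (by linarith)
  have hlog : Real.log (Real.sqrt p) ≤ Real.sqrt p - 1 := Real.log_le_sub_one_of_pos hs
  have h2 : Real.log (Real.sqrt p) = Real.log p / 2 := Real.log_sqrt (by linarith)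
  linarith

/-- `n⁴ ≤ 16ⁿ`. [cite: StewartTijdeman1986, proof of Theorem 1 (principal-unit reduction ∧ the principal-unit lower bound ⇒ the one-prime bound at every odd prime)] -/
theorem pow_four_le_sixteen_pow (n : ℕ) : ((n : ℝ)) ^ 4 ≤ (16 : ℝ) ^ n := by
  have h : (n : ℝ) ≤ 2 ^ n := by exact_mod_cast Nat.lt_two_pow_self.le
  calc ((n : ℝ)) ^ 4 ≤ ((2 : ℝ) ^ n) ^ 4 := pow_le_pow_left₀ (Nat.cast_nonneg n) h 4
    _ = (16 : ℝ) ^ n := by rw [← pow_mul, mul_comm, pow_mul]; norm_num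

/-- `log Ω ≤ log max(3, ∏ qᵢ)` for `Ω = ∏ log qᵢ`, `qᵢ ≥ 2` (`log q ≤ q`). [cite: StewartTijdeman1986, proof of Theorem 1 (principal-unit reduction ∧ the principal-unit lower bound ⇒ the one-prime bound at every odd prime)] -/
theorem log_prod_log_le {n : ℕ} (q : Fin n → ℕ) (hq : ∀ i, 2 ≤ q i) :
    Real.log (∏ i, Real.log (q i)) ≤ Real.log (max 3 (∏ i, ((q i : ℕ) : ℝ))) := by
  have hpos : 0 < ∏ i, Real.log (q i) :=
    Finset.prod_pos fun i _ => Real.log_pos (by exact_mod_cast (hq i))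
  apply Real.log_le_log hpos
  refine le_trans ?_ (le_max_right _ _)
  exact Finset.prod_le_prod (fun i _ => (Real.log_pos (by exact_mod_cast (hq i))).le)
    fun i _ => (Real.log_le_sub_one_of_pos (by exact_mod_cast (by linarith [hq i] : 0 < q i))).trans
      (by linarith)

/-- The real-arithmetic heart of the glue. With `n ≥ 1`, `p ≥ 3`, `Ω > 0`, `L_Q, L_B ≥ 1`,
`1 ≤ lp`, `1 + lp ≤ 2√p`: if `0 ≤ Cn ≤ c₁ⁿ n^{c₂ n}`, `0 ≤ PV ≤ 2ⁿ n^{2n} p Ω`,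
`0 ≤ L2V ≤ (2n²+n+2) + lp + L_Q`, `0 ≤ W ≤ 2n² + lp + L_Q + L_B` and `v ≤ Cn · PV · ((W + L2V) · L2V)`,
then `v ≤ 4704 (32c₁)ⁿ n^{(c₂+2)n} p² Ω L_B² L_Q²`. [cite: StewartTijdeman1986, proof of Theorem 1 (principal-unit reduction ∧ the principal-unit lower bound ⇒ the one-prime bound at every odd prime)] -/
theorem bookkeeping {n : ℕ} {p c₁ c₂ Cn PV L2V W v Ω LQ LB lp : ℝ} (hn : 1 ≤ n) (hp : 3 ≤ p)
    (hc₁ : 1 ≤ c₁) (hΩ : 0 < Ω) (hLQ : 1 ≤ LQ) (hLB : 1 ≤ LB)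
    (hlp1 : 1 ≤ lp) (hlp : 1 + lp ≤ 2 * Real.sqrt p)
    (hCn : Cn ≤ c₁ ^ n * (n : ℝ) ^ (c₂ * n))
    (hPV0 : 0 ≤ PV) (hPV : PV ≤ 2 ^ n * (n : ℝ) ^ (2 * n) * p * Ω)
    (hL2V0 : 0 ≤ L2V) (hL2V : L2V ≤ (2 * (n : ℝ) ^ 2 + n + 2) + lp + LQ)
    (hW0 : 0 ≤ W) (hW : W ≤ 2 * (n : ℝ) ^ 2 + lp + LQ + LB)
    (hv : v ≤ Cn * PV * ((W + L2V) * L2V)) :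
    v ≤ 4704 * (32 * c₁) ^ n * (n : ℝ) ^ ((c₂ + 2) * n) * p ^ 2 * Ω * LB ^ 2 * LQ ^ 2 := by
  have hn0 : (0 : ℝ) < n := by exact_mod_cast (show 0 < n by omega)
  have hn1 : (1 : ℝ) ≤ n := by exact_mod_cast hn
  have hp0 : 0 < p := by linarith
  have hsq : Real.sqrt p ^ 2 = p := Real.sq_sqrt hp0.le
  have hs0 : 0 ≤ Real.sqrt p := Real.sqrt_nonneg p
  set a : ℝ := 2 * (n : ℝ) ^ 2 + n + 2 with ha
  set b : ℝ := 4 * (n : ℝ) ^ 2 + n + 2 with hb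
  have hn2 : (0 : ℝ) ≤ (n : ℝ) ^ 2 := sq_nonneg _
  have ha1 : 1 ≤ a := by rw [ha]; linarith
  have hb1 : 1 ≤ b := by rw [hb]; linarith
  -- `L2V ≤ 2 a (1 + lp) LQ`
  have hL2V' : L2V ≤ 2 * a * (1 + lp) * LQ := by
    have h1 : a + lp ≤ a * (1 + lp) := add_le_mul_one_add ha1 (by linarith)
    have h1' : 1 ≤ a * (1 + lp) := one_le_mul_of_one_le_of_one_le ha1 (by linarith)
    have h2 : a * (1 + lp) + LQ ≤ a * (1 + lp) * (1 + LQ) := add_le_mul_one_add h1' (by linarith)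
    have h3 : a * (1 + lp) * (1 + LQ) ≤ a * (1 + lp) * (2 * LQ) :=
      mul_le_mul_of_nonneg_left (by linarith) (by linarith)
    linarith
  -- `W + L2V ≤ 6 b (1 + 2 lp) LQ LB`
  have hWL : W + L2V ≤ 6 * b * (1 + 2 * lp) * LQ * LB := by
    have h0 : W + L2V ≤ b + 2 * lp + 2 * LQ + LB := by rw [hb]; linarith
    have h1 : b + 2 * lp ≤ b * (1 + 2 * lp) := add_le_mul_one_add hb1 (by linarith)
    have h1' : 1 ≤ b * (1 + 2 * lp) := one_le_mul_of_one_le_of_one_le hb1 (by linarith)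
    have h2 : b * (1 + 2 * lp) + 2 * LQ ≤ b * (1 + 2 * lp) * (1 + 2 * LQ) :=
      add_le_mul_one_add h1' (by linarith)
    have h2' : 1 ≤ b * (1 + 2 * lp) * (1 + 2 * LQ) :=
      one_le_mul_of_one_le_of_one_le h1' (by linarith)
    have h3 : b * (1 + 2 * lp) * (1 + 2 * LQ) + LB ≤ b * (1 + 2 * lp) * (1 + 2 * LQ) * (1 + LB) :=
      add_le_mul_one_add h2' (by linarith)
    have h4 : b * (1 + 2 * lp) * (1 + 2 * LQ) * (1 + LB) ≤ b * (1 + 2 * lp) * (3 * LQ) * (2 * LB) := by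
      have hb0 : 0 ≤ b * (1 + 2 * lp) := mul_nonneg (by linarith) (by linarith)
      apply mul_le_mul _ (by linarith) (by linarith) (by positivity)
      exact mul_le_mul_of_nonneg_left (by linarith) hb0
    linarith
  -- `(1 + lp)(1 + 2 lp) ≤ 8 p`
  have hlp2 : (1 + lp) * (1 + 2 * lp) ≤ 8 * p := by
    have h1 : (1 + lp) ^ 2 ≤ (2 * Real.sqrt p) ^ 2 := pow_le_pow_left₀ (by linarith) hlp 2
    have h2 : (2 * Real.sqrt p) ^ 2 = 4 * p := by rw [mul_pow, hsq]; norm_num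
    have h3 : (1 + lp) * (1 + 2 * lp) ≤ (1 + lp) * (2 * (1 + lp)) :=
      mul_le_mul_of_nonneg_left (by linarith) (by linarith)
    have h4 : (1 + lp) * (2 * (1 + lp)) = 2 * (1 + lp) ^ 2 := by ring
    linarith
  -- the product of the two logarithmic factors
  have hprod : (W + L2V) * L2V ≤ 96 * (a * b) * p * LQ ^ 2 * LB := by
    have h := mul_le_mul hWL hL2V' hL2V0 (by positivity)
    calc (W + L2V) * L2V ≤ (6 * b * (1 + 2 * lp) * LQ * LB) * (2 * a * (1 + lp) * LQ) := h
      _ = 12 * (a * b) * ((1 + lp) * (1 + 2 * lp)) * LQ ^ 2 * LB := by ring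
      _ ≤ 12 * (a * b) * (8 * p) * LQ ^ 2 * LB := by
          have : 0 ≤ 12 * (a * b) := by positivity
          have hL : 0 ≤ LQ ^ 2 * LB := by positivity
          apply mul_le_mul_of_nonneg_right _ (by positivity)
          apply mul_le_mul_of_nonneg_right _ (by positivity)
          exact mul_le_mul_of_nonneg_left hlp2 this
      _ = 96 * (a * b) * p * LQ ^ 2 * LB := by ring
  -- `a b ≤ 49 n⁴ ≤ 49 · 16ⁿ`
  have hab : a * b ≤ 49 * (16 : ℝ) ^ n := by
    have hnn : (n : ℝ) ≤ (n : ℝ) ^ 2 := by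
      rw [sq]; exact le_mul_of_one_le_left hn0.le hn1
    have ha5 : a ≤ 5 * (n : ℝ) ^ 2 := by rw [ha]; linarith
    have hb7 : b ≤ 7 * (n : ℝ) ^ 2 := by rw [hb]; linarith
    have h16 := pow_four_le_sixteen_pow n
    have hn4 : (0 : ℝ) ≤ (n : ℝ) ^ 4 := pow_nonneg hn0.le 4
    calc a * b ≤ (5 * (n : ℝ) ^ 2) * (7 * (n : ℝ) ^ 2) := mul_le_mul ha5 hb7 (by positivity) (by positivity)
      _ = 35 * (n : ℝ) ^ 4 := by ring
      _ ≤ 49 * (16 : ℝ) ^ n := by linarith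
  -- powers of `n`
  have hnpow : (n : ℝ) ^ (c₂ * n) * (n : ℝ) ^ (2 * n) = (n : ℝ) ^ ((c₂ + 2) * n) := by
    rw [← Real.rpow_natCast (n : ℝ) (2 * n), ← Real.rpow_add hn0]
    congr 1; push_cast; ring
  have hLB2 : LB ≤ LB ^ 2 := by
    rw [sq]; exact le_mul_of_one_le_left (by linarith) hLB
  -- assemble
  have hA : 0 ≤ c₁ ^ n * (n : ℝ) ^ (c₂ * n) := by positivity
  have hB : 0 ≤ 2 ^ n * (n : ℝ) ^ (2 * n) * p * Ω := by positivity
  have hC0 : 0 ≤ (W + L2V) * L2V := by positivity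
  calc v ≤ Cn * PV * ((W + L2V) * L2V) := hv
    _ ≤ (c₁ ^ n * (n : ℝ) ^ (c₂ * n)) * (2 ^ n * (n : ℝ) ^ (2 * n) * p * Ω) *
          (96 * (a * b) * p * LQ ^ 2 * LB) := by
        apply mul_le_mul (mul_le_mul hCn hPV hPV0 hA) hprod hC0 (mul_nonneg hA hB)
    _ ≤ (c₁ ^ n * (n : ℝ) ^ (c₂ * n)) * (2 ^ n * (n : ℝ) ^ (2 * n) * p * Ω) *
          (96 * (49 * (16 : ℝ) ^ n) * p * LQ ^ 2 * LB ^ 2) := by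
        apply mul_le_mul_of_nonneg_left _ (mul_nonneg hA hB)
        apply mul_le_mul _ hLB2 (by linarith) (by positivity)
        apply mul_le_mul_of_nonneg_right _ (by positivity)
        apply mul_le_mul_of_nonneg_right _ hp0.le
        exact mul_le_mul_of_nonneg_left hab (by norm_num)
    _ = 4704 * (c₁ ^ n * 2 ^ n * (16 : ℝ) ^ n) * ((n : ℝ) ^ (c₂ * n) * (n : ℝ) ^ (2 * n)) *
          p ^ 2 * Ω * LB ^ 2 * LQ ^ 2 := by ring
    _ = 4704 * (32 * c₁) ^ n * (n : ℝ) ^ ((c₂ + 2) * n) * p ^ 2 * Ω * LB ^ 2 * LQ ^ 2 := by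
        rw [hnpow, mul_pow, show (32 : ℝ) ^ n = 2 ^ n * 16 ^ n by rw [← mul_pow]; norm_num]
        ring

/-- `1 ≤ ∏ f` when every factor is `≥ 1` (reals). [folklore] -/
private theorem one_le_prod {ι : Type*} (s : Finset ι) (f : ι → ℝ) (h : ∀ i ∈ s, 1 ≤ f i) :
    1 ≤ ∏ i ∈ s, f i :=
  Finset.prod_induction f (fun x => 1 ≤ x) (fun _ _ ha hb => one_le_mul_of_one_le_of_one_le ha hb)
    le_rfl h

/-- A factor `≥ 0` of a product of reals `≥ 1` is at most the product. [cite: StewartTijdeman1986, proof of Theorem 1 (principal-unit reduction ∧ the principal-unit lower bound ⇒ the one-prime bound at every odd prime)] -/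
theorem le_prod_of_one_le {ι : Type*} [DecidableEq ι] (s : Finset ι) (f : ι → ℝ)
    (h : ∀ i ∈ s, 1 ≤ f i) {j : ι} (hj : j ∈ s) : f j ≤ ∏ i ∈ s, f i := by
  rw [← Finset.mul_prod_erase s f hj]
  exact le_mul_of_one_le_right (zero_le_one.trans (h j hj))
    (one_le_prod _ _ fun i hi => h i (Finset.mem_of_mem_erase hi))

end Glue

open Glue

/-! ### The glue theorem -/

/-- **WP-S glue: WP-M ∧ Theorem A ⇒ the prime-argument bound at every odd prime** (the planner's
`GlueSpec`, `HOME/plan/Skeleton.lean`, with `K = 4704`, `L = 32 c₁`, `κ = c₂ + 2`, `σ = τ = τ₁ = 2`).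
Binder `hM` is the body of `AbcStewartYuPlan.WPM` (principal generators `αⱼ ≡ 1 (mod p)` from a
Minkowski basis, PADIC-CORE §2, with the floor clause `log p ≤ 2 h(αⱼ)`), binder `hA` the body of
`AbcStewartYuPlan.PadicCW77Bound C r` (the `p`-adic Cijsouw–Waldschmidt bound for principal units in
the symmetric shape), both verbatim; the conclusion is the body of
`AbcStewartYuPlan.PrimePadicBoundAt p 4704 (32 c₁) (c₂ + 2) 2 2 2`, i.e. the hypothesis of the landed
door `Literature.Barriers.ABC.stewartTijdeman1986_of_primePadicBound_logRad` at the prime `p`.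
Book-keeping in `Glue.bookkeeping`. [cite: StewartTijdeman1986, proof of Theorem 1 (principal-unit reduction ∧ the principal-unit lower bound ⇒ the one-prime bound at every odd prime)] -/
theorem primePadicBoundAt_odd_of_principal
    (hM : ∀ (p : ℕ), p.Prime → p ≠ 2 → ∀ (m : ℕ) (q : Fin m → ℕ),
      (∀ i, (q i).Prime) → Function.Injective q → (∀ i, q i ≠ p) →
      ∀ (e : Fin m → ℤ), e ≠ 0 → 1 ≤ padicValRat p (∏ i, (q i : ℚ) ^ e i - 1) →
      ∃ (α : Fin m → ℚ) (e' : Fin m → ℤ),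
        (∀ j, α j ≠ 0 ∧ 1 ≤ padicValRat p (α j - 1)) ∧
        (∀ μ : Fin m → ℤ, ∏ j, α j ^ μ j = 1 → μ = 0) ∧
        (∀ T : Finset (Fin m), T.Nonempty → ¬ IsSquare (∏ j ∈ T, α j)) ∧
        e' ≠ 0 ∧ ∏ i, (q i : ℚ) ^ e i = ∏ j, α j ^ e' j ∧
        (∏ j, logHeight₁ (α j)) ≤ (m : ℝ) ^ (2 * m) * p * ∏ i, Real.log (q i) ∧
        (∀ j, (|e' j| : ℝ) ≤
          (m : ℝ) ^ (2 * m) * p * (∏ i, Real.log (q i)) * (Finset.univ.sup fun i => (e i).natAbs)) ∧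
        (∀ j, Real.log p ≤ 2 * logHeight₁ (α j)))
    {C : ℕ → ℝ} {r : ℕ → ℕ} {c₁ c₂ : ℝ} (hc₁ : 1 ≤ c₁)
    (hC : ∀ m, 0 ≤ C m ∧ C m ≤ c₁ ^ m * (m : ℝ) ^ (c₂ * m))
    (hA : ∀ (p : ℕ), p.Prime → p ≠ 2 →
      ∀ (m : ℕ) (α : Fin m → ℚ) (b : Fin m → ℤ) (V : Fin m → ℝ) (Vmax W : ℝ),
        (∀ j, α j ≠ 0 ∧ 1 ≤ padicValRat p (α j - 1)) →
        (∀ μ : Fin m → ℤ, ∏ j, α j ^ μ j = 1 → μ = 0) →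
        (∀ T : Finset (Fin m), T.Nonempty → ¬ IsSquare (∏ j ∈ T, α j)) →
        (∀ j, logHeight₁ (α j) ≤ V j) → (∀ j, Real.log p ≤ V j) → (∀ j, V j ≤ Vmax) →
        b ≠ 0 → (∀ j, Real.log (max 3 (|b j| : ℝ)) ≤ W) →
        (padicValRat p (∏ j, α j ^ b j - 1) : ℝ) * Real.log p ≤
          C m * (∏ j, V j) * (W + Real.log (2 * Vmax)) * Real.log (2 * Vmax) / Real.log p ^ r m)
    {p : ℕ} (hp : p.Prime) (hp2 : p ≠ 2) (n : ℕ) (q : Fin n → ℕ) (e : Fin n → ℤ)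
    (hq : ∀ i, (q i).Prime) (hinj : Function.Injective q) (hqp : ∀ i, q i ≠ p) (he : e ≠ 0)
    (hne1 : ∏ i, ((q i : ℚ)) ^ e i ≠ 1) :
    (padicValRat p (∏ i, ((q i : ℚ)) ^ e i - 1) : ℝ) ≤
      4704 * (32 * c₁) ^ n * (n : ℝ) ^ ((c₂ + 2) * n) * (p : ℝ) ^ (2 : ℝ) * (∏ i, Real.log (q i)) *
        Real.log (max 3 ((Finset.univ.sup fun i => (e i).natAbs : ℕ) : ℝ)) ^ 2 *
        Real.log (max 3 (∏ i, ((q i : ℕ) : ℝ))) ^ 2 := by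
  classical
  -- `n ≥ 1` (else `e = 0`)
  have hn : 1 ≤ n := by
    rcases Nat.eq_zero_or_pos n with h0 | h0
    · subst h0; exact absurd (Subsingleton.elim e 0) he
    · exact h0
  have hn0 : (0 : ℝ) < n := by exact_mod_cast (show 0 < n by omega)
  -- `p ≥ 3`
  have hp3 : 3 ≤ p := by
    have := hp.two_le
    omega
  have hp3R : (3 : ℝ) ≤ p := by exact_mod_cast hp3
  have hpR0 : (0 : ℝ) < p := by linarith
  -- the quantities of the statement
  set Ω : ℝ := ∏ i, Real.log (q i) with hΩ
  set P : ℝ := ∏ i, ((q i : ℕ) : ℝ) with hP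
  set B : ℕ := Finset.univ.sup fun i => (e i).natAbs with hB
  set LQ : ℝ := Real.log (max 3 P) with hLQ
  set LB : ℝ := Real.log (max 3 (B : ℝ)) with hLB
  set lp : ℝ := Real.log p with hlp
  have hq2 : ∀ i, 2 ≤ q i := fun i => (hq i).two_le
  have hΩ0 : 0 < Ω := Finset.prod_pos fun i _ => Real.log_pos (by exact_mod_cast hq2 i)
  have hl3 : 1 ≤ Real.log 3 := by
    rw [Real.le_log_iff_exp_le (by norm_num)]
    exact Real.exp_one_lt_d9.le.trans (by norm_num)
  have hLQ1 : 1 ≤ LQ := hl3.trans (Real.log_le_log (by norm_num) (le_max_left _ _))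
  have hLB1 : 1 ≤ LB := hl3.trans (Real.log_le_log (by norm_num) (le_max_left _ _))
  have hlp1 : 1 ≤ lp := hl3.trans (Real.log_le_log (by norm_num) hp3R)
  have hlps : 1 + lp ≤ 2 * Real.sqrt p := one_add_log_le_two_sqrt (by linarith)
  have hlogΩ : Real.log Ω ≤ LQ := log_prod_log_le q hq2
  -- the right-hand side is nonnegative: the case `ord_p ≤ 0`
  have hRHS0 : 0 ≤ 4704 * (32 * c₁) ^ n * (n : ℝ) ^ ((c₂ + 2) * n) * (p : ℝ) ^ (2 : ℝ) * Ω *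
      LB ^ 2 * LQ ^ 2 := by
    have : 0 ≤ (32 * c₁) ^ n := pow_nonneg (by linarith) n
    positivity
  by_cases hv : padicValRat p (∏ i, ((q i : ℚ)) ^ e i - 1) ≤ 0
  · exact le_trans (by exact_mod_cast hv) hRHS0
  have hv1 : 1 ≤ padicValRat p (∏ i, ((q i : ℚ)) ^ e i - 1) := by omega
  -- WP-M
  obtain ⟨α, e', h1, h2, h3, h4, h5, h6, h7, h8⟩ := hM p hp hp2 n q hq hinj hqp e he hv1
  -- the sizes fed to Theorem A
  set V : Fin n → ℝ := fun j => max (logHeight₁ (α j)) lp with hV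
  have hVh : ∀ j, logHeight₁ (α j) ≤ V j := fun j => le_max_left _ _
  have hVp : ∀ j, Real.log p ≤ V j := fun j => le_max_right _ _
  have hV1 : ∀ j, 1 ≤ V j := fun j => hlp1.trans (hVp j)
  have hV2 : ∀ j, V j ≤ 2 * logHeight₁ (α j) := fun j =>
    max_le (by linarith [zero_le_logHeight₁ (α j)]) (h8 j)
  set PV : ℝ := ∏ j, V j with hPV
  have hPV1 : 1 ≤ PV := one_le_prod _ _ fun j _ => hV1 j
  have hVle : ∀ j, V j ≤ PV := fun j => le_prod_of_one_le _ _ (fun i _ => hV1 i) (Finset.mem_univ j)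
  have hPVle : PV ≤ 2 ^ n * (n : ℝ) ^ (2 * n) * p * Ω := by
    calc PV ≤ ∏ j, (2 * logHeight₁ (α j)) :=
          Finset.prod_le_prod (fun j _ => zero_le_one.trans (hV1 j)) fun j _ => hV2 j
      _ = 2 ^ n * ∏ j, logHeight₁ (α j) := by
          rw [Finset.prod_mul_distrib, Finset.prod_const, Finset.card_univ, Fintype.card_fin]
      _ ≤ 2 ^ n * ((n : ℝ) ^ (2 * n) * p * Ω) := mul_le_mul_of_nonneg_left h6 (by positivity)
      _ = _ := by ring
  set B' : ℝ := (n : ℝ) ^ (2 * n) * p * Ω * B with hB'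
  set W : ℝ := Real.log (max 3 B') with hW
  have hWj : ∀ j, Real.log (max 3 (|e' j| : ℝ)) ≤ W := fun j =>
    Real.log_le_log (lt_of_lt_of_le (by norm_num) (le_max_left _ _)) (max_le_max le_rfl (h7 j))
  -- Theorem A
  have key := hA p hp hp2 n α e' V PV W h1 h2 h3 hVh hVp hVle h4 hWj
  rw [← h5] at key
  -- remove `log p` on both sides
  set L2V : ℝ := Real.log (2 * PV) with hL2V
  have hL2V0 : 0 ≤ L2V := Real.log_nonneg (by linarith)
  have hW0 : 0 ≤ W := Real.log_nonneg (le_trans (by norm_num) (le_max_left _ _))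
  have hCn0 : 0 ≤ C n := (hC n).1
  have hX0 : 0 ≤ C n * PV * (W + L2V) * L2V := by positivity
  have hlppow : 1 ≤ Real.log p ^ r n := one_le_pow₀ hlp1
  set v : ℝ := (padicValRat p (∏ i, ((q i : ℚ)) ^ e i - 1) : ℝ) with hvdef
  have hv0 : 0 ≤ v := by rw [hvdef]; exact_mod_cast (le_trans zero_le_one hv1)
  have hvle : v ≤ C n * PV * ((W + L2V) * L2V) := by
    have h1' : v ≤ v * Real.log p := le_mul_of_one_le_right hv0 hlp1
    have h2' : C n * PV * (W + L2V) * L2V / Real.log p ^ r n ≤ C n * PV * (W + L2V) * L2V :=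
      div_le_self hX0 hlppow
    calc v ≤ v * Real.log p := h1'
      _ ≤ C n * PV * (W + L2V) * L2V / Real.log p ^ r n := key
      _ ≤ C n * PV * (W + L2V) * L2V := h2'
      _ = C n * PV * ((W + L2V) * L2V) := by ring
  -- `L2V ≤ (2n² + n + 2) + lp + LQ`
  have hlogn : Real.log n ≤ n := (Real.log_le_sub_one_of_pos hn0).trans (by linarith)
  have hn2n : Real.log ((n : ℝ) ^ (2 * n)) ≤ 2 * (n : ℝ) ^ 2 := by
    rw [Real.log_pow]
    have h := mul_le_mul_of_nonneg_left hlogn (by positivity : (0 : ℝ) ≤ ((2 * n : ℕ) : ℝ))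
    calc ((2 * n : ℕ) : ℝ) * Real.log n ≤ ((2 * n : ℕ) : ℝ) * n := h
      _ = 2 * (n : ℝ) ^ 2 := by push_cast; ring
  have hL2Vle : L2V ≤ (2 * (n : ℝ) ^ 2 + n + 2) + lp + LQ := by
    have hpos : 0 < 2 * PV := by linarith
    have hle : 2 * PV ≤ 2 * 2 ^ n * (n : ℝ) ^ (2 * n) * p * Ω := by linarith [hPVle]
    have hnn : (0 : ℝ) < (n : ℝ) ^ (2 * n) := by positivity
    calc L2V ≤ Real.log (2 * 2 ^ n * (n : ℝ) ^ (2 * n) * p * Ω) := Real.log_le_log hpos hle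
      _ = Real.log 2 + n * Real.log 2 + Real.log ((n : ℝ) ^ (2 * n)) + lp + Real.log Ω := by
          rw [Real.log_mul (by positivity) hΩ0.ne', Real.log_mul (by positivity) hpR0.ne',
            Real.log_mul (by positivity) hnn.ne', Real.log_mul (by norm_num) (by positivity),
            Real.log_pow]
      _ ≤ 1 + n * 1 + 2 * (n : ℝ) ^ 2 + lp + LQ := by
          have h2 : Real.log 2 ≤ 1 := by linarith [Real.log_two_lt_d9]
          have : (n : ℝ) * Real.log 2 ≤ n * 1 := mul_le_mul_of_nonneg_left h2 hn0.le
          linarith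
      _ = (2 * (n : ℝ) ^ 2 + n + 2) + lp + LQ - 1 := by ring
      _ ≤ (2 * (n : ℝ) ^ 2 + n + 2) + lp + LQ := by linarith
  -- `W ≤ 2n² + lp + LQ + LB`
  have hWle : W ≤ 2 * (n : ℝ) ^ 2 + lp + LQ + LB := by
    have hΩ1 : Ω ≤ max 1 Ω := le_max_right _ _
    have hm1 : (1 : ℝ) ≤ max 1 Ω := le_max_left _ _
    have hBle : (B : ℝ) ≤ max 3 (B : ℝ) := le_max_right _ _
    have h3le : (3 : ℝ) ≤ max 3 (B : ℝ) := le_max_left _ _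
    have hnn : (1 : ℝ) ≤ (n : ℝ) ^ (2 * n) := one_le_pow₀ (by exact_mod_cast hn)
    set M : ℝ := (n : ℝ) ^ (2 * n) * p * max 1 Ω * max 3 (B : ℝ) with hM
    have hB'M : B' ≤ M := by
      rw [hB', hM]
      apply mul_le_mul (mul_le_mul_of_nonneg_left hΩ1 (by positivity)) hBle (Nat.cast_nonneg _)
        (by positivity)
    have h3M : (3 : ℝ) ≤ M := by
      rw [hM]
      have h1 : (3 : ℝ) ≤ (n : ℝ) ^ (2 * n) * p := by
        calc (3 : ℝ) = 1 * 3 := by ring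
          _ ≤ (n : ℝ) ^ (2 * n) * p := mul_le_mul hnn hp3R (by norm_num) (by positivity)
      calc (3 : ℝ) = 3 * 1 * 1 := by ring
        _ ≤ (n : ℝ) ^ (2 * n) * p * max 1 Ω * max 3 (B : ℝ) :=
            mul_le_mul (mul_le_mul h1 hm1 zero_le_one (by positivity)) (by linarith) zero_le_one
              (by positivity)
    have hmaxM : max 3 B' ≤ M := max_le h3M hB'M
    have hM0 : 0 < M := by linarith
    have hlogmax1 : Real.log (max 1 Ω) ≤ LQ := by
      rw [hLQ]
      apply Real.log_le_log (by positivity)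
      refine max_le (le_trans (by norm_num) (le_max_left _ _)) (le_trans ?_ (le_max_right _ _))
      exact Finset.prod_le_prod (fun i _ => (Real.log_pos (by exact_mod_cast hq2 i)).le)
        fun i _ => (Real.log_le_sub_one_of_pos (by exact_mod_cast (by linarith [hq2 i] : 0 < q i))).trans
          (by linarith)
    calc W ≤ Real.log M := Real.log_le_log (lt_of_lt_of_le (by norm_num) (le_max_left _ _)) hmaxM
      _ = Real.log ((n : ℝ) ^ (2 * n)) + lp + Real.log (max 1 Ω) + LB := by
          rw [hM, Real.log_mul (by positivity) (by positivity), Real.log_mul (by positivity) (by positivity),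
            Real.log_mul (by positivity) hpR0.ne']
      _ ≤ 2 * (n : ℝ) ^ 2 + lp + LQ + LB := by linarith
  -- conclude
  have hfinal := bookkeeping (c₂ := c₂) hn hp3R hc₁ hΩ0 hLQ1 hLB1 hlp1 hlps (hC n).2
    (zero_le_one.trans hPV1) hPVle hL2V0 hL2Vle hW0 hWle hvle
  rw [Real.rpow_two]
  exact hfinal

end Literature.NumberTheory.Transcendental.StewartYu

end Part7

/-!
## Part 8 — port of `Summits/ABC/StewartYu/PrimePadicSocketTools.lean` (5 declarations kept)

# Cell abc-stewartyu: the prime-argument `p`-adic SOCKET of the abc assembly, I —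
# absorption lemmas, the endgame with a power of `log c`, and the localized summation

`Summits/ABC/StewartYu/PrimePadicSocketTools.lean` — cell `abc-stewartyu` (HOME
`run/shared/lean/pub/abc-stewartyu/`, seat p3; theorems only: no definition, no named fact), continuing
the tree's `Literature/Barriers/ABC/BakerMethodBoundsStewartTijdemanGenericProofs.lean`, whose Theorem A
(`stewartTijdeman1986_of_primePadicBound`) derives the Stewart–Tijdeman shape `BakerShapeBound 15 0`
(`log c ≤ κ R^{15}` [cite: StewartTijdeman1986, Theorem 1 (upper bound), as quoted in
Waldschmidt2014 §2 (PDF p. 3)]) from ANY `p`-adic bound for linear forms in the logarithms of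
distinct rational primes of the shape `K Lⁿ n^{κn} p^σ (∏ log qᵢ) (log max(3, max|eᵢ|))^τ` with
`κ, σ ≤ 14` and a FIXED `τ`.

This file and its sequels (`PrimePadicSocketLog.lean`, `PrimePadicSocketRad.lean`, `PrimePadicSocket.lean`)
widen that socket to the shapes a first formalisation of the `p`-adic theory is likely to produce:
any `κ, σ ≥ 0`, a power of the logarithm GROWING WITH `n` (`τ₀ + τ₁ n`, the quality of Baker's
method without Kummer descent), and the stray terms `log p`, `∑ log qᵢ` inside that logarithm
(shapes like `Ω log Ω (log B + log Ω)` of Cijsouw–Waldschmidt 1977 or `log(Bₙ C₅ p^{n+1} ∏ h')` of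
Yu 2007). Here: the tools.

* `pow_le_pow_mul_factorial_mul_exp` — `Xⁿ ≤ δ^{-n} n! e^{δX}` (from `sⁿ ≤ n! · e^s`, one term of
  the exponential series — the device that absorbs `(log R)^n` and `(log log c)^n` against `n! ≤ rad`,
  `factorial_card_le_prod`); `log_pow_le_mul_rpow` — `(log Y)^τ ≤ ((τ+1)/δ)^τ · Y^δ` (`Y ≥ 1`);
* `bakerShapeBound_zero_mono` — `BakerShapeBound θ 0 → BakerShapeBound θ' 0` for `θ ≤ θ'`;
* `bakerShapeBound_of_loglog_rpow` — the endgame: `log c ≤ M R^μ Y^δ (log Y)^τ`, `Y = max(3, log c)`,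
  with `2δ < 1` and `μ ≤ θ (1 − 2δ)`, gives `BakerShapeBound θ 0`;
* `sum_padicPart_le_of_local` — the Stewart–Tijdeman summation with a COMPLETELY GENERIC per-prime
  bound `F p`: if `ord_p((y/z)² − 1) ≤ F p` for the primes `p ≥ p₀` of `x` (asked only for the
  enumerations of the primes of `yz` and exponent vectors with entries `≤ 3 log max(y, z)` in
  absolute value), then `∑_{p ∣ x, p ≥ p₀} ord_p(x) log p ≤ ∑_{p ∣ x, p ≥ p₀} F p · log p`.

Nothing here is claimed to be in print beyond the summation pattern of Stewart–Tijdeman 1986 /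
Shorey–Tijdeman [cite: ShoreyTijdeman1986, Ch. 1, proof of Theorem 1.2 (PDF p. 48)]; the point is to
record, as kernel theorems, WHICH crude `p`-adic bounds already yield an abc-type bound.

## References

* [StewartTijdeman1986] C. L. Stewart, R. Tijdeman, *On the Oesterlé–Masser conjecture*, Monatsh.
  Math. 102 (1986), 251–257 — Theorem 1, as quoted in [Waldschmidt2014] §2.
* [ShoreyTijdeman1986] T. N. Shorey, R. Tijdeman, *Exponential Diophantine Equations*, Cambridge
  Tracts in Math. 87, CUP 1986 — Ch. B; Ch. 1, Theorem 1.2 and its proof.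
-/

section Part8

open _root_.Finset _root_.Real
open Literature.NumberTheory.DiophantineGeometry

namespace Literature.NumberTheory.Transcendental.StewartYu

open Literature.Barriers.ABC Literature.Barriers.ABC.StewartTijdemanGeneric

/-! ### Absorption lemmas -/

/-- `(log Y)^τ ≤ ((τ+1)/δ)^τ · Y^δ` for `Y ≥ 1` and `δ > 0` (`log Y ≤ Y^ε/ε` with
`ε = δ/(τ+1)`). [cite: ShoreyTijdeman1986, Ch. 1, proof of Theorem 1.2 (PDF p. 48) (summation over the primes of a member of the triple; tools)] -/
theorem log_pow_le_mul_rpow {δ : ℝ} (hδ : 0 < δ) (τ : ℕ) {Y : ℝ} (hY : 1 ≤ Y) :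
    Real.log Y ^ τ ≤ ((τ + 1) / δ) ^ τ * Y ^ δ := by
  have hY0 : 0 ≤ Y := zero_le_one.trans hY
  set ε : ℝ := δ / ((τ : ℝ) + 1) with hε
  have hτ1 : (0 : ℝ) < (τ : ℝ) + 1 := by positivity
  have hε0 : 0 < ε := by rw [hε]; positivity
  have h1 : Real.log Y ≤ Y ^ ε / ε := Real.log_le_rpow_div hY0 hε0
  have h2 : Y ^ ε / ε = ((τ + 1) / δ) * Y ^ ε := by
    rw [hε]; field_simp
  have hlog0 : 0 ≤ Real.log Y := Real.log_nonneg hY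
  have hc0 : (0 : ℝ) ≤ (τ + 1) / δ := by positivity
  calc Real.log Y ^ τ ≤ (((τ + 1) / δ) * Y ^ ε) ^ τ := by
        rw [← h2]; exact pow_le_pow_left₀ hlog0 h1 τ
    _ = ((τ + 1) / δ) ^ τ * Y ^ (ε * τ) := by rw [mul_pow, ← Real.rpow_mul_natCast hY0]
    _ ≤ ((τ + 1) / δ) ^ τ * Y ^ δ := by
        apply mul_le_mul_of_nonneg_left _ (pow_nonneg hc0 τ)
        apply Real.rpow_le_rpow_of_exponent_le hY
        rw [hε, div_mul_eq_mul_div, div_le_iff₀ hτ1]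
        have : (τ : ℝ) ≤ τ + 1 := by linarith
        nlinarith

/-- `Xⁿ ≤ Cⁿ · n! · e^{δ X}` for `X ≥ 0`, `δ > 0`, with `C = 1/δ` (`(δX)ⁿ ≤ n! e^{δX}`). [cite: ShoreyTijdeman1986, Ch. 1, proof of Theorem 1.2 (PDF p. 48) (summation over the primes of a member of the triple; tools)] -/
theorem pow_le_pow_mul_factorial_mul_exp {δ X : ℝ} (hδ : 0 < δ) (hX : 0 ≤ X) (n : ℕ) :
    X ^ n ≤ (1 / δ) ^ n * (n.factorial : ℝ) * Real.exp (δ * X) := by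
  -- `(δX)ⁿ ≤ n! e^{δX}`: one term of the exponential series (the tree has this as
  -- `Literature.NumberTheory.Sieve.Iwaniec1980b.pow_le_factorial_mul_exp`; re-derived in two lines
  -- from Mathlib to keep the sieve files out of the import closure).
  have h : (δ * X) ^ n ≤ (n.factorial : ℝ) * Real.exp (δ * X) := by
    have h0 := Real.pow_div_factorial_le_exp (δ * X) (by positivity) n
    have hf : (0 : ℝ) < n.factorial := by exact_mod_cast Nat.factorial_pos n
    rw [div_le_iff₀ hf] at h0
    linarith [h0]
  have hδn : (0 : ℝ) < δ ^ n := pow_pos hδ n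
  rw [mul_pow] at h
  calc X ^ n = (1 / δ) ^ n * (δ ^ n * X ^ n) := by
        rw [← mul_assoc, ← mul_pow, one_div, inv_mul_cancel₀ hδ.ne', one_pow, one_mul]
    _ ≤ (1 / δ) ^ n * ((n.factorial : ℝ) * Real.exp (δ * X)) :=
        mul_le_mul_of_nonneg_left h (pow_nonneg (by positivity) n)
    _ = _ := by ring

/-! ### Monotonicity of the shape in the exponent -/

/-- `BakerShapeBound θ 0 → BakerShapeBound θ' 0` for `θ ≤ θ'` (`R ≥ 1`). [cite: ShoreyTijdeman1986, Ch. 1, proof of Theorem 1.2 (PDF p. 48) (summation over the primes of a member of the triple; tools)] -/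
theorem bakerShapeBound_zero_mono {θ θ' : ℝ} (hθ : θ ≤ θ') (h : BakerShapeBound θ 0) :
    BakerShapeBound θ' 0 := by
  obtain ⟨κ, hκ⟩ := h
  refine ⟨max κ 0, fun a b c ht => ?_⟩
  have h1 := hκ a b c ht
  have hR : (1 : ℝ) ≤ (rad a b c : ℝ) := one_le_rad_real a b c
  rw [pow_zero, mul_one] at h1 ⊢
  calc Real.log c ≤ κ * (rad a b c : ℝ) ^ θ := h1
    _ ≤ max κ 0 * (rad a b c : ℝ) ^ θ :=
        mul_le_mul_of_nonneg_right (le_max_left _ _) (Real.rpow_nonneg (by linarith) θ)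
    _ ≤ max κ 0 * (rad a b c : ℝ) ^ θ' :=
        mul_le_mul_of_nonneg_left (Real.rpow_le_rpow_of_exponent_le hR hθ) (le_max_right _ _)

/-! ### The endgame with a small power of `log c` -/

/-- **The endgame, with a power `Y^δ`.** If every abc triple satisfies
`log c ≤ M · R^μ · Y^δ · (log Y)^τ`, `Y = max(3, log c)`, with `0 < δ`, `2δ < 1`, `0 ≤ μ ≤ θ(1 − 2δ)`,
then `BakerShapeBound θ 0` (`(log Y)^τ ≤ C Y^δ`, then `u ≤ (3 + M')u^{2δ}` for `u = 3 + log c` gives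
`u ≤ (3 + M')^{1/(1−2δ)}` and `R^{μ/(1−2δ)} ≤ R^θ`). [cite: ShoreyTijdeman1986, Ch. 1, proof of Theorem 1.2 (PDF p. 48) (summation over the primes of a member of the triple; tools)] -/
theorem bakerShapeBound_of_loglog_rpow {μ θ δ M : ℝ} {τ : ℕ} (hμ0 : 0 ≤ μ) (hδ : 0 < δ)
    (h2δ : 2 * δ < 1) (hθ : μ ≤ θ * (1 - 2 * δ)) (hM : 0 ≤ M)
    (h : ∀ a b c : ℕ, IsABCTriple a b c →
      Real.log c ≤ M * (rad a b c : ℝ) ^ μ * (max 3 (Real.log c)) ^ δ *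
        Real.log (max 3 (Real.log c)) ^ τ) :
    BakerShapeBound θ 0 := by
  set Cτ : ℝ := ((τ + 1) / δ) ^ τ with hCτ
  have hCτ0 : 0 ≤ Cτ := pow_nonneg (by positivity) τ
  set γ : ℝ := 1 - 2 * δ with hγ
  have hγ0 : 0 < γ := by rw [hγ]; linarith
  have hθ0 : 0 ≤ θ := by
    by_contra hneg
    push Not at hneg
    have : θ * (1 - 2 * δ) < 0 := mul_neg_of_neg_of_pos hneg hγ0
    linarith
  set κ₀ : ℝ := (3 + M * Cτ * 3) ^ (1 / γ) with hκ₀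
  refine ⟨κ₀, fun a b c ht => ?_⟩
  have hmain := h a b c ht
  obtain ⟨ha, hb, habc, -⟩ := ht
  rw [pow_zero, mul_one]
  set R : ℝ := (rad a b c : ℝ) with hR
  have hR1 : 1 ≤ R := one_le_rad_real a b c
  set y : ℝ := Real.log c with hy
  have hc1 : (1 : ℝ) ≤ c := by exact_mod_cast (show 1 ≤ c by omega)
  have hy0 : 0 ≤ y := Real.log_nonneg hc1
  set Y : ℝ := max 3 y with hYdef
  have hY1 : 1 ≤ Y := le_trans (by norm_num) (le_max_left _ _)
  have hY0 : 0 ≤ Y := zero_le_one.trans hY1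
  have hY3 : Y ≤ 3 + y := max_le (by linarith) (by linarith)
  set u : ℝ := 3 + y with hu
  have hu1 : 1 ≤ u := by rw [hu]; linarith
  have hu0 : 0 ≤ u := zero_le_one.trans hu1
  -- `y ≤ M' u^{2δ}`
  set M' : ℝ := M * Cτ * 3 * R ^ μ with hM'
  have hRμ1 : 1 ≤ R ^ μ := Real.one_le_rpow hR1 hμ0
  have hM'0 : 0 ≤ M' := by rw [hM']; positivity
  have h1 : y ≤ M' * u ^ (2 * δ) := by
    have hlog := log_pow_le_mul_rpow hδ τ hY1
    have hYu : Y ^ δ ≤ u ^ δ := Real.rpow_le_rpow hY0 hY3 hδ.le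
    have hYu2 : Y ^ δ * Y ^ δ ≤ u ^ (2 * δ) := by
      rw [two_mul, Real.rpow_add (by linarith : (0 : ℝ) < u)]
      exact mul_le_mul hYu hYu (Real.rpow_nonneg hY0 δ) (Real.rpow_nonneg hu0 δ)
    calc y ≤ M * R ^ μ * Y ^ δ * Real.log Y ^ τ := hmain
      _ ≤ M * R ^ μ * Y ^ δ * (Cτ * Y ^ δ) :=
          mul_le_mul_of_nonneg_left hlog (by positivity)
      _ = M * Cτ * R ^ μ * (Y ^ δ * Y ^ δ) := by ring
      _ ≤ M * Cτ * R ^ μ * u ^ (2 * δ) := mul_le_mul_of_nonneg_left hYu2 (by positivity)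
      _ ≤ M' * u ^ (2 * δ) := by
          rw [hM']
          have : M * Cτ * R ^ μ ≤ M * Cτ * 3 * R ^ μ := by nlinarith [mul_nonneg hM hCτ0]
          exact mul_le_mul_of_nonneg_right this (Real.rpow_nonneg hu0 _)
  -- `u ≤ (3 + M') u^{2δ}`, so `u^{γ} ≤ 3 + M'`
  have hu2δ : 1 ≤ u ^ (2 * δ) := Real.one_le_rpow hu1 (by linarith)
  have h2 : u ≤ (3 + M') * u ^ (2 * δ) := by
    calc u = 3 + y := rfl
      _ ≤ 3 * u ^ (2 * δ) + M' * u ^ (2 * δ) := by nlinarith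
      _ = (3 + M') * u ^ (2 * δ) := by ring
  have h3 : u ^ γ ≤ 3 + M' := by
    have hsplit : u = u ^ γ * u ^ (2 * δ) := by
      rw [← Real.rpow_add (by linarith : (0 : ℝ) < u), hγ]; norm_num
    have hpos : 0 < u ^ (2 * δ) := by linarith
    rw [hsplit] at h2
    exact le_of_mul_le_mul_right (by linarith [h2]) hpos
  -- `u ≤ (3 + M')^{1/γ} ≤ κ₀ R^{θ}`
  have h4 : u ≤ (3 + M') ^ (1 / γ) := by
    have h := Real.rpow_le_rpow (Real.rpow_nonneg hu0 _) h3 (by positivity : (0:ℝ) ≤ 1 / γ)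
    rwa [← Real.rpow_mul hu0, mul_one_div_cancel hγ0.ne', Real.rpow_one] at h
  have h5 : (3 + M') ^ (1 / γ) ≤ κ₀ * R ^ θ := by
    have hle : 3 + M' ≤ (3 + M * Cτ * 3) * R ^ μ := by
      rw [hM']; nlinarith [mul_nonneg (mul_nonneg hM hCτ0) (by norm_num : (0:ℝ) ≤ 3)]
    calc (3 + M') ^ (1 / γ) ≤ ((3 + M * Cτ * 3) * R ^ μ) ^ (1 / γ) :=
          Real.rpow_le_rpow (by linarith) hle (by positivity)
      _ = κ₀ * (R ^ μ) ^ (1 / γ) := by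
          rw [hκ₀, Real.mul_rpow (by positivity) (by positivity)]
      _ = κ₀ * R ^ (μ * (1 / γ)) := by rw [← Real.rpow_mul (by linarith)]
      _ ≤ κ₀ * R ^ θ := by
          apply mul_le_mul_of_nonneg_left _ (by positivity)
          apply Real.rpow_le_rpow_of_exponent_le hR1
          rw [mul_one_div, div_le_iff₀ hγ0, hγ]
          exact hθ
  calc y ≤ u := by rw [hu]; linarith
    _ ≤ κ₀ * R ^ θ := h4.trans h5

/-! ### The Stewart–Tijdeman summation with a generic per-prime bound -/

/-- **The Stewart–Tijdeman summation, localized generic form.** Let `y ≠ z` be coprime positive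
integers, `S` the set of primes of `yz` (`n = #S`), and `x` a positive integer coprime to `yz` with
`x ∣ y² − z²`. Suppose that for every prime `p ≥ p₀` dividing `x`, for the enumerations
`q : Fin n → ℕ` of `S` (injective, image `S`, `qᵢ ≠ p`) and every exponent vector `e ≠ 0` with
`∏ qᵢ^{eᵢ} ≠ 1` and `max |eᵢ| ≤ 3 log max(y, z)`, one has `ord_p(∏ qᵢ^{eᵢ} − 1) ≤ F p` for some
function `F`. Then `∑_{p ∣ x, p ≥ p₀} ord_p(x) log p ≤ ∑_{p ∣ x, p ≥ p₀} F p · log p` (apply the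
hypothesis to `(y/z)² − 1 = ∏_{q ∈ S} q^{2e_q} − 1`, `e_q = ord_q y − ord_q z`, whose `p`-order is
`≥ ord_p x`). This is `sum_padicPart_le` with the shape of the bound left to the caller. [cite: ShoreyTijdeman1986, Ch. 1, proof of Theorem 1.2 (PDF p. 48) (summation over the primes of a member of the triple; tools)] -/
theorem sum_padicPart_le_of_local (F : ℕ → ℝ) {p₀ x y z : ℕ} (hx : 0 < x) (hy : 0 < y)
    (hz : 0 < z) (hyz : y ≠ z) (hcop : Nat.Coprime y z) (hxcop : Nat.Coprime x (y * z))
    (hdvd : (x : ℤ) ∣ (y : ℤ) ^ 2 - (z : ℤ) ^ 2)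
    (hP : ∀ (p : ℕ) (q : Fin (y * z).primeFactors.card → ℕ)
      (e : Fin (y * z).primeFactors.card → ℤ), p.Prime → p₀ ≤ p → p ∣ x →
      (∀ i, (q i).Prime) → Function.Injective q →
      Finset.univ.image q = (y * z).primeFactors → (∀ i, q i ≠ p) → e ≠ 0 →
      ∏ i, ((q i : ℚ)) ^ e i ≠ 1 →
      (((Finset.univ.sup fun i => (e i).natAbs : ℕ)) : ℝ) ≤ 3 * Real.log (max y z : ℕ) →
      (padicValRat p (∏ i, ((q i : ℚ)) ^ e i - 1) : ℝ) ≤ F p) :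
    ∑ p ∈ x.primeFactors.filter (fun p => p₀ ≤ p), (x.factorization p : ℝ) * Real.log p ≤
      ∑ p ∈ x.primeFactors.filter (fun p => p₀ ≤ p), F p * Real.log p := by
  classical
  have hy0 : y ≠ 0 := hy.ne'
  have hz0 : z ≠ 0 := hz.ne'
  have hx0 : x ≠ 0 := hx.ne'
  set S := (y * z).primeFactors with hS
  set n := S.card with hn
  have hprime : ∀ q ∈ S, q.Prime := fun q hq => Nat.prime_of_mem_primeFactors hq
  -- the exponent vector and the `Fin n`-indexed family of primes
  set e : ℕ → ℤ := fun q => (y.factorization q : ℤ) - (z.factorization q : ℤ) with he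
  set φ : Fin n ≃ S := S.equivFin.symm with hφ
  set q : Fin n → ℕ := fun i => (φ i : ℕ) with hqdef
  set e' : Fin n → ℤ := fun i => 2 * e (q i) with he'
  have hqS : ∀ i, q i ∈ S := fun i => (φ i).2
  have hqP : ∀ i, (q i).Prime := fun i => hprime _ (hqS i)
  have hinj : Function.Injective q := fun i j hij =>
    φ.injective (Subtype.ext hij)
  have himg : Finset.univ.image q = S := by
    ext r
    simp only [Finset.mem_image, Finset.mem_univ, true_and]
    constructor
    · rintro ⟨i, rfl⟩; exact hqS i
    · intro hr; exact ⟨φ.symm ⟨r, hr⟩, by simp [hqdef]⟩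
  -- `S` is nonempty and every `e_q`, `q ∈ S`, is non-zero
  have hyz1 : 1 < y * z := by
    rcases Nat.lt_or_ge 1 y with h | h
    · nlinarith
    · have hy1 : y = 1 := by omega
      subst hy1
      have : 1 < z := by omega
      simpa using this
  have hSne : S.Nonempty := Nat.nonempty_primeFactors.mpr hyz1
  have hn0 : 0 < n := Finset.card_pos.mpr hSne
  have he_ne : ∀ r ∈ S, e r ≠ 0 := by
    intro r hr
    have hrP := hprime r hr
    have hrdvd : r ∣ y * z := Nat.dvd_of_mem_primeFactors hr
    rcases (Nat.Prime.dvd_mul hrP).mp hrdvd with hry | hrz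
    · have h1 : 0 < y.factorization r := hrP.factorization_pos_of_dvd hy0 hry
      have h2 : z.factorization r = 0 := by
        apply Nat.factorization_eq_zero_of_not_dvd
        intro hrz
        exact hrP.one_lt.ne' (Nat.eq_one_of_dvd_coprimes hcop hry hrz)
      simp only [he, h2]; omega
    · have h1 : 0 < z.factorization r := hrP.factorization_pos_of_dvd hz0 hrz
      have h2 : y.factorization r = 0 := by
        apply Nat.factorization_eq_zero_of_not_dvd
        intro hry
        exact hrP.one_lt.ne' (Nat.eq_one_of_dvd_coprimes hcop hry hrz)
      simp only [he, h2]; omega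
  have he'ne : e' ≠ 0 := by
    intro h0
    obtain ⟨i⟩ : Nonempty (Fin n) := ⟨⟨0, hn0⟩⟩
    have := congr_fun h0 i
    simp only [he', Pi.zero_apply, mul_eq_zero, OfNat.ofNat_ne_zero, false_or] at this
    exact he_ne _ (hqS i) this
  -- `∏ q_i^{e'_i} = (y/z)²`
  have hfac : ∀ {m : ℕ}, m ≠ 0 → m ∣ y * z →
      (m : ℚ) = ∏ r ∈ S, (r : ℚ) ^ m.factorization r := by
    intro m hm hmd
    have h1 := Nat.prod_primeFactors_pow_factorization hm
    have hsub : m.primeFactors ⊆ S := Nat.primeFactors_mono hmd (mul_ne_zero hy0 hz0)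
    rw [← Finset.prod_subset hsub (fun r hrS hr => ?_)]
    · exact_mod_cast h1
    · have hnd : ¬ r ∣ m := fun hd => hr (Nat.mem_primeFactors.mpr ⟨hprime r hrS, hd, hm⟩)
      rw [Nat.factorization_eq_zero_of_not_dvd hnd, pow_zero]
  have hprodS : ∏ r ∈ S, (r : ℚ) ^ e r = (y : ℚ) / z := by
    rw [hfac hy0 (dvd_mul_right y z), hfac hz0 (dvd_mul_left z y), ← Finset.prod_div_distrib]
    refine Finset.prod_congr rfl fun r hr => ?_
    have hr0 : (r : ℚ) ≠ 0 := by exact_mod_cast (hprime r hr).ne_zero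
    rw [he, zpow_sub₀ hr0, zpow_natCast, zpow_natCast]
  have hprod : ∏ i, ((q i : ℚ)) ^ e' i = ((y : ℚ) / z) ^ 2 := by
    have h1 : ∏ i, ((q i : ℚ)) ^ e' i = ∏ i, (((q i : ℚ)) ^ e (q i)) ^ 2 := by
      refine Finset.prod_congr rfl fun i _ => ?_
      show ((q i : ℚ)) ^ (2 * e (q i)) = (((q i : ℚ)) ^ e (q i)) ^ 2
      rw [mul_comm, zpow_mul, zpow_ofNat]
    have h2 : ∏ i, (((q i : ℚ)) ^ e (q i)) ^ 2 = (∏ i, ((q i : ℚ)) ^ e (q i)) ^ 2 :=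
      Finset.prod_pow _ 2 _
    have h3 : ∏ i, ((q i : ℚ)) ^ e (q i) = ∏ r ∈ S, (r : ℚ) ^ e r := by
      rw [← Finset.prod_coe_sort S (fun r => (r : ℚ) ^ e r)]
      exact Fintype.prod_equiv φ (fun i => ((q i : ℚ)) ^ e (q i)) (fun r => ((r : ℕ) : ℚ) ^ e r)
        (fun i => rfl)
    rw [h1, h2, h3, hprodS]
  have hyzQ : (y : ℚ) / z ≠ 1 := by
    intro h
    rw [div_eq_one_iff_eq (by exact_mod_cast hz0)] at h
    exact hyz (by exact_mod_cast h)
  have hyzQ' : (y : ℚ) / z ≠ -1 := by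
    intro h
    have : (0 : ℚ) < (y : ℚ) / z := div_pos (by exact_mod_cast hy) (by exact_mod_cast hz)
    rw [h] at this; norm_num at this
  have hne1 : ∏ i, ((q i : ℚ)) ^ e' i ≠ 1 := by
    rw [hprod]
    intro h
    rcases sq_eq_one_iff.mp h with h1 | h1
    · exact hyzQ h1
    · exact hyzQ' h1
  -- the integer `m = y² − z² ≠ 0` and `(y/z)² − 1 = m / z²`
  set m : ℤ := (y : ℤ) ^ 2 - (z : ℤ) ^ 2 with hm
  have hm0 : m ≠ 0 := by
    intro h
    have h' : ((y : ℤ)) ^ 2 = (z : ℤ) ^ 2 := sub_eq_zero.mp h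
    have h'' : y ^ 2 = z ^ 2 := by exact_mod_cast h'
    exact hyz (Nat.pow_left_injective (by norm_num) h'')
  have hΛ : ∏ i, ((q i : ℚ)) ^ e' i - 1 = (m : ℚ) / ((z : ℚ)) ^ 2 := by
    rw [hprod, hm]; push_cast
    field_simp
  -- the sup of the exponents
  have hl2 : 0.6931471803 < Real.log 2 := Real.log_two_gt_d9
  have hsup : (((Finset.univ.sup fun i => (e' i).natAbs : ℕ)) : ℝ) ≤ 3 * Real.log (max y z : ℕ) := by
    obtain ⟨i, -, hi⟩ := Finset.exists_mem_eq_sup (Finset.univ : Finset (Fin n))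
      (Finset.univ_nonempty_iff.mpr ⟨⟨0, hn0⟩⟩) (fun i => (e' i).natAbs)
    rw [hi]
    have hfy := factorization_mul_log_two_le (q := q i) (hqP i) hy0
    have hfz := factorization_mul_log_two_le (q := q i) (hqP i) hz0
    have hly : Real.log y ≤ Real.log (max y z : ℕ) :=
      Real.log_le_log (by exact_mod_cast hy) (by exact_mod_cast le_max_left y z)
    have hlz : Real.log z ≤ Real.log (max y z : ℕ) :=
      Real.log_le_log (by exact_mod_cast hz) (by exact_mod_cast le_max_right y z)
    have hyf0 : (0 : ℝ) ≤ y.factorization (q i) := Nat.cast_nonneg _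
    have hzf0 : (0 : ℝ) ≤ z.factorization (q i) := Nat.cast_nonneg _
    have hpy := mul_nonneg hyf0 (sub_nonneg.mpr hl2.le)
    have hpz := mul_nonneg hzf0 (sub_nonneg.mpr hl2.le)
    rcases le_total (y.factorization (q i)) (z.factorization (q i)) with h | h
    · have h1 : (e' i).natAbs ≤ 2 * z.factorization (q i) := by
        simp only [he', he]; omega
      have h1' : ((e' i).natAbs : ℝ) ≤ 2 * (z.factorization (q i) : ℝ) := by exact_mod_cast h1
      linarith
    · have h1 : (e' i).natAbs ≤ 2 * y.factorization (q i) := by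
        simp only [he', he]; omega
      have h1' : ((e' i).natAbs : ℝ) ≤ 2 * (y.factorization (q i) : ℝ) := by exact_mod_cast h1
      linarith
  -- the per-prime estimate
  set T := x.primeFactors.filter (fun p => p₀ ≤ p) with hT
  refine Finset.sum_le_sum fun p hp => ?_
  obtain ⟨hpx, hp₀⟩ := Finset.mem_filter.mp hp
  have hpP : p.Prime := Nat.prime_of_mem_primeFactors hpx
  haveI : Fact p.Prime := ⟨hpP⟩
  have hpdx : p ∣ x := Nat.dvd_of_mem_primeFactors hpx
  have hpyz : ¬ p ∣ y * z := fun hd =>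
    hpP.one_lt.ne' (Nat.eq_one_of_dvd_coprimes hxcop hpdx hd)
  have hpz : ¬ p ∣ z := fun hd => hpyz (dvd_mul_of_dvd_right hd y)
  have hqp : ∀ i, q i ≠ p := fun i h => hpyz (h ▸ Nat.dvd_of_mem_primeFactors (hqS i))
  -- `ord_p x ≤ ord_p ((y/z)² − 1)`
  have hval : (x.factorization p : ℤ) ≤ padicValRat p (∏ i, ((q i : ℚ)) ^ e' i - 1) := by
    rw [hΛ, padicValRat.div (by exact_mod_cast hm0) (pow_ne_zero 2 (by exact_mod_cast hz0)),
      padicValRat.pow, padicValRat.of_nat, padicValNat.eq_zero_of_not_dvd hpz]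
    simp only [Nat.cast_zero, mul_zero, sub_zero]
    rw [padicValRat.of_int]
    have hdvd' : (p : ℤ) ^ x.factorization p ∣ m :=
      dvd_trans (by exact_mod_cast Nat.ordProj_dvd x p) hdvd
    have := (padicValInt_dvd_iff _ _).mp hdvd'
    rcases this with h | h
    · exact absurd h hm0
    · exact_mod_cast h
  have hval' : (x.factorization p : ℝ) ≤ (padicValRat p (∏ i, ((q i : ℚ)) ^ e' i - 1) : ℝ) := by
    exact_mod_cast hval
  have key := hP p q e' hpP hp₀ hpdx hqP hinj himg hqp he'ne hne1 hsup
  have hlogp : 0 ≤ Real.log p := Real.log_nonneg (by exact_mod_cast hpP.one_lt.le)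
  exact mul_le_mul_of_nonneg_right (hval'.trans key) hlogp

end Literature.NumberTheory.Transcendental.StewartYu

end Part8

/-!
## Part 9 — port of `Summits/ABC/StewartYu/PrimePadicSocketLog.lean` (6 declarations kept)

# Cell abc-stewartyu: the prime-argument `p`-adic SOCKET of the abc assembly, II —
# book-keeping of the logarithmic factor and of the powers of the radical

`Summits/ABC/StewartYu/PrimePadicSocketLog.lean` — sequel to
`PrimePadicSocketTools.lean` (theorems only: no definition, no named fact).
Elementary inequalities used by `sum_padicPart_le_rad_general` (next file) to absorb the
logarithmic factor `(W + log R)^{τ₀ + τ₁ n}` of a crude `p`-adic bound against the radical, where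
`n = ω(yz)`, `n! ≤ Q = rad(yz)`, `R = rad(xyz) ≥ 1`, `W = log Y₃ ≥ 1`:
`(1 + log R)^{τ₁ n} ≤ (eQR)^{τ₁}` (`one_add_log_pow_mul_le`),
`(1 + log R)^{τ₀} ≤ (8(τ₀+1))^{τ₀} · 2R^{1/8}` (`one_add_log_pow_le`),
`W^{τ₁ n} ≤ ((τ₁+1)/δ)^{τ₁ n} Q^{τ₁} Y₃^δ` (`log_pow_mul_le`), their product (`logFactor_le`), and
the collection of the powers `R^κ R^{1/4} R^{1/8} R^{τ₁} R^{1/8} R^{τ₁} R^{τ₁} (R^σ R^{1/8}) =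
R^{κ+σ+3τ₁+5/8}` (`rpow_collect`, `powers_le_rpow`). All [folklore]; nothing here is in print.
-/

section Part9

open _root_.Finset _root_.Real
open Literature.NumberTheory.DiophantineGeometry

namespace Literature.NumberTheory.Transcendental.StewartYu

open Literature.Barriers.ABC Literature.Barriers.ABC.StewartTijdemanGeneric

/-! ### Book-keeping lemmas for the general socket -/

/-- `(1 + log R)^{τ n} ≤ (e Q R)^τ` when `n! ≤ Q` and `R ≥ 1` (`(1 + log R)ⁿ ≤ n! · e^{1 + log R}`).
[cite: ShoreyTijdeman1986, Ch. 1, proof of Theorem 1.2 (PDF p. 48) (logarithmic bookkeeping of the socket)] -/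
theorem one_add_log_pow_mul_le {Q R : ℝ} {n τ : ℕ} (hR : 1 ≤ R) (hfact : (n.factorial : ℝ) ≤ Q) :
    (1 + Real.log R) ^ (τ * n) ≤ (Real.exp 1 * Q * R) ^ τ := by
  have hR0 : 0 < R := by linarith
  have hlog : 0 ≤ Real.log R := Real.log_nonneg hR
  have hexpR : Real.exp (1 + Real.log R) = Real.exp 1 * R := by
    rw [Real.exp_add, Real.exp_log hR0]
  have hQ0 : 0 ≤ Q := le_trans (Nat.cast_nonneg _) hfact
  rw [mul_comm τ n, pow_mul]
  apply pow_le_pow_left₀ (pow_nonneg (by linarith) n)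
  calc (1 + Real.log R) ^ n ≤ (n.factorial : ℝ) * Real.exp (1 + Real.log R) := by
        -- one term of the exponential series
        have h0 := Real.pow_div_factorial_le_exp (1 + Real.log R) (by linarith) n
        have hf : (0 : ℝ) < n.factorial := by exact_mod_cast Nat.factorial_pos n
        rw [div_le_iff₀ hf] at h0
        linarith [h0]
    _ ≤ Q * (Real.exp 1 * R) := by
        rw [hexpR]
        exact mul_le_mul_of_nonneg_right hfact (by positivity)
    _ = Real.exp 1 * Q * R := by ring

/-- `(1 + log R)^τ ≤ (8(τ+1))^τ · 2 R^{1/8}` for `R ≥ 1` (`log(eR) ≤ 8(τ+1) (eR)^{1/(8(τ+1))}`,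
`e^{1/8} ≤ 2`). [cite: ShoreyTijdeman1986, Ch. 1, proof of Theorem 1.2 (PDF p. 48) (logarithmic bookkeeping of the socket)] -/
theorem one_add_log_pow_le {R : ℝ} (hR : 1 ≤ R) (τ : ℕ) :
    (1 + Real.log R) ^ τ ≤ (8 * ((τ : ℝ) + 1)) ^ τ * (2 * R ^ (1 / 8 : ℝ)) := by
  have hR0 : 0 < R := by linarith
  have heR1 : 1 ≤ Real.exp 1 * R :=
    one_le_mul_of_one_le_of_one_le (by linarith [Real.exp_one_gt_d9]) hR
  have h := log_pow_le_mul_rpow (δ := 1 / 8) (by norm_num) τ heR1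
  rw [Real.log_mul (Real.exp_pos 1).ne' hR0.ne', Real.log_exp] at h
  have hc : ((τ : ℝ) + 1) / (1 / 8) = 8 * ((τ : ℝ) + 1) := by ring
  rw [hc] at h
  refine h.trans (mul_le_mul_of_nonneg_left ?_ (pow_nonneg (by positivity) τ))
  rw [Real.mul_rpow (Real.exp_pos 1).le hR0.le]
  apply mul_le_mul_of_nonneg_right _ (Real.rpow_nonneg hR0.le _)
  have he256 : Real.exp 1 ≤ (2 : ℝ) ^ (8 : ℕ) := le_trans Real.exp_one_lt_d9.le (by norm_num)
  have h18 : (1 / 8 : ℝ) = ((8 : ℕ) : ℝ)⁻¹ := by norm_num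
  calc Real.exp 1 ^ (1 / 8 : ℝ) ≤ ((2 : ℝ) ^ (8 : ℕ)) ^ (1 / 8 : ℝ) :=
        Real.rpow_le_rpow (Real.exp_pos 1).le he256 (by norm_num)
    _ = 2 := by rw [h18, Real.pow_rpow_inv_natCast (by norm_num) (by norm_num)]

/-- `W^{τ n} ≤ ((τ+1)/δ)^{τ n} · Q^τ · Y^δ` for `W = log Y`, `Y ≥ 1`, `n! ≤ Q`, `δ > 0`
(`Wⁿ ≤ ε^{-n} n! e^{εW}` with `ε = δ/(τ+1)`, and `τ ε ≤ δ`). [cite: ShoreyTijdeman1986, Ch. 1, proof of Theorem 1.2 (PDF p. 48) (logarithmic bookkeeping of the socket)] -/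
theorem log_pow_mul_le {Q Y δ : ℝ} {n τ : ℕ} (hY : 1 ≤ Y) (hfact : (n.factorial : ℝ) ≤ Q)
    (hδ : 0 < δ) :
    Real.log Y ^ (τ * n) ≤ (((τ : ℝ) + 1) / δ) ^ (τ * n) * Q ^ τ * Y ^ δ := by
  have hY0 : 0 < Y := by linarith
  have hW0 : 0 ≤ Real.log Y := Real.log_nonneg hY
  have hfact0 : (0 : ℝ) ≤ (n.factorial : ℝ) := Nat.cast_nonneg _
  have hQ0 : 0 ≤ Q := hfact0.trans hfact
  set ε : ℝ := δ / ((τ : ℝ) + 1) with hε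
  have hτ1 : (0 : ℝ) < (τ : ℝ) + 1 := by positivity
  have hε0 : 0 < ε := by rw [hε]; positivity
  have hτε : (τ : ℝ) * ε ≤ δ := by
    rw [hε, mul_div_assoc', div_le_iff₀ hτ1]
    have := mul_le_mul_of_nonneg_left (show (τ : ℝ) ≤ τ + 1 by linarith) hδ.le
    linarith [mul_comm (τ : ℝ) δ]
  rw [mul_comm τ n, pow_mul, pow_mul]
  have hstep : Real.log Y ^ n ≤ (1 / ε) ^ n * (n.factorial : ℝ) * Real.exp (ε * Real.log Y) :=
    pow_le_pow_mul_factorial_mul_exp hε0 hW0 n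
  have h1ε : 1 / ε = ((τ : ℝ) + 1) / δ := by rw [hε]; field_simp
  rw [h1ε] at hstep
  have hc0 : 0 ≤ ((((τ : ℝ) + 1) / δ) ^ n) ^ τ := pow_nonneg (pow_nonneg (by positivity) n) τ
  have hfτ : ((n.factorial : ℝ)) ^ τ ≤ Q ^ τ := pow_le_pow_left₀ hfact0 hfact τ
  have hexp : Real.exp (ε * Real.log Y) ^ τ ≤ Y ^ δ := by
    rw [← Real.exp_nat_mul, Real.rpow_def_of_pos hY0,
      show (τ : ℝ) * (ε * Real.log Y) = (τ * ε) * Real.log Y by ring, mul_comm (Real.log Y)]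
    exact Real.exp_le_exp.mpr (mul_le_mul_of_nonneg_right hτε hW0)
  calc (Real.log Y ^ n) ^ τ
      ≤ ((((τ : ℝ) + 1) / δ) ^ n * (n.factorial : ℝ) * Real.exp (ε * Real.log Y)) ^ τ :=
        pow_le_pow_left₀ (pow_nonneg hW0 n) hstep τ
    _ = ((((τ : ℝ) + 1) / δ) ^ n) ^ τ * ((n.factorial : ℝ)) ^ τ *
          Real.exp (ε * Real.log Y) ^ τ := by rw [mul_pow, mul_pow]
    _ ≤ ((((τ : ℝ) + 1) / δ) ^ n) ^ τ * Q ^ τ * Real.exp (ε * Real.log Y) ^ τ :=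
        mul_le_mul_of_nonneg_right (mul_le_mul_of_nonneg_left hfτ hc0)
          (pow_nonneg (Real.exp_pos _).le τ)
    _ ≤ ((((τ : ℝ) + 1) / δ) ^ n) ^ τ * Q ^ τ * Y ^ δ :=
        mul_le_mul_of_nonneg_left hexp (mul_nonneg hc0 (pow_nonneg hQ0 τ))

/-- The logarithmic factor of the general socket against the radical: with `W₃ = log Y₃ ≥ 1`,
`W₃ ≤ 2W`, `R ≥ 1`, `n! ≤ Q`:
`(W₃ + log R)^{τ₀ + τ₁ n} ≤ (2^{τ₀} W^{τ₀}) (C^{τ₁ n} Q^{τ₁} Y₃^δ) ((8(τ₀+1))^{τ₀} 2R^{1/8}) (eQR)^{τ₁}`,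
`C = (τ₁+1)/δ`. [cite: ShoreyTijdeman1986, Ch. 1, proof of Theorem 1.2 (PDF p. 48) (logarithmic bookkeeping of the socket)] -/
theorem logFactor_le {Q R Y₃ W δ : ℝ} {n τ₀ τ₁ : ℕ} (hR : 1 ≤ R) (hY₃ : 1 ≤ Y₃)
    (hW₃1 : 1 ≤ Real.log Y₃) (hW₃W : Real.log Y₃ ≤ 2 * W) (hfact : (n.factorial : ℝ) ≤ Q)
    (hδ : 0 < δ) :
    (Real.log Y₃ + Real.log R) ^ (τ₀ + τ₁ * n) ≤
      (2 ^ τ₀ * W ^ τ₀) * ((((τ₁ : ℝ) + 1) / δ) ^ (τ₁ * n) * Q ^ τ₁ * Y₃ ^ δ) *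
        ((8 * ((τ₀ : ℝ) + 1)) ^ τ₀ * (2 * R ^ (1 / 8 : ℝ))) * (Real.exp 1 * Q * R) ^ τ₁ := by
  have hR0 : 0 < R := by linarith
  have hlogR0 : 0 ≤ Real.log R := Real.log_nonneg hR
  have hW₃0 : 0 ≤ Real.log Y₃ := zero_le_one.trans hW₃1
  have hQ0 : 0 ≤ Q := le_trans (Nat.cast_nonneg _) hfact
  have hW0 : 0 ≤ W := by linarith
  have hY₃0 : 0 ≤ Y₃ := by linarith
  set W₃ := Real.log Y₃ with hW₃
  -- `(W₃ + log R)^N ≤ W₃^N (1 + log R)^N`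
  have h4 : (W₃ + Real.log R) ^ (τ₀ + τ₁ * n) ≤
      W₃ ^ (τ₀ + τ₁ * n) * (1 + Real.log R) ^ (τ₀ + τ₁ * n) := by
    rw [← mul_pow]
    apply pow_le_pow_left₀ (by linarith)
    have : Real.log R ≤ W₃ * Real.log R := le_mul_of_one_le_left hlogR0 hW₃1
    linarith [mul_add W₃ 1 (Real.log R)]
  have h4a := one_add_log_pow_mul_le (τ := τ₁) hR hfact
  have h4b := one_add_log_pow_le hR τ₀
  have h4c := log_pow_mul_le (τ := τ₁) hY₃ hfact hδ
  have h4d : W₃ ^ τ₀ ≤ 2 ^ τ₀ * W ^ τ₀ := by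
    rw [← mul_pow]; exact pow_le_pow_left₀ hW₃0 hW₃W τ₀
  calc (W₃ + Real.log R) ^ (τ₀ + τ₁ * n)
      ≤ W₃ ^ (τ₀ + τ₁ * n) * (1 + Real.log R) ^ (τ₀ + τ₁ * n) := h4
    _ = (W₃ ^ τ₀ * W₃ ^ (τ₁ * n)) * ((1 + Real.log R) ^ τ₀ * (1 + Real.log R) ^ (τ₁ * n)) := by
        rw [pow_add, pow_add]
    _ ≤ ((2 ^ τ₀ * W ^ τ₀) * ((((τ₁ : ℝ) + 1) / δ) ^ (τ₁ * n) * Q ^ τ₁ * Y₃ ^ δ)) *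
          (((8 * ((τ₀ : ℝ) + 1)) ^ τ₀ * (2 * R ^ (1 / 8 : ℝ))) * (Real.exp 1 * Q * R) ^ τ₁) := by
        apply mul_le_mul
        · exact mul_le_mul h4d h4c (pow_nonneg hW₃0 _) (by positivity)
        · exact mul_le_mul h4b h4a (pow_nonneg (by linarith) _) (by positivity)
        · exact mul_nonneg (pow_nonneg (by linarith) _) (pow_nonneg (by linarith) _)
        · positivity
    _ = _ := by ring

/-- Collecting the powers of the radical: for `R > 0`,
`R^κ R^{1/4} R^{1/8} R^{τ} R^{1/8} R^{τ} R^{τ} (R^σ R^{1/8}) = R^{κ+σ+3τ+5/8}`. [cite: ShoreyTijdeman1986, Ch. 1, proof of Theorem 1.2 (PDF p. 48) (logarithmic bookkeeping of the socket)] -/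
theorem rpow_collect {R κ σ : ℝ} (hR0 : 0 < R) (τ : ℕ) :
    R ^ κ * R ^ (1 / 4 : ℝ) * R ^ (1 / 8 : ℝ) * R ^ τ * R ^ (1 / 8 : ℝ) * R ^ τ * R ^ τ *
      (R ^ σ * R ^ (1 / 8 : ℝ)) = R ^ (κ + σ + 3 * τ + 5 / 8 : ℝ) := by
  rw [← Real.rpow_natCast R τ]
  simp only [← Real.rpow_add hR0]
  congr 1; ring

/-- Monotonicity of the collected powers: `0 < Q ≤ R`, `0 < P ≤ R`, `κ, σ ≥ 0`. [cite: ShoreyTijdeman1986, Ch. 1, proof of Theorem 1.2 (PDF p. 48) (logarithmic bookkeeping of the socket)] -/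
theorem powers_le_rpow {Q P R κ σ : ℝ} (hQ0 : 0 < Q) (hQR : Q ≤ R) (hP0 : 0 < P) (hPR : P ≤ R)
    (hκ : 0 ≤ κ) (hσ : 0 ≤ σ) (τ : ℕ) :
    Q ^ κ * Q ^ (1 / 4 : ℝ) * Q ^ (1 / 8 : ℝ) * Q ^ τ * R ^ (1 / 8 : ℝ) * Q ^ τ * R ^ τ *
      (P ^ σ * P ^ (1 / 8 : ℝ)) ≤ R ^ (κ + σ + 3 * τ + 5 / 8 : ℝ) := by
  have hR0 : 0 < R := lt_of_lt_of_le hQ0 hQR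
  rw [← rpow_collect hR0 τ]
  have hQκ : Q ^ κ ≤ R ^ κ := Real.rpow_le_rpow hQ0.le hQR hκ
  have hQ4 : Q ^ (1 / 4 : ℝ) ≤ R ^ (1 / 4 : ℝ) := Real.rpow_le_rpow hQ0.le hQR (by norm_num)
  have hQ8 : Q ^ (1 / 8 : ℝ) ≤ R ^ (1 / 8 : ℝ) := Real.rpow_le_rpow hQ0.le hQR (by norm_num)
  have hQτ : Q ^ τ ≤ R ^ τ := pow_le_pow_left₀ hQ0.le hQR τ
  have hPσ : P ^ σ * P ^ (1 / 8 : ℝ) ≤ R ^ σ * R ^ (1 / 8 : ℝ) :=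
    mul_le_mul (Real.rpow_le_rpow hP0.le hPR hσ) (Real.rpow_le_rpow hP0.le hPR (by norm_num))
      (Real.rpow_nonneg hP0.le _) (Real.rpow_nonneg hR0.le _)
  have hR8 : 0 ≤ R ^ (1 / 8 : ℝ) := Real.rpow_nonneg hR0.le _
  have hRτ : 0 ≤ R ^ τ := pow_nonneg hR0.le _
  apply mul_le_mul _ hPσ (by positivity) (by positivity)
  apply mul_le_mul_of_nonneg_right _ hRτ
  apply mul_le_mul _ hQτ (by positivity) (by positivity)
  apply mul_le_mul_of_nonneg_right _ hR8
  apply mul_le_mul _ hQτ (by positivity) (by positivity)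
  apply mul_le_mul _ hQ8 (by positivity) (by positivity)
  exact mul_le_mul hQκ hQ4 (by positivity) (by positivity)

end Literature.NumberTheory.Transcendental.StewartYu

end Part9

/-!
## Part 10 — port of `Summits/ABC/StewartYu/PrimePadicSocketRad.lean` (1 declarations kept)

# Cell abc-stewartyu: the prime-argument `p`-adic SOCKET of the abc assembly, III —
# one member of the triple against the radical, general exponents

`Summits/ABC/StewartYu/PrimePadicSocketRad.lean` — sequel to
`PrimePadicSocketLog.lean` (theorems only: no definition, no named fact).
The book-keeping of the general socket: for a `p`-adic bound at prime arguments of the shape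
`K Lⁿ n^{κn} p^σ (∏ log qᵢ) (log max(3, max|eᵢ|) + log p + ∑ log qᵢ)^{τ₀ + τ₁ n}` (`κ, σ ≥ 0`
real, `τ₀, τ₁ ∈ ℕ`), applied at the primes `p ≥ p₀` of a member `x` of a triple with cofactors
`y, z` (`x ∣ y² − z²`), the sum `∑_{p ∣ x, p ≥ p₀} ord_p(x) log p` is at most
`M · rad(xyz)^{κ+σ+3τ₁+5/8} · max(3, 3 log max(y,z))^δ · (log max(3, log max(y,z)))^{τ₀}`
(`sum_padicPart_le_rad_general`), for every `δ > 0`, with `M = 48 K A e^{τ₁} (16(τ₀+1))^{τ₀}` and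
`A` the constant absorbing `(4 L e^κ ((τ₁+1)/δ)^{τ₁})^{ω(yz)}` against `rad(yz)^{1/8}`
(`exists_pow_card_le_prod_rpow`). Book-keeping, with `Q = rad(yz) ≥ n!`, `n = ω(yz)`,
`R = rad(xyz)`: `n^{κn} ≤ e^{κn} Q^κ`, `∏ log q ≤ 4ⁿ Q^{1/4}`, `∑_{p∣x} p^σ log p ≤ 8 rad(x)^{σ+1/8}`,
`log p + ∑ log qᵢ ≤ log R`, `(W + log R)^N ≤ W^N (1 + log R)^N` (`W ≥ 1`),
`(1 + log R)ⁿ ≤ n! · eR`, `Wⁿ ≤ ε^{-n} n! e^{εW}` (`ε = δ/(τ₁+1)`),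
`(1 + log R)^{τ₀} ≤ (8(τ₀+1))^{τ₀} · 2R^{1/8}` (`logFactor_le`, `one_add_log_pow_mul_le`,
`one_add_log_pow_le`, `log_pow_mul_le`, `rpow_collect`, `powers_le_rpow`).

Nothing here is claimed to be in print beyond the summation pattern of Stewart–Tijdeman 1986
[cite: ShoreyTijdeman1986, Ch. 1, proof of Theorem 1.2 (PDF p. 48)].

## References

* [StewartTijdeman1986] C. L. Stewart, R. Tijdeman, *On the Oesterlé–Masser conjecture*, Monatsh.
  Math. 102 (1986), 251–257 — Theorem 1, as quoted in [Waldschmidt2014] §2.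
* [ShoreyTijdeman1986] T. N. Shorey, R. Tijdeman, *Exponential Diophantine Equations*, Cambridge
  Tracts in Math. 87, CUP 1986 — Ch. 1, Theorem 1.2 and its proof.
-/

section Part10

open _root_.Finset _root_.Real
open Literature.NumberTheory.DiophantineGeometry

namespace Literature.NumberTheory.Transcendental.StewartYu

open Literature.Barriers.ABC Literature.Barriers.ABC.StewartTijdemanGeneric

/-! ### One member of the triple against the radical, general exponents -/

/-- **The bound for one member, against the radical — general socket.** Hypothesis `hP`: for every
prime `p ≥ p₀`, all distinct primes `q₁, …, qₙ ≠ p` and all `e ∈ ℤⁿ ∖ {0}` with `∏ qᵢ^{eᵢ} ≠ 1`,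
`ord_p(∏ qᵢ^{eᵢ} − 1) ≤ K Lⁿ n^{κn} p^σ (∏ log qᵢ) (log max(3, max|eᵢ|) + log p + ∑ log qᵢ)^{τ₀ + τ₁ n}`
(`K ≥ 0`, `L ≥ 1`, `κ, σ ≥ 0`, `τ₀, τ₁ ∈ ℕ`). Then for coprime positive `y ≠ z` and `x > 0` coprime to
`yz` with `x ∣ y² − z²`, writing `R = rad(xyz)`, `Y₃ = max(3, 3 log max(y,z))`:
`∑_{p ∣ x, p ≥ p₀} ord_p(x) log p ≤ 48 K A e^{τ₁} (16(τ₀+1))^{τ₀} · R^{κ+σ+3τ₁+5/8} · Y₃^δ · (log max(3, log max(y,z)))^{τ₀}`,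
for any `δ > 0` and any `A ≥ 0` with `(4 L e^κ ((τ₁+1)/δ)^{τ₁})^{#S} ≤ A (∏ S)^{1/8}` for all finite
sets of primes `S` (`exists_pow_card_le_prod_rpow`). Book-keeping (with `Q = rad(yz) ≥ n!`,
`n = ω(yz)`): `n^{κn} ≤ e^{κn} Q^κ`, `∏ log q ≤ 4ⁿ Q^{1/4}`, `∑_{p∣x} p^σ log p ≤ 8 rad(x)^{σ+1/8}`,
`log p + ∑ log qᵢ ≤ log R`, and `logFactor_le`. [cite: ShoreyTijdeman1986, Ch. 1, proof of Theorem 1.2 (PDF p. 48) (the radical form of the socket)] -/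
theorem sum_padicPart_le_rad_general {K L κ σ δ A : ℝ} {τ₀ τ₁ p₀ : ℕ} (hK : 0 ≤ K) (hL : 1 ≤ L)
    (hκ0 : 0 ≤ κ) (hσ0 : 0 ≤ σ) (hδ : 0 < δ)
    (hP : ∀ (p n : ℕ) (q : Fin n → ℕ) (e : Fin n → ℤ), p.Prime → p₀ ≤ p →
      (∀ i, (q i).Prime) → Function.Injective q → (∀ i, q i ≠ p) → e ≠ 0 →
      ∏ i, ((q i : ℚ)) ^ e i ≠ 1 →
      (padicValRat p (∏ i, ((q i : ℚ)) ^ e i - 1) : ℝ) ≤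
        K * L ^ n * (n : ℝ) ^ (κ * n) * (p : ℝ) ^ σ * (∏ i, Real.log (q i)) *
          (Real.log (max 3 ((Finset.univ.sup fun i => (e i).natAbs : ℕ) : ℝ)) + Real.log p +
            ∑ i, Real.log (q i)) ^ (τ₀ + τ₁ * n))
    (hA0 : 0 ≤ A)
    (hA : ∀ S : Finset ℕ, (∀ q ∈ S, q.Prime) →
      (4 * L * Real.exp κ * (((τ₁ : ℝ) + 1) / δ) ^ τ₁) ^ S.card ≤
        A * (((∏ q ∈ S, q : ℕ)) : ℝ) ^ (1 / 8 : ℝ))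
    {x y z : ℕ} (hx : 0 < x) (hy : 0 < y) (hz : 0 < z) (hyz : y ≠ z) (hcop : Nat.Coprime y z)
    (hxcop : Nat.Coprime x (y * z)) (hdvd : (x : ℤ) ∣ (y : ℤ) ^ 2 - (z : ℤ) ^ 2) :
    ∑ p ∈ x.primeFactors.filter (fun p => p₀ ≤ p), (x.factorization p : ℝ) * Real.log p ≤
      48 * K * A * Real.exp τ₁ * (16 * ((τ₀ : ℝ) + 1)) ^ τ₀ *
        (((∏ q ∈ (x * (y * z)).primeFactors, q : ℕ)) : ℝ) ^ (κ + σ + 3 * τ₁ + 5 / 8 : ℝ) *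
        (max 3 (3 * Real.log (max y z : ℕ))) ^ δ *
        Real.log (max 3 (Real.log (max y z : ℕ))) ^ τ₀ := by
  classical
  have hx0 : x ≠ 0 := hx.ne'
  have hy0 : y ≠ 0 := hy.ne'
  have hz0 : z ≠ 0 := hz.ne'
  set S := (y * z).primeFactors with hS
  set n := S.card with hn
  set T := x.primeFactors.filter (fun p => p₀ ≤ p) with hT
  set Q : ℝ := (((∏ q ∈ S, q : ℕ)) : ℝ) with hQ
  set Px : ℝ := (((∏ p ∈ x.primeFactors, p : ℕ)) : ℝ) with hPx
  set P₂ : ℝ := (((∏ p ∈ T, p : ℕ)) : ℝ) with hP₂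
  set R : ℝ := (((∏ q ∈ (x * (y * z)).primeFactors, q : ℕ)) : ℝ) with hR
  set Θ : ℝ := ∏ q ∈ S, Real.log q with hΘ
  set Y₃ : ℝ := max 3 (3 * Real.log (max y z : ℕ)) with hY₃
  set W₃ : ℝ := Real.log Y₃ with hW₃
  set W : ℝ := Real.log (max 3 (Real.log (max y z : ℕ))) with hW
  set N : ℕ := τ₀ + τ₁ * n with hN
  set Sg : ℝ := ∑ p ∈ T, (p : ℝ) ^ σ * Real.log p with hSg
  have hprimeS : ∀ q ∈ S, q.Prime := fun q hq => Nat.prime_of_mem_primeFactors hq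
  have hprimeX : ∀ p ∈ x.primeFactors, p.Prime := fun p hp => Nat.prime_of_mem_primeFactors hp
  have hprimeT : ∀ p ∈ T, p.Prime := fun p hp => hprimeX p (Finset.mem_filter.mp hp).1
  have hQ1 : 1 ≤ Q := by
    rw [hQ]; exact_mod_cast Finset.prod_pos fun q hq => (hprimeS q hq).pos
  have hPx1 : 1 ≤ Px := by
    rw [hPx]; exact_mod_cast Finset.prod_pos fun p hp => (hprimeX p hp).pos
  have hP₂1 : 1 ≤ P₂ := by
    rw [hP₂]; exact_mod_cast Finset.prod_pos fun p hp => (hprimeT p hp).pos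
  have hP₂x : P₂ ≤ Px := by
    rw [hP₂, hPx]
    exact_mod_cast Finset.prod_le_prod_of_subset_of_one_le' (Finset.filter_subset _ _)
      fun p hp _ => (hprimeX p hp).one_lt.le
  -- the radical of `xyz`
  have hRad : R = Px * Q := by
    rw [hR, hPx, hQ, hS, Nat.Coprime.primeFactors_mul hxcop,
      Finset.prod_union hxcop.disjoint_primeFactors]
    push_cast; ring
  have hQ0 : 0 < Q := by linarith
  have hPx0 : 0 < Px := by linarith
  have hP₂0 : 0 < P₂ := by linarith
  have hR1 : 1 ≤ R := by rw [hRad]; exact one_le_mul_of_one_le_of_one_le hPx1 hQ1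
  have hR0 : 0 < R := by linarith
  have hQR : Q ≤ R := by rw [hRad]; exact le_mul_of_one_le_left hQ0.le hPx1
  have hPxR : Px ≤ R := by rw [hRad]; exact le_mul_of_one_le_right hPx0.le hQ1
  have hlogR0 : 0 ≤ Real.log R := Real.log_nonneg hR1
  -- `Y₃ ≥ 3`, `W₃ ≥ 1`, `W ≥ 1`
  have hY₃3 : (3 : ℝ) ≤ Y₃ := le_max_left _ _
  have hY₃1 : (1 : ℝ) ≤ Y₃ := le_trans (by norm_num) hY₃3
  have hY₃0 : 0 < Y₃ := by linarith
  have hl3 : 1 ≤ Real.log 3 := by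
    rw [Real.le_log_iff_exp_le (by norm_num)]
    exact Real.exp_one_lt_d9.le.trans (by norm_num)
  have hW₃1 : 1 ≤ W₃ := hl3.trans (Real.log_le_log (by norm_num) hY₃3)
  have hW₃0 : 0 ≤ W₃ := zero_le_one.trans hW₃1
  have hW1 : 1 ≤ W := hl3.trans (Real.log_le_log (by norm_num) (le_max_left _ _))
  have hW0 : 0 ≤ W := zero_le_one.trans hW1
  have hW₃W : W₃ ≤ 2 * W := by rw [hW₃, hY₃, hW]; exact log_max_three_mul_le _
  have hΘ0 : 0 ≤ Θ := Finset.prod_nonneg fun q hq =>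
    Real.log_nonneg (by exact_mod_cast (hprimeS q hq).one_lt.le)
  have hL0 : 0 ≤ L := zero_le_one.trans hL
  -- Step 1: the localized summation with `F p = K Lⁿ n^{κn} p^σ Θ (W₃ + log R)^N`
  have hsum := sum_padicPart_le_of_local
    (fun p => K * L ^ n * (n : ℝ) ^ (κ * n) * (p : ℝ) ^ σ * Θ * (W₃ + Real.log R) ^ N)
    (p₀ := p₀) hx hy hz hyz hcop hxcop hdvd ?_
  swap
  · intro p q e hpP hp₀ hpdx hqP hinj himg hqp hene hne1 hB
    have key := hP p n q e hpP hp₀ hqP hinj hqp hene hne1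
    -- `∏ log qᵢ = Θ`, `∑ log qᵢ = log Q`
    have hprodq : ∏ i, Real.log (q i) = Θ := by
      have h := Finset.prod_image (f := fun r : ℕ => Real.log (r : ℝ)) (s := Finset.univ)
        (g := q) (fun i _ j _ h => hinj h)
      rw [himg] at h
      rw [hΘ, h]
    have hsumq : ∑ i, Real.log (q i) = Real.log Q := by
      have h := Finset.sum_image (f := fun r : ℕ => Real.log (r : ℝ)) (s := Finset.univ)
        (g := q) (fun i _ j _ h => hinj h)
      rw [himg] at h
      rw [hQ, Nat.cast_prod, Real.log_prod (s := S) (fun r hr => ?_), h]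
      exact_mod_cast (hprimeS r hr).ne_zero
    -- `p · Q ≤ R`
    have hpx : p ∈ x.primeFactors := Nat.mem_primeFactors.mpr ⟨hpP, hpdx, hx0⟩
    have hpPx : (p : ℝ) ≤ Px := by
      rw [hPx]
      exact_mod_cast Nat.le_of_dvd (Finset.prod_pos fun p hp => (hprimeX p hp).pos)
        (Finset.dvd_prod_of_mem _ hpx)
    have hp0 : (0 : ℝ) < p := by exact_mod_cast hpP.pos
    have hlogpQ : Real.log p + Real.log Q ≤ Real.log R := by
      rw [← Real.log_mul hp0.ne' hQ0.ne', hRad]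
      exact Real.log_le_log (mul_pos hp0 hQ0) (mul_le_mul_of_nonneg_right hpPx hQ0.le)
    -- the logarithmic factor
    have hsup3 : Real.log (max 3 (((Finset.univ.sup fun i => (e i).natAbs : ℕ)) : ℝ)) ≤ W₃ := by
      rw [hW₃, hY₃]
      exact Real.log_le_log (lt_of_lt_of_le (by norm_num) (le_max_left _ _))
        (max_le_max le_rfl hB)
    have h1 : 0 ≤ Real.log (max 3 (((Finset.univ.sup fun i => (e i).natAbs : ℕ)) : ℝ)) :=
      Real.log_nonneg (le_trans (by norm_num) (le_max_left _ _))
    have h2 : 0 ≤ Real.log p := Real.log_nonneg (by exact_mod_cast hpP.one_lt.le)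
    have h3 : 0 ≤ ∑ i, Real.log (q i) := Finset.sum_nonneg fun i _ =>
      Real.log_nonneg (by exact_mod_cast (hqP i).one_lt.le)
    have hbase0 : 0 ≤ Real.log (max 3 (((Finset.univ.sup fun i => (e i).natAbs : ℕ)) : ℝ)) +
        Real.log p + ∑ i, Real.log (q i) := by linarith
    have hbase : Real.log (max 3 (((Finset.univ.sup fun i => (e i).natAbs : ℕ)) : ℝ)) +
        Real.log p + ∑ i, Real.log (q i) ≤ W₃ + Real.log R := by
      rw [hsumq]; linarith
    have hpowN : (Real.log (max 3 (((Finset.univ.sup fun i => (e i).natAbs : ℕ)) : ℝ)) +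
        Real.log p + ∑ i, Real.log (q i)) ^ N ≤ (W₃ + Real.log R) ^ N :=
      pow_le_pow_left₀ hbase0 hbase N
    have hpre : 0 ≤ K * L ^ n * (n : ℝ) ^ (κ * n) * (p : ℝ) ^ σ * Θ := by
      have : 0 ≤ L ^ n := pow_nonneg hL0 n
      positivity
    rw [hprodq] at key
    exact key.trans (mul_le_mul_of_nonneg_left hpowN hpre)
  -- Step 2: pull the `p`-independent factor out of the sum
  have hsum' : ∑ p ∈ T, (x.factorization p : ℝ) * Real.log p ≤
      K * L ^ n * (n : ℝ) ^ (κ * n) * Θ * (W₃ + Real.log R) ^ N * Sg := by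
    refine hsum.trans (le_of_eq ?_)
    rw [hSg, Finset.mul_sum]
    exact Finset.sum_congr rfl fun p _ => by ring
  -- Step 3: the book-keeping
  have hfact : ((n.factorial : ℕ) : ℝ) ≤ Q := by
    rw [hQ]
    exact_mod_cast factorial_card_le_prod n S hn.symm fun q hq => (hprimeS q hq).one_lt.le
  have h1 : (n : ℝ) ^ (κ * n) ≤ Real.exp κ ^ n * Q ^ κ :=
    (rpow_mul_self_le hκ0 n).trans
      (mul_le_mul_of_nonneg_left (Real.rpow_le_rpow (Nat.cast_nonneg _) hfact hκ0)
        (pow_nonneg (Real.exp_pos κ).le n))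
  have h2 : Θ ≤ 4 ^ n * Q ^ (1 / 4 : ℝ) := by
    have h := prod_log_le_pow_mul_prod_rpow hprimeS (θ := 1 / 4) (by norm_num)
    rw [one_div_one_div] at h
    exact h
  have h3 : Sg ≤ 8 * (P₂ ^ σ * P₂ ^ (1 / 8 : ℝ)) := by
    have h := sum_rpow_mul_log_le hprimeT hσ0
    have hlog : Real.log P₂ ≤ P₂ ^ (1 / 8 : ℝ) / (1 / 8) :=
      Real.log_le_rpow_div (zero_le_one.trans hP₂1) (by norm_num)
    calc Sg ≤ P₂ ^ σ * Real.log P₂ := h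
      _ ≤ P₂ ^ σ * (P₂ ^ (1 / 8 : ℝ) / (1 / 8)) :=
          mul_le_mul_of_nonneg_left hlog (Real.rpow_nonneg (zero_le_one.trans hP₂1) σ)
      _ = 8 * (P₂ ^ σ * P₂ ^ (1 / 8 : ℝ)) := by ring
  have h4 := logFactor_le (τ₀ := τ₀) (τ₁ := τ₁) (W := W) hR1 hY₃1 hW₃1 hW₃W hfact hδ
  have h5 : (4 * L * Real.exp κ * (((τ₁ : ℝ) + 1) / δ) ^ τ₁) ^ n ≤ A * Q ^ (1 / 8 : ℝ) :=
    hA S hprimeS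
  have h6 := powers_le_rpow hQ0 hQR hP₂0 (hP₂x.trans hPxR) hκ0 hσ0 τ₁
  -- final assembly
  have hSg0 : 0 ≤ Sg := Finset.sum_nonneg fun p hp => mul_nonneg
    (Real.rpow_nonneg (Nat.cast_nonneg p) σ)
    (Real.log_nonneg (by exact_mod_cast (hprimeT p hp).one_lt.le))
  have hmain : K * L ^ n * (n : ℝ) ^ (κ * n) * Θ * (W₃ + Real.log R) ^ N * Sg ≤
      K * L ^ n * (Real.exp κ ^ n * Q ^ κ) * (4 ^ n * Q ^ (1 / 4 : ℝ)) *
        ((2 ^ τ₀ * W ^ τ₀) * ((((τ₁ : ℝ) + 1) / δ) ^ (τ₁ * n) * Q ^ τ₁ * Y₃ ^ δ) *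
          ((8 * ((τ₀ : ℝ) + 1)) ^ τ₀ * (2 * R ^ (1 / 8 : ℝ))) * (Real.exp 1 * Q * R) ^ τ₁) *
        (8 * (P₂ ^ σ * P₂ ^ (1 / 8 : ℝ))) := by
    have hKL : 0 ≤ K * L ^ n := mul_nonneg hK (pow_nonneg hL0 n)
    apply mul_le_mul _ h3 hSg0 (by positivity)
    apply mul_le_mul _ h4 (pow_nonneg (by linarith) N) (by positivity)
    apply mul_le_mul _ h2 hΘ0 (by positivity)
    exact mul_le_mul_of_nonneg_left h1 hKL
  have hC : (4 * L * Real.exp κ * (((τ₁ : ℝ) + 1) / δ) ^ τ₁) ^ n =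
      L ^ n * Real.exp κ ^ n * 4 ^ n * (((τ₁ : ℝ) + 1) / δ) ^ (τ₁ * n) := by
    rw [mul_pow, mul_pow, mul_pow, ← pow_mul]; ring
  have hY0 : 0 ≤ Y₃ ^ δ := Real.rpow_nonneg hY₃0.le δ
  have hWτ : 0 ≤ W ^ τ₀ := pow_nonneg hW0 τ₀
  have hrest : 0 ≤ Q ^ κ * Q ^ (1 / 4 : ℝ) * Q ^ (1 / 8 : ℝ) * Q ^ τ₁ * R ^ (1 / 8 : ℝ) * Q ^ τ₁ *
      R ^ τ₁ * (P₂ ^ σ * P₂ ^ (1 / 8 : ℝ)) := by positivity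
  calc ∑ p ∈ T, (x.factorization p : ℝ) * Real.log p
      ≤ K * L ^ n * (n : ℝ) ^ (κ * n) * Θ * (W₃ + Real.log R) ^ N * Sg := hsum'
    _ ≤ _ := hmain
    _ = 16 * K * Real.exp 1 ^ τ₁ * (16 * ((τ₀ : ℝ) + 1)) ^ τ₀ *
          ((4 * L * Real.exp κ * (((τ₁ : ℝ) + 1) / δ) ^ τ₁) ^ n) *
          (Q ^ κ * Q ^ (1 / 4 : ℝ) * Q ^ τ₁ * R ^ (1 / 8 : ℝ) * Q ^ τ₁ * R ^ τ₁ *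
            (P₂ ^ σ * P₂ ^ (1 / 8 : ℝ))) * Y₃ ^ δ * W ^ τ₀ := by
        rw [hC, show (16 : ℝ) * ((τ₀ : ℝ) + 1) = 2 * (8 * ((τ₀ : ℝ) + 1)) by ring, mul_pow 2,
          mul_pow (Real.exp 1 * Q) R, mul_pow (Real.exp 1) Q]
        ring
    _ ≤ 16 * K * Real.exp 1 ^ τ₁ * (16 * ((τ₀ : ℝ) + 1)) ^ τ₀ *
          (A * Q ^ (1 / 8 : ℝ)) *
          (Q ^ κ * Q ^ (1 / 4 : ℝ) * Q ^ τ₁ * R ^ (1 / 8 : ℝ) * Q ^ τ₁ * R ^ τ₁ *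
            (P₂ ^ σ * P₂ ^ (1 / 8 : ℝ))) * Y₃ ^ δ * W ^ τ₀ := by
        have h0 : 0 ≤ 16 * K * Real.exp 1 ^ τ₁ * (16 * ((τ₀ : ℝ) + 1)) ^ τ₀ := by positivity
        have hrest' : 0 ≤ (Q ^ κ * Q ^ (1 / 4 : ℝ) * Q ^ τ₁ * R ^ (1 / 8 : ℝ) * Q ^ τ₁ * R ^ τ₁ *
            (P₂ ^ σ * P₂ ^ (1 / 8 : ℝ))) := by positivity
        apply mul_le_mul_of_nonneg_right _ hWτ
        apply mul_le_mul_of_nonneg_right _ hY0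
        apply mul_le_mul_of_nonneg_right _ hrest'
        exact mul_le_mul_of_nonneg_left h5 h0
    _ = 16 * K * A * Real.exp 1 ^ τ₁ * (16 * ((τ₀ : ℝ) + 1)) ^ τ₀ *
          (Q ^ κ * Q ^ (1 / 4 : ℝ) * Q ^ (1 / 8 : ℝ) * Q ^ τ₁ * R ^ (1 / 8 : ℝ) * Q ^ τ₁ * R ^ τ₁ *
            (P₂ ^ σ * P₂ ^ (1 / 8 : ℝ))) * Y₃ ^ δ * W ^ τ₀ := by ring
    _ ≤ 16 * K * A * Real.exp 1 ^ τ₁ * (16 * ((τ₀ : ℝ) + 1)) ^ τ₀ *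
          R ^ (κ + σ + 3 * τ₁ + 5 / 8 : ℝ) * Y₃ ^ δ * W ^ τ₀ := by
        have h0 : 0 ≤ 16 * K * A * Real.exp 1 ^ τ₁ * (16 * ((τ₀ : ℝ) + 1)) ^ τ₀ := by positivity
        apply mul_le_mul_of_nonneg_right _ hWτ
        apply mul_le_mul_of_nonneg_right _ hY0
        exact mul_le_mul_of_nonneg_left h6 h0
    _ ≤ 48 * K * A * Real.exp τ₁ * (16 * ((τ₀ : ℝ) + 1)) ^ τ₀ *
          R ^ (κ + σ + 3 * τ₁ + 5 / 8 : ℝ) * Y₃ ^ δ * W ^ τ₀ := by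
        have hRμ : 0 ≤ R ^ (κ + σ + 3 * τ₁ + 5 / 8 : ℝ) := Real.rpow_nonneg hR0.le _
        apply mul_le_mul_of_nonneg_right _ hWτ
        apply mul_le_mul_of_nonneg_right _ hY0
        apply mul_le_mul_of_nonneg_right _ hRμ
        rw [Real.exp_one_pow]
        have : 0 ≤ K * A * Real.exp τ₁ * (16 * ((τ₀ : ℝ) + 1)) ^ τ₀ := by positivity
        linarith

end Literature.NumberTheory.Transcendental.StewartYu

end Part10

/-!
## Part 11 — port of `Summits/ABC/StewartYu/PrimePadicSocketOdd.lean` (3 declarations kept)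

# Cell abc-stewartyu: the prime-argument `p`-adic SOCKET of the abc assembly, V —
# socket A⁺ at the ODD primes (no `2`-adic input, no archimedean input)

`Summits/ABC/StewartYu/PrimePadicSocketOdd.lean` — cell `abc-stewartyu` (HOME
`run/shared/lean/pub/abc-stewartyu/`, seat p3; theorems only, no definition, no named fact), sequel to
`PrimePadicSocketRad.lean` and `PrimePadicSocket.lean`.

**Socket A⁺ at the odd primes** (`bakerShapeBound_of_oddPrimePadicBound_general`). If the class bound
of socket A⁺,

  `ord_p(q₁^{e₁}⋯qₙ^{eₙ} − 1) ≤ K · Lⁿ · n^{κn} · p^σ · (log q₁ ⋯ log qₙ) ·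
      (log max(3, max|eᵢ|) + log p + ∑ᵢ log qᵢ)^{τ₀ + τ₁ n}`

(distinct primes `qᵢ ≠ p`, `e ≠ 0`, `∏ qᵢ^{eᵢ} ≠ 1`), holds for every ODD prime `p ≥ 3`, then already
`log c ≤ C · rad(abc)^{κ+σ+3τ₁+1}` for every abc triple (`BakerShapeBound (κ+σ+3τ₁+1) 0`), and
`stewartTijdeman1986_upperBound` (`log c ≤ κ R^{15}` [cite: StewartTijdeman1986, Theorem 1 (upper
bound), as quoted in Waldschmidt2014 §2 (PDF p. 3)]) when `κ + σ + 3τ₁ + 1 ≤ 15`. Reason: if `c` is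
odd, expand `c = ∑_{p ∣ c} ord_p(c) log p` at its (odd) primes; if `c` is even, `a` and `b` are odd and
(for `a < b`) `c < 2b`, so expand `b` (`b ∣ c² − a²`) and absorb `log 2` in the constant
(`log_oddMember_le`). So the `p`-adic core of the cell (blueprint `HOME/p2/PADIC-CORE.md`) need not
treat `p = 2` — where the points `s/2^J` of the `2`-descent leave `ℤ₂` (risk R4 there) — and no
archimedean estimate is needed to dispense with it (contrast Theorem B of
`Literature/Barriers/ABC/BakerMethodBoundsStewartTijdemanGenericProofs.lean`, which removes `p = 2, 3`
at the price of an archimedean bound for `k log 2 + l log 3 + log ξ`).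

Nothing here is claimed to be in print beyond the summation pattern of Stewart–Tijdeman 1986
[cite: ShoreyTijdeman1986, Ch. 1, proof of Theorem 1.2 (PDF p. 48)].
-/

section Part11

open _root_.Finset _root_.Real
open Literature.NumberTheory.DiophantineGeometry

namespace Literature.NumberTheory.Transcendental.StewartYu

open Literature.Barriers.ABC Literature.Barriers.ABC.StewartTijdemanGeneric

/-- **One odd member against the radical.** Under the odd-prime class bound (`p ≥ 3`), for an odd
positive `x` coprime to `yz` with `x ∣ y² − z²` (`y ≠ z` coprime, `max(y, z) ≤ c`), writing
`R = rad(xyz)` and `Y = max(3, log c)`: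
`log x ≤ 3 M₀ · R^{κ+σ+3τ₁+5/8} · Y^δ · (log Y)^{τ₀}`, `M₀ = 48 K A e^{τ₁} (16(τ₀+1))^{τ₀}`
(`sum_padicPart_le_rad_general` at `p₀ = 3`; all primes of `x` are `≥ 3`). [cite: StewartTijdeman1986, Theorem 1 (upper bound), as quoted in Waldschmidt2014 §2 (PDF p. 3) (socket A⁺ at the odd primes ⇒ BakerShapeBound)] -/
theorem log_oddMember_le {K L κ σ δ A : ℝ} {τ₀ τ₁ : ℕ} (hK : 0 ≤ K) (hL : 1 ≤ L)
    (hκ0 : 0 ≤ κ) (hσ0 : 0 ≤ σ) (hδ : 0 < δ) (hδ1 : δ ≤ 1)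
    (hP : ∀ (p n : ℕ) (q : Fin n → ℕ) (e : Fin n → ℤ), p.Prime → 3 ≤ p →
      (∀ i, (q i).Prime) → Function.Injective q → (∀ i, q i ≠ p) → e ≠ 0 →
      ∏ i, ((q i : ℚ)) ^ e i ≠ 1 →
      (padicValRat p (∏ i, ((q i : ℚ)) ^ e i - 1) : ℝ) ≤
        K * L ^ n * (n : ℝ) ^ (κ * n) * (p : ℝ) ^ σ * (∏ i, Real.log (q i)) *
          (Real.log (max 3 ((Finset.univ.sup fun i => (e i).natAbs : ℕ) : ℝ)) + Real.log p +
            ∑ i, Real.log (q i)) ^ (τ₀ + τ₁ * n))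
    (hA0 : 0 ≤ A)
    (hA : ∀ S : Finset ℕ, (∀ q ∈ S, q.Prime) →
      (4 * L * Real.exp κ * (((τ₁ : ℝ) + 1) / δ) ^ τ₁) ^ S.card ≤
        A * (((∏ q ∈ S, q : ℕ)) : ℝ) ^ (1 / 8 : ℝ))
    {x y z c : ℕ} (hx : 0 < x) (hy : 0 < y) (hz : 0 < z) (hyz : y ≠ z) (hcop : Nat.Coprime y z)
    (hxcop : Nat.Coprime x (y * z)) (hdvd : (x : ℤ) ∣ (y : ℤ) ^ 2 - (z : ℤ) ^ 2)
    (hodd : ¬ 2 ∣ x) (hyc : y ≤ c) (hzc : z ≤ c) :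
    Real.log x ≤ 3 * (48 * K * A * Real.exp τ₁ * (16 * ((τ₀ : ℝ) + 1)) ^ τ₀) *
      (((∏ q ∈ (x * (y * z)).primeFactors, q : ℕ)) : ℝ) ^ (κ + σ + 3 * τ₁ + 5 / 8 : ℝ) *
      (max 3 (Real.log c)) ^ δ * Real.log (max 3 (Real.log c)) ^ τ₀ := by
  classical
  have hx0 : x ≠ 0 := hx.ne'
  have hmem := sum_padicPart_le_rad_general (p₀ := 3) hK hL hκ0 hσ0 hδ hP hA0 hA hx hy hz hyz hcop
    hxcop hdvd
  -- every prime of `x` is `≥ 3`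
  have hfilter : x.primeFactors.filter (fun p => 3 ≤ p) = x.primeFactors := by
    refine Finset.filter_true_of_mem fun p hp => ?_
    have hpP := Nat.prime_of_mem_primeFactors hp
    have hp2 : p ≠ 2 := fun h => hodd (h ▸ Nat.dvd_of_mem_primeFactors hp)
    have := hpP.two_le
    omega
  have hlogx : Real.log x = ∑ p ∈ x.primeFactors, (x.factorization p : ℝ) * Real.log p := by
    have h1 := Nat.prod_primeFactors_pow_factorization hx0
    have h2 : (x : ℝ) = ∏ p ∈ x.primeFactors, (p : ℝ) ^ x.factorization p := by
      exact_mod_cast h1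
    rw [h2, Real.log_prod]
    · exact Finset.sum_congr rfl fun p _ => Real.log_pow _ _
    · intro p hp
      exact pow_ne_zero _ (by exact_mod_cast (Nat.prime_of_mem_primeFactors hp).ne_zero)
  rw [hfilter, ← hlogx] at hmem
  -- the logarithms against `Y = max(3, log c)`
  set Y : ℝ := max 3 (Real.log c) with hYdef
  have hY3 : (3 : ℝ) ≤ Y := le_max_left _ _
  have hmaxpos : (0 : ℝ) < (max y z : ℕ) := by exact_mod_cast lt_max_of_lt_left hy
  have hc0 : 0 < c := lt_of_lt_of_le hy hyc
  have hmaxc : Real.log (max y z : ℕ) ≤ Real.log c :=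
    Real.log_le_log hmaxpos (by exact_mod_cast (max_le hyc hzc : max y z ≤ c))
  have hW : Real.log (max 3 (Real.log (max y z : ℕ))) ^ τ₀ ≤ Real.log Y ^ τ₀ := by
    apply pow_le_pow_left₀ (Real.log_nonneg (le_trans (by norm_num) (le_max_left _ _)))
    exact Real.log_le_log (lt_of_lt_of_le (by norm_num) (le_max_left _ _))
      (max_le_max le_rfl hmaxc)
  have hY₃ : (max 3 (3 * Real.log (max y z : ℕ)) : ℝ) ^ δ ≤ 3 * Y ^ δ := by
    have hle : (max 3 (3 * Real.log (max y z : ℕ)) : ℝ) ≤ 3 * Y :=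
      max_le (by linarith) (by linarith [le_max_right 3 (Real.log c)])
    have h0 : (0 : ℝ) ≤ max 3 (3 * Real.log (max y z : ℕ)) := le_trans (by norm_num) (le_max_left _ _)
    calc (max 3 (3 * Real.log (max y z : ℕ)) : ℝ) ^ δ ≤ (3 * Y) ^ δ :=
          Real.rpow_le_rpow h0 hle hδ.le
      _ = (3 : ℝ) ^ δ * Y ^ δ := Real.mul_rpow (by norm_num) (by linarith)
      _ ≤ 3 * Y ^ δ := by
          apply mul_le_mul_of_nonneg_right _ (Real.rpow_nonneg (by linarith) δ)
          calc (3 : ℝ) ^ δ ≤ (3 : ℝ) ^ (1 : ℝ) :=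
                Real.rpow_le_rpow_of_exponent_le (by norm_num) hδ1
            _ = 3 := Real.rpow_one 3
  set M₀ : ℝ := 48 * K * A * Real.exp τ₁ * (16 * ((τ₀ : ℝ) + 1)) ^ τ₀ with hM₀
  set R : ℝ := (((∏ q ∈ (x * (y * z)).primeFactors, q : ℕ)) : ℝ) with hR
  have hRμ0 : (0 : ℝ) ≤ R ^ (κ + σ + 3 * τ₁ + 5 / 8 : ℝ) := by positivity
  calc Real.log x ≤ M₀ * R ^ (κ + σ + 3 * τ₁ + 5 / 8 : ℝ) *
        (max 3 (3 * Real.log (max y z : ℕ))) ^ δ * Real.log (max 3 (Real.log (max y z : ℕ))) ^ τ₀ :=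
        hmem
    _ ≤ M₀ * R ^ (κ + σ + 3 * τ₁ + 5 / 8 : ℝ) * (3 * Y ^ δ) * Real.log Y ^ τ₀ := by
        apply mul_le_mul _ hW (pow_nonneg (Real.log_nonneg (le_trans (by norm_num)
          (le_max_left _ _))) τ₀) (by positivity)
        exact mul_le_mul_of_nonneg_left hY₃ (by positivity)
    _ = 3 * M₀ * R ^ (κ + σ + 3 * τ₁ + 5 / 8 : ℝ) * Y ^ δ * Real.log Y ^ τ₀ := by ring

/-- **Socket A⁺ at the odd primes.** The conclusion of `bakerShapeBound_of_primePadicBound_general`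
(`log c ≤ C · rad(abc)^{κ+σ+3τ₁+1}` for every abc triple) already follows from the class bound at the
ODD primes `p ≥ 3` alone, with no archimedean input: if `c` is odd expand `c`, otherwise `a, b` are odd,
and (for `a < b`) `c < 2b`, so expand `b` (`b ∣ c² − a²`); `log 2` is absorbed by the constant. This
dispenses the `p`-adic core with the prime `2` (where the `2`-descent points `s/2^J` leave `ℤ₂`).
[cite: StewartTijdeman1986, Theorem 1 (upper bound), as quoted in Waldschmidt2014 §2 (PDF p. 3) (socket A⁺ at the odd primes ⇒ BakerShapeBound)] -/
theorem bakerShapeBound_of_oddPrimePadicBound_general {K L κ σ : ℝ} {τ₀ τ₁ : ℕ} (hK : 0 ≤ K)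
    (hL : 1 ≤ L) (hκ0 : 0 ≤ κ) (hσ0 : 0 ≤ σ)
    (hP : ∀ (p n : ℕ) (q : Fin n → ℕ) (e : Fin n → ℤ), p.Prime → 3 ≤ p →
      (∀ i, (q i).Prime) → Function.Injective q → (∀ i, q i ≠ p) → e ≠ 0 →
      ∏ i, ((q i : ℚ)) ^ e i ≠ 1 →
      (padicValRat p (∏ i, ((q i : ℚ)) ^ e i - 1) : ℝ) ≤
        K * L ^ n * (n : ℝ) ^ (κ * n) * (p : ℝ) ^ σ * (∏ i, Real.log (q i)) *
          (Real.log (max 3 ((Finset.univ.sup fun i => (e i).natAbs : ℕ) : ℝ)) + Real.log p +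
            ∑ i, Real.log (q i)) ^ (τ₀ + τ₁ * n)) :
    BakerShapeBound (κ + σ + 3 * τ₁ + 1) 0 := by
  classical
  set θ : ℝ := κ + σ + 3 * τ₁ + 1 with hθ
  set μ : ℝ := κ + σ + 3 * τ₁ + 5 / 8 with hμ
  have hθ1 : 1 ≤ θ := by
    rw [hθ]; have : (0 : ℝ) ≤ 3 * (τ₁ : ℝ) := by positivity
    linarith
  have hθ0 : 0 < θ := by linarith
  have hμ0 : 0 ≤ μ := by rw [hμ]; positivity
  set δ : ℝ := 1 / (8 * θ) with hδ
  have hδ0 : 0 < δ := by rw [hδ]; positivity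
  have hδθ : δ * θ = 1 / 8 := by rw [hδ]; field_simp
  have hδ1 : δ ≤ 1 := by
    rw [hδ, div_le_one (by positivity)]; linarith
  have h2δ : 2 * δ < 1 := by
    have : δ ≤ 1 / 8 := by rw [hδ]; exact one_div_le_one_div_of_le (by norm_num) (by linarith)
    linarith
  have hμθ : μ ≤ θ * (1 - 2 * δ) := by
    have : θ * (1 - 2 * δ) = θ - 2 * (δ * θ) := by ring
    rw [this, hδθ, hμ, hθ]; linarith
  set C₀ : ℝ := 4 * L * Real.exp κ * (((τ₁ : ℝ) + 1) / δ) ^ τ₁ with hC₀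
  have hC₀1 : 1 ≤ C₀ := by
    have h1 : 1 ≤ 4 * L * Real.exp κ := by
      nlinarith [Real.one_le_exp hκ0]
    have h2 : (1 : ℝ) ≤ ((τ₁ : ℝ) + 1) / δ := by
      rw [le_div_iff₀ hδ0]; nlinarith
    rw [hC₀]
    exact one_le_mul_of_one_le_of_one_le h1 (one_le_pow₀ h2)
  obtain ⟨A, hA1, hA⟩ := exists_pow_card_le_prod_rpow hC₀1 (by norm_num : (0 : ℝ) < 1 / 8)
  have hA0 : 0 ≤ A := zero_le_one.trans hA1
  set M₀ : ℝ := 48 * K * A * Real.exp τ₁ * (16 * ((τ₀ : ℝ) + 1)) ^ τ₀ with hM₀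
  have hM₀0 : 0 ≤ M₀ := by rw [hM₀]; positivity
  refine bakerShapeBound_of_loglog_rpow (μ := μ) (τ := τ₀) (M := 3 * M₀ + 1) hμ0 hδ0 h2δ hμθ
    (by positivity) fun a b c ht => ?_
  -- symmetric in `a, b`: reduce to `a ≤ b`
  have hR1 : (1 : ℝ) ≤ (rad a b c : ℝ) := one_le_rad_real a b c
  have hRμ : (1 : ℝ) ≤ (rad a b c : ℝ) ^ μ := Real.one_le_rpow hR1 hμ0
  set Y : ℝ := max 3 (Real.log c) with hYdef
  have hY3 : (3 : ℝ) ≤ Y := le_max_left _ _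
  have hY1 : (1 : ℝ) ≤ Y := le_trans (by norm_num) hY3
  have hl3 : 1 ≤ Real.log 3 := by
    rw [Real.le_log_iff_exp_le (by norm_num)]
    exact Real.exp_one_lt_d9.le.trans (by norm_num)
  have hlogY1 : 1 ≤ Real.log Y := hl3.trans (Real.log_le_log (by norm_num) hY3)
  have hYδ : 1 ≤ Y ^ δ := Real.one_le_rpow hY1 hδ0.le
  have hlogYτ : 1 ≤ Real.log Y ^ τ₀ := one_le_pow₀ hlogY1
  have hbig : 1 ≤ (rad a b c : ℝ) ^ μ * Y ^ δ * Real.log Y ^ τ₀ :=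
    one_le_mul_of_one_le_of_one_le (one_le_mul_of_one_le_of_one_le hRμ hYδ) hlogYτ
  have hbig0 : 0 ≤ (rad a b c : ℝ) ^ μ * Y ^ δ * Real.log Y ^ τ₀ := zero_le_one.trans hbig
  -- the key bound for `a' < b'` (applied to `(a, b)` or `(b, a)`)
  have key : ∀ {a' b' : ℕ}, IsABCTriple a' b' c → a' < b' → rad a' b' c = rad a b c →
      Real.log c ≤ (3 * M₀ + 1) * (rad a b c : ℝ) ^ μ * Y ^ δ * Real.log Y ^ τ₀ := by
    intro a' b' ht' hab hradeq
    obtain ⟨ha, hb, habc, hcop⟩ := ht'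
    have hc0 : c ≠ 0 := by omega
    have hcpos : (0 : ℝ) < c := by exact_mod_cast (show 0 < c by omega)
    have hac : Nat.Coprime a' c := by rw [← habc]; exact Nat.coprime_self_add_right.mpr hcop
    have hbc : Nat.Coprime b' c := by rw [← habc]; exact Nat.coprime_add_self_right.mpr hcop.symm
    have hrad3 : ∀ x y z : ℕ, x * (y * z) = a' * b' * c →
        (((∏ q ∈ (x * (y * z)).primeFactors, q : ℕ)) : ℝ) = (rad a b c : ℝ) := by
      intro x y z hxyz
      rw [← hradeq, rad_def, Nat.radical_eq_prod_primeFactors, hxyz]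
    by_cases h2c : 2 ∣ c
    · -- `c` even: `a', b'` odd, expand `b'` (`b' ∣ c² − a'²`, `c < 2 b'`)
      have hb_odd : ¬ 2 ∣ b' := fun h =>
        (Nat.Prime.one_lt Nat.prime_two).ne' (Nat.eq_one_of_dvd_coprimes hbc h h2c)
      have hcopb : Nat.Coprime b' (c * a') := Nat.Coprime.mul_right hbc hcop.symm
      have hdvd : (b' : ℤ) ∣ (c : ℤ) ^ 2 - (a' : ℤ) ^ 2 :=
        ⟨(c : ℤ) + a', by rw [← habc]; push_cast; ring⟩
      have hca : c ≠ a' := by omega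
      have hmem := log_oddMember_le (c := c) hK hL hκ0 hσ0 hδ0 hδ1 hP hA0 hA hb (by omega) ha hca
        hac.symm hcopb hdvd hb_odd le_rfl (by omega)
      rw [hrad3 b' c a' (by ring)] at hmem
      have hc2b : (c : ℝ) ≤ 2 * b' := by exact_mod_cast (show c ≤ 2 * b' by omega)
      have hlogc : Real.log c ≤ Real.log 2 + Real.log b' := by
        rw [← Real.log_mul (by norm_num) (by exact_mod_cast hb.ne')]
        exact Real.log_le_log hcpos hc2b
      have hlog2 : Real.log 2 ≤ 1 := by linarith [Real.log_two_lt_d9]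
      calc Real.log c ≤ Real.log 2 + Real.log b' := hlogc
        _ ≤ 1 * ((rad a b c : ℝ) ^ μ * Y ^ δ * Real.log Y ^ τ₀) +
              3 * M₀ * (rad a b c : ℝ) ^ μ * Y ^ δ * Real.log Y ^ τ₀ := by
            apply add_le_add
            · rw [one_mul]; exact hlog2.trans hbig
            · rw [hM₀, hμ]; exact hmem
        _ = (3 * M₀ + 1) * (rad a b c : ℝ) ^ μ * Y ^ δ * Real.log Y ^ τ₀ := by ring
    · -- `c` odd: expand `c` (`c ∣ a'² − b'²`)
      have hcopc : Nat.Coprime c (a' * b') := (Nat.Coprime.mul_left hac hbc).symm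
      have hdvd : (c : ℤ) ∣ (a' : ℤ) ^ 2 - (b' : ℤ) ^ 2 :=
        ⟨(a' : ℤ) - b', by rw [← habc]; push_cast; ring⟩
      have hmem := log_oddMember_le (c := c) hK hL hκ0 hσ0 hδ0 hδ1 hP hA0 hA (by omega) ha hb
        (by omega) hcop hcopc hdvd h2c (by omega) (by omega)
      rw [hrad3 c a' b' (by ring)] at hmem
      calc Real.log c ≤ 3 * M₀ * (rad a b c : ℝ) ^ μ * Y ^ δ * Real.log Y ^ τ₀ := by
            rw [hM₀, hμ]; exact hmem
        _ ≤ (3 * M₀ + 1) * (rad a b c : ℝ) ^ μ * Y ^ δ * Real.log Y ^ τ₀ := by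
            have : 0 ≤ 1 * ((rad a b c : ℝ) ^ μ * Y ^ δ * Real.log Y ^ τ₀) := by positivity
            nlinarith
  obtain ⟨ha, hb, habc, hcop⟩ := ht
  rcases lt_trichotomy a b with hab | rfl | hba
  · exact key ⟨ha, hb, habc, hcop⟩ hab rfl
  · -- `a = b = 1`, `c = 2`
    have ha1 : a = 1 := Nat.Coprime.eq_one_of_dvd hcop (dvd_refl a)
    have hc2 : c = 2 := by omega
    subst hc2
    have h2 : Real.log ((2 : ℕ) : ℝ) ≤ 1 := by
      push_cast; linarith only [Real.log_two_lt_d9]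
    have h1 : (1 : ℝ) ≤ 3 * M₀ + 1 := by linarith
    calc Real.log ((2 : ℕ) : ℝ) ≤ 1 := h2
      _ ≤ (3 * M₀ + 1) * ((rad a a 2 : ℝ) ^ μ * Y ^ δ * Real.log Y ^ τ₀) :=
          one_le_mul_of_one_le_of_one_le h1 hbig
      _ = (3 * M₀ + 1) * (rad a a 2 : ℝ) ^ μ * Y ^ δ * Real.log Y ^ τ₀ := by ring
  · have hrad : rad b a c = rad a b c := by rw [rad_def, rad_def, mul_comm b a]
    exact key ⟨hb, ha, by omega, hcop.symm⟩ hba hrad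

/-- **The `_logRad` shape at the odd primes suffices.** If for every odd prime `p`, all distinct primes
`qᵢ ≠ p` and `e ≠ 0` with `∏ qᵢ^{eᵢ} ≠ 1`,
`ord_p(∏ qᵢ^{eᵢ} − 1) ≤ K Lⁿ n^{κn} p^σ (∏ log qᵢ) (log max(3, max|eᵢ|))^τ (log max(3, ∏ qᵢ))^{τ₁}`
(the one-prime hypothesis of `Literature.Barriers.ABC.stewartTijdeman1986_of_primePadicBound_logRad`,
= `AbcStewartYuPlan.PrimePadicBoundAt p K L κ σ τ τ₁` of the cell's skeleton), then
`BakerShapeBound (κ + σ + 1) 0`; since `log max(3, max|eᵢ|), log max(3, ∏ qᵢ) ≤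
log max(3, max|eᵢ|) + log p + ∑ log qᵢ`, this is `bakerShapeBound_of_oddPrimePadicBound_general` with
`τ₀ = τ + τ₁`, `τ₁ = 0`. [cite: StewartTijdeman1986, Theorem 1 (upper bound), as quoted in Waldschmidt2014 §2 (PDF p. 3) (socket A⁺ at the odd primes ⇒ BakerShapeBound)] -/
theorem bakerShapeBound_of_oddPrime_logRadShape {K L κ σ : ℝ} {τ τ₁ : ℕ} (hK : 0 ≤ K) (hL : 1 ≤ L)
    (hκ0 : 0 ≤ κ) (hσ0 : 0 ≤ σ)
    (hP : ∀ (p : ℕ), p.Prime → p ≠ 2 → ∀ (n : ℕ) (q : Fin n → ℕ) (e : Fin n → ℤ),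
      (∀ i, (q i).Prime) → Function.Injective q → (∀ i, q i ≠ p) → e ≠ 0 →
      ∏ i, ((q i : ℚ)) ^ e i ≠ 1 →
      (padicValRat p (∏ i, ((q i : ℚ)) ^ e i - 1) : ℝ) ≤
        K * L ^ n * (n : ℝ) ^ (κ * n) * (p : ℝ) ^ σ * (∏ i, Real.log (q i)) *
          Real.log (max 3 ((Finset.univ.sup fun i => (e i).natAbs : ℕ) : ℝ)) ^ τ *
          Real.log (max 3 (∏ i, ((q i : ℕ) : ℝ))) ^ τ₁) :
    BakerShapeBound (κ + σ + 1) 0 := by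
  have h := bakerShapeBound_of_oddPrimePadicBound_general (τ₀ := τ + τ₁) (τ₁ := 0) hK hL hκ0 hσ0
    (fun p n q e hp hp3 hq hinj hqp he hne1 => by
      have hp2 : p ≠ 2 := by omega
      have key := hP p hp hp2 n q e hq hinj hqp he hne1
      refine key.trans ?_
      -- compare the logarithmic factors
      set S : ℝ := Real.log (max 3 ((Finset.univ.sup fun i => (e i).natAbs : ℕ) : ℝ)) + Real.log p +
        ∑ i, Real.log (q i) with hS
      have hl3 : 1 ≤ Real.log 3 := by
        rw [Real.le_log_iff_exp_le (by norm_num)]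
        exact Real.exp_one_lt_d9.le.trans (by norm_num)
      have hLB3 : Real.log 3 ≤ Real.log (max 3 ((Finset.univ.sup fun i => (e i).natAbs : ℕ) : ℝ)) :=
        Real.log_le_log (by norm_num) (le_max_left _ _)
      have hLB0 : 0 ≤ Real.log (max 3 ((Finset.univ.sup fun i => (e i).natAbs : ℕ) : ℝ)) := by
        linarith
      have hlp0 : 0 ≤ Real.log p := Real.log_nonneg (by exact_mod_cast hp.one_lt.le)
      have hsum0 : 0 ≤ ∑ i, Real.log (q i) := Finset.sum_nonneg fun i _ =>
        Real.log_nonneg (by exact_mod_cast (hq i).one_lt.le)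
      have hLB_le : Real.log (max 3 ((Finset.univ.sup fun i => (e i).natAbs : ℕ) : ℝ)) ≤ S := by
        rw [hS]; linarith
      have hP1 : (1 : ℝ) ≤ ∏ i, ((q i : ℕ) : ℝ) := by
        rw [← Nat.cast_prod]; exact_mod_cast Finset.prod_pos fun i _ => (hq i).pos
      have hLQ_le : Real.log (max 3 (∏ i, ((q i : ℕ) : ℝ))) ≤ S := by
        have hle : max 3 (∏ i, ((q i : ℕ) : ℝ)) ≤ 3 * ∏ i, ((q i : ℕ) : ℝ) :=
          max_le (by linarith) (by linarith)
        have hlogP : Real.log (∏ i, ((q i : ℕ) : ℝ)) = ∑ i, Real.log (q i) :=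
          Real.log_prod (s := Finset.univ) (fun i _ => by exact_mod_cast (hq i).ne_zero)
        calc Real.log (max 3 (∏ i, ((q i : ℕ) : ℝ))) ≤ Real.log (3 * ∏ i, ((q i : ℕ) : ℝ)) :=
              Real.log_le_log (lt_of_lt_of_le (by norm_num) (le_max_left _ _)) hle
          _ = Real.log 3 + ∑ i, Real.log (q i) := by
              rw [Real.log_mul (by norm_num) (by linarith), hlogP]
          _ ≤ S := by rw [hS]; linarith
      have hLQ0 : 0 ≤ Real.log (max 3 (∏ i, ((q i : ℕ) : ℝ))) :=
        Real.log_nonneg (le_trans (by norm_num) (le_max_left _ _))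
      have hlogs : Real.log (max 3 ((Finset.univ.sup fun i => (e i).natAbs : ℕ) : ℝ)) ^ τ *
          Real.log (max 3 (∏ i, ((q i : ℕ) : ℝ))) ^ τ₁ ≤ S ^ (τ + τ₁ + 0 * n) := by
        rw [zero_mul, add_zero, pow_add]
        exact mul_le_mul (pow_le_pow_left₀ hLB0 hLB_le τ) (pow_le_pow_left₀ hLQ0 hLQ_le τ₁)
          (pow_nonneg hLQ0 τ₁) (pow_nonneg (hLB0.trans hLB_le) τ)
      have hpre : 0 ≤ K * L ^ n * (n : ℝ) ^ (κ * n) * (p : ℝ) ^ σ * (∏ i, Real.log (q i)) := by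
        have : 0 ≤ L ^ n := pow_nonneg (zero_le_one.trans hL) n
        have : 0 ≤ ∏ i, Real.log (q i) := Finset.prod_nonneg fun i _ =>
          Real.log_nonneg (by exact_mod_cast (hq i).one_lt.le)
        positivity
      calc K * L ^ n * (n : ℝ) ^ (κ * n) * (p : ℝ) ^ σ * (∏ i, Real.log (q i)) *
            Real.log (max 3 ((Finset.univ.sup fun i => (e i).natAbs : ℕ) : ℝ)) ^ τ *
            Real.log (max 3 (∏ i, ((q i : ℕ) : ℝ))) ^ τ₁
          = K * L ^ n * (n : ℝ) ^ (κ * n) * (p : ℝ) ^ σ * (∏ i, Real.log (q i)) *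
            (Real.log (max 3 ((Finset.univ.sup fun i => (e i).natAbs : ℕ) : ℝ)) ^ τ *
            Real.log (max 3 (∏ i, ((q i : ℕ) : ℝ))) ^ τ₁) := by ring
        _ ≤ K * L ^ n * (n : ℝ) ^ (κ * n) * (p : ℝ) ^ σ * (∏ i, Real.log (q i)) *
            S ^ (τ + τ₁ + 0 * n) := mul_le_mul_of_nonneg_left hlogs hpre)
  simpa using h

end Literature.NumberTheory.Transcendental.StewartYu

end Part11

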